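import Literature.Computability.AlgebraicComplexity.PowerSumLowDegreeIdeal
import Literature.Computability.AlgebraicComplexity.ChowVersusPowerSumsProofs
import Literature.Computability.AlgebraicComplexity.HwvIdealRankBound
import Literature.Computability.AlgebraicComplexity.FewLetterEquations
import Literature.Computability.AlgebraicComplexity.PowerSumNonvanishing
import Literature.Computability.AlgebraicComplexity.RankMethodBarriers
import Mathlib.Analysis.Complex.Polynomial.Basic
import Mathlib.RingTheory.PowerSeries.Inverse
import Literature.RingTheory.MvPolynomial.HomogeneousHilbertFunction
import HarnessLib

/-!
# Dörfler–Ikenmeyer–Panova 2020 typed as printed: the Chow variety versus power sums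
# (Thm. 2.3 (2), Props. 3.2–3.15, eq. (2.2), (3.8), (3.11), (4.3)–(4.4), Props. 4.5, 4.7, Cor. 4.8, Prop. 5.1, Prop. 7.1)

Topic `Literature/Computability/AlgebraicComplexity` (val-lit cell, DAG row DIP20-A, EXTEND). Source:
J. Dörfler, C. Ikenmeyer, G. Panova, *On geometric complexity theory: Multiplicity obstructions are
stronger than occurrence obstructions*, SIAM J. Appl. Algebra Geom. 4 (2020) 354–376 = ICALP 2019 =
arXiv:1901.04576 (v1, the only arXiv version; key `DorflerIkenmeyerPanova2020`). NUMBERING: the arXiv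
TeX shares one counter per section between equations and statements (`\newtheorem{…}[equation]`),
giving Thm. 2.3, Rem. 2.4, (3.1), Prop. 3.2, Prop. 3.3, Lemma 3.4, Thm. 3.5, (3.6), Lemma 3.7, (3.8),
Prop. 3.9, Prop. 3.10, (3.11), Prop. 3.12, Lemma 3.13, Prop. 3.14, Prop. 3.15, (4.1)–(4.4), Prop. 4.5,
Prop. 4.6, Prop. 4.7, Cor. 4.8, Prop. 5.1, (5.2)–(5.10), Prop. 7.1 — confirmed on the arXiv PDF
(cross-references "Prop. 3.15", "Corollary 4.8", "Proposition 7.1" on pp. 4–12); this is also the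
numbering of the tree's earlier files (`DIP2020_thm_2_3_1`, `DIP2020_prop_3_3`). The HELD text
`paper-arxiv-1901.04576` (TeX chunks) numbers SEQUENTIALLY ("Theorem 1", "Proposition 3", …,
"Proposition 19"); every docstring carries both locators («arXiv p. N; held pNNNN.txt:Lnn»).

HONEST FRAMING. Typed literature for a TOY MODEL (Chow variety versus power sums / higher secants of
the Veronese): the first published setting where multiplicity obstructions provably do more than
occurrence obstructions. Nothing here bears on permanent versus determinant beyond method
validation; VP ≠ VNP is not proved and nothing in this file is progress on it.

## What the tree already has (CITED, not restated)

* Thm. 2.3 (1) = `DIP2020_thm_2_3_1` (`ChowVersusPowerSums.lean`; DISCHARGED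
  `DIP2020_thm_2_3_1_holds`, `ChowVersusPowerSumsProofs.lean`) in the orbit-closure range `m ≥ n+1`,
  with `x₁⋯x_n = truncatedChowMonomial`, `x₁^n+⋯+x_k^n = partialPowerSum`, `λ = dipPartition n`.
* Prop. 3.3 in the range `d ≤ k ≤ m` = `DIP2020_prop_3_3` (DISCHARGED `DIP2020_prop_3_3_holds`,
  `PowerSumLowDegreeIdeal.lean`).
* §2's definitions of multiplicity / occurrence obstruction (orbit-closure form):
  `IsMultiplicityObstructionAt`, `IsOccurrenceObstructionAt`, `IsVanishingIdealOccurrenceObstructionAt`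
  (`ObstructionTypes.lean`); (2.2)/§5 rank–nullity `orbitMultiplicity_add_finrank_inf_eq_plethysmCoeff`
  (`HwvIdealRankBound.lean`); (5.2) Schur–Weyl and (5.3) `mult = dim HWV` are the tree's
  `SchurWeylPlethysm.lean` / `hwMultiplicity`; the tableau contraction (5.8) is `PlethysmTableauEvaluation.lean`.

## Why sets (the one piece of new vocabulary)

DIP's `Ch_m^n` (products of `n` linear forms in `m` variables) and `Pow_{m,k}^n` (border Waring rank
`≤ k`) are orbit closures of ONE form in `m` variables only when `n ≤ m`, resp. `k ≤ m`; the finite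
settings of Thm. 2.3 (2) (`m = 3, n = 6`; `m = 4, n = 7`), Prop. 3.12, Prop. 3.15 and Prop. 5.1 live
outside that range (this is why `ChowVersusPowerSums.lean` recorded them as "NOT here"). Here
`chowSet k m n`, `powerSumSet k m r n` are SETS of forms, and `coordRingMultiplicity k Z n χ :=
a_χ - dim (HWV_χ(k[Sym^n]) ∩ I(Z))` renders `mult_χ(k[Z̄])` numerically — DIP's own reading (5.3)–(5.4).
PROVED bridges: it equals the tree's `orbitMultiplicity` whenever `GL·f ⊆ Z ⊆ End·f`
(`coordRingMultiplicity_eq_orbitMultiplicity`), in particular for `Ch_m^n`, `n ≤ m`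
(`coordRingMultiplicity_chowSet`) and `Pow_{m,r}^n`, `r ≤ m` (`coordRingMultiplicity_powerSumSet`); it
is monotone in `Z` (`coordRingMultiplicity_mono` = DIP (2.2), the obstruction principle, in set form);
and Prop. 3.3 holds AS PRINTED, for every `m` (`coordRingMultiplicity_powerSumSet_dualOfPartition`, from
BIP 2019 Prop. 3.2 = `exists_aeval_formCoeff_sum_linearFormPow_ne_zero`). Partitions ranging over
semigroups are row vectors `μ : Fin m → ℕ` with dual weight `rowDual μ` (= `Weight.dualOfPartition` on
sorted parts, `rowDual_sortedParts`); "`a_μ(d[n])`" is `plethysmCoeff ℂ (Fin m) n (rowDual μ)` (inner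
degree `n`; the outer degree `d = |μ|/n` is pinned by the weight), "`a_μ(n[d])`" has inner degree `d`.

## What is typed (source item → Lean decl → status; `-- FACT` = named `def … : Prop`, D-0014)

| printed | decl | status |
|---|---|---|
| §2 `Ch_m^n`, `Pow_{m,k}^n`, `mult_λ(ℂ[Z]_d)` | `chowSet`, `powerSumSet`, `coordRingMultiplicity`, `rowDual` | definitions + proved API |
| (2.2) obstruction principle | `coordRingMultiplicity_mono` | PROVED |
| Thm. 2.3 (1), every `m ≥ 3` | `dip20_thm_2_3_1_sets` (`m ≥ n+1`, from `DIP2020_thm_2_3_1_holds`), `dip20_thm_2_3_1_sets_all` (§I, `3 ≤ m ≤ n` by few letters), `powerSumSet_not_subset_chowSet` | PROVED |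
| Lemma 3.4, in-proof identity `mult_λ(ℂ[Ch_m^n]_d) = mult_λ(ℂ[\overline{GL_n x₁⋯x_n}]_d)` | `coordRingMultiplicity_chowSet_dualOfPartition` (§I; `vanishingIdeal_chowSet_eq_letterPart`) | PROVED |
| Thm. 2.3 (2)(a), (2)(b) incl. the no-occurrence clauses (3.6) | `DIP20_thm_2_3_2a`, `DIP20_thm_2_3_2b`; §N: the no-occurrence clauses PROVED from Props. 3.9 / 7.1 + 5.1 (`dip20_eq_3_6_of_prop_3_9_of_prop_5_1`, `dip20_noOccurrence47_of_prop_7_1_of_prop_5_1`), the Chow side of (2)(b) from Prop. 3.2 (`dip20_thm_2_3_2b_chow_lt_of_prop_3_2`), assemblies `DIP20_thm_2_3_2a_of_facts` / `DIP20_thm_2_3_2b_of_facts`; §O: few letters for power sums (`coordRingMultiplicity_powerSumSet_dualOfPartition_eq_of_le`, inheritance in `m`) ⇒ `DIP20_thm_2_3_2b_of_facts'` : (2)(b) ⇐ Props. 3.2, 7.1, 5.1; sibling `DIP20PlethysmValues.lean`: the Chow sides UNCONDITIONAL (`coordRingMultiplicity_chowSet_three_six_dipPartition_le` (≤ 7),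 `dip20_thm_2_3_2b_chow_lt` (< 11, = conjunct 1 of (2)(b) PROVED), via Lemma 3.4 and the values `a(6[7]) = 7`, `a(7[8]) = 10`), `DIP20_thm_2_3_2a_of_values`, `DIP20_thm_2_3_2b_of_values` | FACT (computer); reductions PROVED; (2)(b) conjunct 1 PROVED |
| Prop. 3.2 | `DIP20_prop_3_2`; sibling `DIP20PlethysmValues.lean`: the plethysm conjuncts `a_{(34,6,2)}(7[6]) = 8`, `a_{(47,7,2)}(8[7]) = 11` PROVED in the kernel (`plethysmCoeffOfPartition_dipPartition_six/_seven`), `DIP20_prop_3_2_of_lower_bounds` (⇐ the two certificate lower bounds only) | FACT (computer; certificate-shaped) — plethysm halves PROVED |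
| Prop. 3.3 (every `m`) | `coordRingMultiplicity_powerSumSet_dualOfPartition` | PROVED |
| Lemma 3.4 (inner degree `d ≥ 1`; guard `0 < d`, see the docstring) | `DIP20_lem_3_4` + `DIP20_lem_3_4_holds` (sibling file `DIP20ChowUpperBoundProofs.lean`, val-lit-p6: Hadamard–Howe pullback + plethysm bridge, `orbitMultiplicity_prod_X_le_plethysmCoeff`) | DISCHARGED (sibling file) |
| Thm. 3.5 | `DIP20_thm_3_5` + **`DIP20_thm_3_5_holds`** (sibling `DIP20KeyDifferenceFormula.lean`, through §Q `DIP20_thm_3_5_of_prop_4_7` and `DIP20_prop_4_7_holds`; for `2 ≤ n ≤ 7` also by kernel values, `DIP20_thm_3_5_of_le_seven` in `DIP20PlethysmValues.lean`) | DISCHARGED (sibling file) |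
| Lemma 3.7, Lemma 3.13 | `DIP20_lem_3_7`, `DIP20_lem_3_13` (`dipTails36`, `dipTails47`) | FACT |
| (3.8) semigroup property of plethysm positivity | `DIP20_eq_3_8` + `DIP20_eq_3_8_holds` | DISCHARGED here |
| (3.11) semigroup property for `ℂ[Ch_m^n]` | `DIP20_eq_3_11` + `DIP20_eq_3_11_holds` (§H: `I(Ch_m^n)` is prime, `isPrime_vanishingIdeal_chowSet`) | DISCHARGED here |
| Prop. 3.9, Prop. 7.1 (generators `X`) | `DIP20_prop_3_9`, `DIP20_prop_7_1`; data `dipGeneratorRows36` (89), `dipGeneratorRows47` (948); §P: the `←` halves reduce to the positivity of the generators (`DIP20_prop_3_9_mpr_of_generators_pos`, `DIP20_prop_7_1_mpr_of_generators_pos`, certificate interface) | FACT (LiE) |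
| Prop. 3.10, Prop. 3.14 | `DIP20_prop_3_10`, `DIP20_prop_3_14` — DISCHARGED in the sibling files `DIP20PlethysmSemigroupGenerators.lean` (`DIP20_prop_3_10_holds`, 832 kernel-checked certificates) and `DIP20PlethysmSemigroupGenerators47*.lean` (`DIP20_prop_3_14_holds`, 10294 certificates) | DISCHARGED (sibling files) |
| Prop. 3.12 | `DIP20_prop_3_12` + `DIP20_prop_3_12_holds` (§K binary forms split: `chowSet_two_eq`, `coordRingMultiplicity_chowSet_two`; §L inheritance `Ch_2^n → Ch_3^n`) | DISCHARGED here |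
| Prop. 3.15 (+ table) | `DIP20_prop_3_15`, `DIP20_prop_3_15_table`; sibling file `DIP20ToyModelOccurrenceObstructions.lean`: `DIP20_prop_3_15_of_table : DIP20_prop_3_15_table → DIP20_prop_3_15` (Lemma 3.4 + §J), row 1's Chow side PROVED outright (`coordRingMultiplicity_chowSet_three_two_222`), certificate interface `DIP20_prop_3_15_of_plethysm_bounds` (five positivity + four vanishing plethysm values suffice); sibling `DIP20PlethysmValues.lean`: rows 1–2 PROVED (`DIP20_prop_3_15_row1/row2`, `DIP20_prop_3_15_table_row1/row2`), `DIP20_prop_3_15_of_rows345` | FACT ⇐ rows 3–5 of the printed table (see errata); rows 1–2 PROVED |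
| (4.3) `c_ν(d,n)`, `p_r(a,b)`, `binom_q` | `dipMonomialCount`, `boxPartitionCount`, `gaussBinomial` | definitions |
| (4.4) Jacobi–Trudi for `a_λ(d[n])` | `DIP20_eq_4_4` + `DIP20_eq_4_4_holds` (sibling `DIP20PlethysmCountingFormulaProofs.lean`, val-lit-p6) | DISCHARGED (sibling file) |
| Prop. 4.5 (i),(ii) | `DIP20_prop_4_5` + `DIP20_prop_4_5_holds` (sibling file `DIP20MonomialCounts.lean`: bijections of the printed proof, transpose symmetry `p_r(a,b) = p_r(b,a)`; §F there: `q`-Pascal, absorption and the printed product formula of `binom(a+b,a)_q` as theorems; §G there: (iii) in its CORRECTED form PROVED, `dipMonomialCount_row_two_two_cast`) | DISCHARGED (sibling file); (iii) corrected & PROVED (see errata) |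
| Prop. 4.6 | — | not typed (errata) |
| Prop. 4.7 | `DIP20_prop_4_7` + **`DIP20_prop_4_7_holds`** (sibling `DIP20KeyDifferenceFormula.lean`: (4.4) written out over `𝔖₃`, Prop. 4.5 (i)(ii)(iii corrected), the `ν₃ = 0, 1` terms cancel by symmetry in `(n,d)`, `q`-binomial absorption; printed route) | DISCHARGED (sibling file) |
| Cor. 4.8, `p_26(9,6) = 227 = p_27(9,6)` | `DIP20_cor_4_8` (FACT, ranges per errata; §Q: clauses `r < n`, `r = n` ⇐ Prop. 4.7, `dip_cor48_diff_of_prop_4_7`; sibling `DIP20KeyDifferenceFormula.lean`: clauses `r < n`, `r = n`, `(8,35)` PROVED (`dip20_cor_4_8_of_lt/_of_eq/_eight_thirtyfive`), the `r > n` difference `= p_{r-n}(n+1,n-2) - p_{r-n-1}(n+1,n-2)` PROVED (`dip20_cor_4_8_diff_eq_boxCounts`), the fact ⇐ exactly Gaussian unimodality (`DIP20_cor_4_8_of_gaussian_unimodality`)), `DIP20_cor_4_8_boxCounts` + `DIP20_cor_4_8_boxCounts_holds` (§M: `boxPartitionCount_eq_boxCount`, kernel) | FACT (⇐ unimodality of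 `p_k(n+1,n-2)` only) / DISCHARGED here |
| Prop. 5.1 | `DIP20_prop_5_1` | FACT (computer; certificate-shaped, tableaux printed in §8) |

## Print errata candidates found while typing (desk computation, two independent evaluations of the
## plethysm coefficients: DIP's own counting formula (4.3)–(4.4) and Vandermonde extraction,
## both validated on `h₃[h₃]`, `h₄[h₂]`, `h₂[h₄]`, `h₃[h₄]`; scripts kept in the typing session folder)

* E1 (Prop. 3.15, table p. 8): `a_{(14,14,13,13)}(9[6])` is printed `11`; it evaluates to `19`. Only
  its positivity is used (and typed).
* E2 (Prop. 4.5 (iii), p. 9, and hence Prop. 4.6, p. 11): in `c_{(L,k,2)}` the factor `binom(n,1)_q` of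
  the first summand should be `binom(n,1)_{q²}` (the case `b_i = 2` of the printed proof); Prop. 4.6's
  `binom(n+d-2,n)_q`-coefficient should accordingly read `q(1-q^n)(1-q^{n+1})/(1-q²)`. Both corrected
  readings agree with direct evaluation for `2 ≤ n, d ≤ 6`; Prop. 4.7 and everything downstream
  (Cor. 4.8's values, Thm. 3.5, Thm. 2.3) are unaffected and reproduce. The misprinted (iii)/4.6 are
  not typed.
* E3/E4 (Cor. 4.8, p. 12): "`> 0` when `r > n` and `n ≥ 7`" fails at `r = n+1` (the printed proof's own
  value `p_1 - p_0 = 0`) and at the unlisted exception `(n, r) = (9, 44)` (`a_{(44,44,2)}(10[9]) =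
  a_{(44,44,2)}(9[10]) = 109`; `binom(17,7)_q` has `p_34 = p_35 = 734`); the printed exception `(8, 35)`
  is confirmed (`p_26(9,6) = p_27(9,6) = 227`, difference `26 - 26`). Typed with `n+2 ≤ r` and both
  exceptions excluded; no other zero for `7 ≤ n ≤ 60` (Pak–Panova strict unimodality covers `n ≥ 10`).
* Also reproduced: Thm. 3.5 for `n = 2,…,6`; Prop. 3.2's `a_{(34,6,2)}(7[6]) = 8`, `a_{(47,7,2)}(8[7]) = 11`;
  Prop. 3.15 rows 1–4 and `a_{(14,14,13,13)}(6[9]) = 0`; Lemmas 3.7/3.13: no nonzero value for `n ≤ 7`,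
  `d ≤ 8`; Prop. 3.9's semigroup description for `d ≤ 5` (so the 89 rows are transcribed faithfully).

## NOT typed, and why

* (2.1) Foulkes' conjecture ("`a_λ(n[d]) ≤ a_λ(d[n])` for all `d ≥ n`", p. 3): an OPEN conjecture —
  conjectures live in `Summits/…/Theorems` as `@[conjecture]` leaves, not in Literature; no route uses it.
  Hermite reciprocity (2-row equality, [Her1854]) is cited by DIP, not one of its numbered statements.
* Prop. 4.6 and Prop. 4.5 (iii) as printed (errata E2); (5.5)–(5.10) (algorithmics: dynamic programming
  over placements, cache size); the tableaux of §6 and §8 (certificate DATA for Props. 3.2, 5.1 — the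
  discharge route for `DIP20_prop_3_2`, `DIP20_prop_5_1`, not statements); the partial computation for
  `(n, k, m) = (7, 8, 5)` reported on p. 7 (5016 generators found, incomplete — not a statement).

## References

* J. Dörfler, C. Ikenmeyer, G. Panova, *On geometric complexity theory: Multiplicity obstructions are
  stronger than occurrence obstructions*, SIAM J. Appl. Algebra Geom. 4 (2020) 354–376; arXiv:1901.04576.
  [DorflerIkenmeyerPanova2020]
* P. Bürgisser, C. Ikenmeyer, G. Panova, *No occurrence obstructions in geometric complexity theory*,
  J. AMS 32 (2019), Prop. 3.2. [BurgisserIkenmeyerPanovaJAMS2019]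
* C. Ikenmeyer, G. Panova, *Rectangular Kronecker coefficients and plethysms in geometric complexity
  theory*, Adv. Math. 319 (2017), Thm. 1.7 (a) (= DIP's [IP17, Thm. 1.10 (a)]). [IkenmeyerPanova2017]
* I. Pak, G. Panova, *Strict unimodality of q-binomial coefficients*, C. R. Math. Acad. Sci. Paris 351
  (2013) 415–418 (DIP's [PP13], used in Cor. 4.8).

Provenance: val-lit cell (D-0074 GROUP L), typer val-lit-t07, from the arXiv TeX `multobs.tex`,
`generators74.tex` and the arXiv PDF; data lists machine-extracted from the TeX and cross-checked
against the PDF text.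
-/

noncomputable section

open MvPolynomial

namespace Literature.Computability.AlgebraicComplexity

open _root_.Literature.NumberTheory.DiophantineGeometry

/-! ### §A. DIP's varieties as sets of forms, and the multiplicity of a type in `ℂ[Z]` -/

section Varieties

variable (k : Type) [Field k]

/-- DIP's **Chow variety** `Ch_m^n := {ℓ₁ ⋯ ℓ_n | ℓ_i ∈ V} ⊆ 𝔸_m^n = k[x₁,…,x_m]_n` ("the set of
polynomials that can be written as a product of homogeneous linear forms", §2, arXiv p. 3), as a
set of polynomials in `m` variables; `ℓ = linearForm a = ∑_j a_j x_j` is the tree's linear form.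
For `n ≤ m` it lies between the orbit `GL_m · x₁⋯x_n` and its closure `Δ_n[x₁⋯x_n]`
(`glOrbit_truncatedChowMonomial_subset_chowSet`, `chowSet_subset_endOrbit`), so it has the same
equations; for `m < n` it is NOT the orbit closure of a single form in `m` variables, which is why
it is a set here. [cite: DorflerIkenmeyerPanova2020, §2 (arXiv p. 3; TeX multobs.tex L174; held paper-arxiv-1901.04576 p0004.txt:L13)] -/
def chowSet (m n : ℕ) : Set (MvPolynomial (Fin m) k) :=
  {p | ∃ a : Fin n → Fin m → k, p = ∏ i, linearForm (a i)}

/-- The set `{ℓ₁^n + ⋯ + ℓ_r^n | ℓ_i ∈ V} ⊆ 𝔸_m^n` of power sums of `r` linear forms in `m`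
variables, whose (Zariski = Euclidean) closure is DIP's **higher secant variety of the Veronese**
`Pow_{m,r}^n` = forms of border Waring rank `≤ r` (§2, arXiv p. 3). Equations of a set and of its
closure coincide, so `coordRingMultiplicity k (powerSumSet k m r n)` renders `mult_λ(ℂ[Pow_{m,r}^n]_d)`.
For `r ≤ m` it lies between `GL_m · (x₁^n + ⋯ + x_r^n)` and `End · (x₁^n + ⋯ + x_r^n)`
(`partialPowerSum`). [cite: DorflerIkenmeyerPanova2020, §2 (arXiv p. 3; TeX multobs.tex L179; held paper-arxiv-1901.04576 p0004.txt:L20)] -/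
def powerSumSet (m r n : ℕ) : Set (MvPolynomial (Fin m) k) :=
  {p | ∃ a : Fin r → Fin m → k, p = ∑ i, linearForm (a i) ^ n}

variable {σ : Type} [Fintype σ] [LinearOrder σ]

/-- **The multiplicity of the type `χ` in the coordinate ring `k[Z̄]_•` of (the closure of) a set
`Z` of degree-`n` forms**, rendered NUMERICALLY: `a_χ − dim_k (HWV_χ(k[Sym^n k^σ]) ∩ I(Z))`, where
`a_χ = plethysmCoeff k σ n χ = dim HWV_χ(k[Sym^n])` and `I(Z) ⊆ k[Sym^n]` is the vanishing ideal of
the coefficient vectors of `Z`. This is DIP's reading (5.3)–(5.4) (§5, arXiv p. 13):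
"`mult_λ(W) = dim HWV_λ(W)`" and the restriction `HWV_λ(ℂ[𝔸_m^n]_d) ↠ HWV_λ(ℂ[Ch_m^n]_d)` is onto
(complete reducibility, characteristic zero) with kernel the highest-weight vectors vanishing on
the variety; for `Z` the orbit of a form it IS the tree's `orbitMultiplicity`
(`coordRingMultiplicity_glOrbit`, from `orbitMultiplicity_add_finrank_inf_eq_plethysmCoeff`), and
it depends on `Z` only through `I(Z)` (closure-invariant). Meaningful for `GL`-stable `Z`, `n ≠ 0`,
characteristic zero (then `HWV_χ` is finite-dimensional); a weight pins the degree `d = -|χ|/n`.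
[cite: DorflerIkenmeyerPanova2020, §5 eq. (5.3)–(5.4) (arXiv p. 13; TeX multobs.tex L762 {eq:multdimHWV}, L775 {eq:HWVsurjections}; held paper-arxiv-1901.04576 p0012.txt:L36, L53)] -/
def coordRingMultiplicity (Z : Set (MvPolynomial σ k)) (n : ℕ) (χ : Weight σ) : ℕ :=
  plethysmCoeff k σ n χ -
    Module.finrank k ↥(highestWeightSpace (coordRep σ k n) χ ⊓
      (MvPolynomial.vanishingIdeal k (formCoeff n '' Z)).restrictScalars k)

/-- **The dual weight `μ^*` of an `m`-partition given by its ROW VECTOR** `μ = (μ₁ ≥ ⋯ ≥ μ_m ≥ 0)`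
("An `m`-partition of `D` is a nonincreasing list of `m` nonnegative integers that sum up to `D`",
§2, arXiv p. 3; DIP identify `m`-partitions with zero-padded `m'`-partitions): the weight
`(-μ_m, …, -μ_1)` of `GL_m`, i.e. the tree's `Weight.dualOfPartition` convention applied to a row
vector (`rowDual_sortedParts`). Used for statements quantifying over semigroups of partitions.
[cite: DorflerIkenmeyerPanova2020, §2 (arXiv p. 3)] -/
def rowDual {m : ℕ} (μ : Fin m → ℕ) : Weight (Fin m) :=
  Weight.dual fun i => (μ i : ℤ)

variable {k}

/-- `rowDual` of the row vector of a partition is the tree's `Weight.dualOfPartition` (by `rfl`):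
DIP's identification of `m`-partitions with zero-padded row vectors (§2, arXiv p. 3).
[cite: DorflerIkenmeyerPanova2020, §2 (arXiv p. 3)] -/
@[simp]
theorem rowDual_sortedParts (m : ℕ) {s : ℕ} (lam : Nat.Partition s) :
    rowDual (fun i : Fin m => lam.sortedParts.getD i 0) = Weight.dualOfPartition m lam :=
  rfl

/-- `mult_χ k[Z] ≤ a_χ`: the multiplicity in a quotient of `k[Sym^n]` is at most the plethysm
coefficient (DIP §2: all types occurring in `ℂ[Ch_m^n]_d` or `ℂ[Pow_{m,k}^n]_d` are `m`-partitions of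
`dn`). [cite: DorflerIkenmeyerPanova2020, §2 (arXiv p. 4)] -/
theorem coordRingMultiplicity_le_plethysmCoeff (Z : Set (MvPolynomial σ k)) (n : ℕ) (χ : Weight σ) :
    coordRingMultiplicity k Z n χ ≤ plethysmCoeff k σ n χ :=
  Nat.sub_le _ _

/-- `coordRingMultiplicity` depends on `Z` only through its vanishing ideal (so a set and its
Zariski closure have the same multiplicities, DIP §2 p. 3: "the Zariski closure equals the
Euclidean closure"). [cite: DorflerIkenmeyerPanova2020, §2 (arXiv p. 3)] -/
theorem coordRingMultiplicity_congr_vanishingIdeal {Z Z' : Set (MvPolynomial σ k)} {n : ℕ}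
    (h : MvPolynomial.vanishingIdeal k (formCoeff n '' Z) =
      MvPolynomial.vanishingIdeal k (formCoeff n '' Z')) (χ : Weight σ) :
    coordRingMultiplicity k Z n χ = coordRingMultiplicity k Z' n χ := by
  unfold coordRingMultiplicity
  rw [h]

/-- **DIP (2.2), the multiplicity-obstruction principle, in set form**: if `Z ⊆ Z'` then
restriction of functions gives `ℂ[Z']_d ↠ ℂ[Z]_d`, whence "`mult_λ(ℂ[Ch_m^n]_d) ≥ mult_λ(ℂ[Pow_{m,k}^n]_d)`
for all `m`-partitions `λ`" when `Pow_{m,k}^n ⊆ Ch_m^n` (§2, arXiv p. 4, via Schur's lemma). In the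
numeric rendering: `I(Z') ⊆ I(Z)`, so fewer highest-weight equations (`n ≠ 0`, characteristic
zero, for finite-dimensionality of `HWV_χ`). A `χ` violating the inequality "is called a
multiplicity obstruction"; "if additionally `mult_λ(ℂ[Ch_m^n]_d) = 0`, then `λ` is called an
occurrence obstruction" (tree, orbit-closure form: `IsMultiplicityObstructionAt`,
`IsOccurrenceObstructionAt`).
[cite: DorflerIkenmeyerPanova2020, §2 eq. (2.2) (arXiv p. 4; TeX multobs.tex L270 {eq:obsineq}; held paper-arxiv-1901.04576 p0005.txt:L33–40)] -/
theorem coordRingMultiplicity_mono [CharZero k] {Z Z' : Set (MvPolynomial σ k)} (hZ : Z ⊆ Z')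
    {n : ℕ} (hn : n ≠ 0) (χ : Weight σ) :
    coordRingMultiplicity k Z n χ ≤ coordRingMultiplicity k Z' n χ := by
  haveI : Infinite k := CharZero.infinite k
  haveI : FiniteDimensional k (highestWeightSpace (coordRep σ k n) χ) :=
    finiteDimensional_highestWeightSpace_coordRep_holds hn χ
  unfold coordRingMultiplicity
  apply Nat.sub_le_sub_left
  have hle : highestWeightSpace (coordRep σ k n) χ ⊓
        (MvPolynomial.vanishingIdeal k (formCoeff n '' Z')).restrictScalars k ≤
      highestWeightSpace (coordRep σ k n) χ ⊓
        (MvPolynomial.vanishingIdeal k (formCoeff n '' Z)).restrictScalars k := by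
    refine inf_le_inf le_rfl ?_
    intro F hF
    exact MvPolynomial.vanishingIdeal_anti_mono (Set.image_mono hZ) hF
  exact LinearMap.finrank_le_finrank_of_injective (Submodule.inclusion_injective hle)

/-- **Equations of a set squeezed between an orbit and its endomorphism orbit.** If
`GL · f ⊆ Z ⊆ End · f` then `I(Z) = I(GL · f)` (infinite field: `I(GL · f)` vanishes on `End · f`,
`aeval_formCoeff_linSubst_eq_zero_of_mem_orbitVanishingIdeal`; BIP 2019, proof of Lemma 2.2: `GL` is
dense in `End`). [cite: BurgisserIkenmeyerPanovaJAMS2019, Lemma 2.2] -/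
theorem vanishingIdeal_image_eq_orbitVanishingIdeal [Infinite k] {f : MvPolynomial σ k} {n : ℕ}
    {Z : Set (MvPolynomial σ k)} (h1 : glOrbit σ k f ⊆ Z) (h2 : Z ⊆ endOrbit σ k f) :
    MvPolynomial.vanishingIdeal k (formCoeff n '' Z) = orbitVanishingIdeal f n := by
  apply le_antisymm
  · exact MvPolynomial.vanishingIdeal_anti_mono (Set.image_mono h1)
  · intro F hF
    rw [MvPolynomial.mem_vanishingIdeal_iff]
    rintro _ ⟨q, hq, rfl⟩
    obtain ⟨A, rfl⟩ := h2 hq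
    exact aeval_formCoeff_linSubst_eq_zero_of_mem_orbitVanishingIdeal hF A

/-- **Consistency with the tree's orbit-closure multiplicity**: for the orbit `Z = GL · f` of a
form (`n ≠ 0`, characteristic zero), `coordRingMultiplicity k (GL · f) n χ = orbitMultiplicity k f n χ
= mult_χ k[Δ_n[f]]` — rank–nullity `mult_χ k[Δ_n[f]] + dim (HWV_χ ∩ I(GL · f)) = a_χ`
(`orbitMultiplicity_add_finrank_inf_eq_plethysmCoeff`, DIP (2.2)/§5).
[cite: DorflerIkenmeyerPanova2020, §5 eq. (5.3)–(5.4) (arXiv p. 13)] -/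
theorem coordRingMultiplicity_glOrbit [CharZero k] (f : MvPolynomial σ k) {n : ℕ} (hn : n ≠ 0)
    (χ : Weight σ) : coordRingMultiplicity k (glOrbit σ k f) n χ = orbitMultiplicity k f n χ := by
  unfold coordRingMultiplicity
  rw [← orbitMultiplicity_add_finrank_inf_eq_plethysmCoeff f hn χ]
  exact Nat.add_sub_cancel _ _

/-- The same for any set squeezed between the orbit and the endomorphism orbit:
`GL · f ⊆ Z ⊆ End · f ⇒ mult_χ k[Z̄] = mult_χ k[Δ_n[f]]` (DIP §2: `Pow_{m,k}^n` is the CLOSURE of the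
set of power sums; (5.3)–(5.4)). [cite: DorflerIkenmeyerPanova2020, §5 eq. (5.3)–(5.4) (arXiv p. 13)] -/
theorem coordRingMultiplicity_eq_orbitMultiplicity [CharZero k] {f : MvPolynomial σ k} {n : ℕ}
    (hn : n ≠ 0) {Z : Set (MvPolynomial σ k)} (h1 : glOrbit σ k f ⊆ Z) (h2 : Z ⊆ endOrbit σ k f)
    (χ : Weight σ) : coordRingMultiplicity k Z n χ = orbitMultiplicity k f n χ := by
  haveI : Infinite k := CharZero.infinite k
  rw [← coordRingMultiplicity_glOrbit f hn χ]
  exact coordRingMultiplicity_congr_vanishingIdeal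
    (by rw [vanishingIdeal_image_eq_orbitVanishingIdeal h1 h2,
      vanishingIdeal_image_eq_orbitVanishingIdeal subset_rfl (glOrbit_subset_endOrbit f)]) χ

/-- **No equations of degree `d` ⇒ full multiplicity in degree `d`** (set form of the tree's
`orbitMultiplicity_eq_plethysmCoeff_of_degree_eq_zero`): if every homogeneous degree-`d` element of
`I(Z)` vanishes, then `mult_χ k[Z̄] = a_χ` for every weight `χ` of degree `d` (`|χ| = -n d`; the
members of `HWV_χ` are homogeneous of degree `d`, "a weight pins the degree").
[cite: DorflerIkenmeyerPanova2020, §3 eq. (3.1) (arXiv p. 4)] -/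
theorem coordRingMultiplicity_eq_plethysmCoeff_of_degree_eq_zero [CharZero k]
    {Z : Set (MvPolynomial σ k)} {n : ℕ} (hn : n ≠ 0) {d : ℕ}
    (H : ∀ Ψ : MvPolynomial (DegIdx σ n) k,
      Ψ ∈ MvPolynomial.vanishingIdeal k (formCoeff n '' Z) → Ψ.IsHomogeneous d → Ψ = 0)
    {χ : Weight σ} (hχ : χ.size = -((n * d : ℕ) : ℤ)) :
    coordRingMultiplicity k Z n χ = plethysmCoeff k σ n χ := by
  haveI : Infinite k := CharZero.infinite k
  unfold coordRingMultiplicity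
  have hbot : highestWeightSpace (coordRep σ k n) χ ⊓
      (MvPolynomial.vanishingIdeal k (formCoeff n '' Z)).restrictScalars k = ⊥ := by
    rw [Submodule.eq_bot_iff]
    intro F hF
    exact H F hF.2 (isHomogeneous_of_mem_weightSpace_of_size_eq hn hχ
      (highestWeightSpace_le_weightSpace _ _ hF.1))
  rw [hbot, finrank_bot, Nat.sub_zero]

/-! ### §B. The Chow variety and the power sums in the orbit-closure range -/

/-- `GL_m · x₁⋯x_n ⊆ Ch_m^n` (`n ≤ m`): a translate of `x₁ ⋯ x_n` is the product of the linear forms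
`g · x_i`. [cite: DorflerIkenmeyerPanova2020, §2 (arXiv p. 3)] -/
theorem glOrbit_truncatedChowMonomial_subset_chowSet {n m : ℕ} (h : n ≤ m) :
    glOrbit (Fin m) k (truncatedChowMonomial k n m h) ⊆ chowSet k m n := by
  rintro _ ⟨g, rfl⟩
  refine ⟨fun i j => (g : Matrix (Fin m) (Fin m) k) j (Fin.castLE h i), ?_⟩
  simp only [linSubstRep_apply, truncatedChowMonomial, map_prod, linSubst_X, linearForm,
    smul_eq_C_mul]

/-- `Ch_m^n ⊆ End · x₁⋯x_n` (`n ≤ m`): `∏_i ℓ_i = A · (x₁ ⋯ x_n)` for the matrix `A` whose first `n`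
columns are the coefficient vectors of the `ℓ_i`; hence `Ch_m^n ⊆ Δ_n[x₁⋯x_n]` and, with the
previous lemma, `Ch_m^n` and `GL_m · x₁⋯x_n` have the same equations (the file header of
`ChowVersusPowerSums.lean`: "`Ch_m^n = Δ_n[x₁ ⋯ x_n]` for `n ≤ m`").
[cite: DorflerIkenmeyerPanova2020, §2 (arXiv p. 3)] -/
theorem chowSet_subset_endOrbit {n m : ℕ} (h : n ≤ m) :
    chowSet k m n ⊆ endOrbit (Fin m) k (truncatedChowMonomial k n m h) := by
  classical
  rintro _ ⟨a, rfl⟩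
  refine ⟨Matrix.of fun j c => if hc : (c : ℕ) < n then a ⟨c, hc⟩ j else 0, ?_⟩
  simp only [truncatedChowMonomial, map_prod, linSubst_X, Matrix.of_apply, Fin.val_castLE,
    Fin.is_lt, dif_pos, Fin.eta, linearForm, smul_eq_C_mul]

/-- `GL_m · (x₁^n + ⋯ + x_r^n) ⊆ {ℓ₁^n + ⋯ + ℓ_r^n}` (`r ≤ m`).
[cite: DorflerIkenmeyerPanova2020, §2 (arXiv p. 3)] -/
theorem glOrbit_partialPowerSum_subset_powerSumSet {r m : ℕ} (h : r ≤ m) (n : ℕ) :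
    glOrbit (Fin m) k (partialPowerSum k r m n h) ⊆ powerSumSet k m r n := by
  rintro _ ⟨g, rfl⟩
  refine ⟨fun i j => (g : Matrix (Fin m) (Fin m) k) j (Fin.castLE h i), ?_⟩
  simp only [linSubstRep_apply, partialPowerSum, map_sum, map_pow, linSubst_X, linearForm,
    smul_eq_C_mul]

/-- `{ℓ₁^n + ⋯ + ℓ_r^n} ⊆ End · (x₁^n + ⋯ + x_r^n)` (`r ≤ m`; the tree's
`exists_linSubst_partialPowerSum_eq`). [cite: DorflerIkenmeyerPanova2020, §2 (arXiv p. 3)] -/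
theorem powerSumSet_subset_endOrbit {r m : ℕ} (h : r ≤ m) (n : ℕ) :
    powerSumSet k m r n ⊆ endOrbit (Fin m) k (partialPowerSum k r m n h) := by
  rintro _ ⟨a, rfl⟩
  obtain ⟨A, hA⟩ := exists_linSubst_partialPowerSum_eq (k := k) h n a
  exact ⟨A, hA⟩

/-- **`mult_λ(ℂ[Ch_m^n]_d)` in the orbit-closure range** (`1 ≤ n ≤ m`, characteristic zero): the set
rendering agrees with the tree's `orbitMultiplicity` of `x₁ ⋯ x_n`, for every weight.
[cite: DorflerIkenmeyerPanova2020, §2 (arXiv p. 3)] -/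
theorem coordRingMultiplicity_chowSet [CharZero k] {n m : ℕ} (h : n ≤ m) (hn : n ≠ 0)
    (χ : Weight (Fin m)) :
    coordRingMultiplicity k (chowSet k m n) n χ =
      orbitMultiplicity k (truncatedChowMonomial k n m h) n χ :=
  coordRingMultiplicity_eq_orbitMultiplicity hn (glOrbit_truncatedChowMonomial_subset_chowSet h)
    (chowSet_subset_endOrbit h) χ

/-- **`mult_λ(ℂ[Pow_{m,r}^n]_d)` in the orbit-closure range** (`r ≤ m`, `n ≠ 0`, characteristic
zero): the set rendering agrees with the tree's `orbitMultiplicity` of `x₁^n + ⋯ + x_r^n`.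
[cite: DorflerIkenmeyerPanova2020, §2 (arXiv p. 3)] -/
theorem coordRingMultiplicity_powerSumSet [CharZero k] {r m n : ℕ} (h : r ≤ m) (hn : n ≠ 0)
    (χ : Weight (Fin m)) :
    coordRingMultiplicity k (powerSumSet k m r n) n χ =
      orbitMultiplicity k (partialPowerSum k r m n h) n χ :=
  coordRingMultiplicity_eq_orbitMultiplicity hn (glOrbit_partialPowerSum_subset_powerSumSet h n)
    (powerSumSet_subset_endOrbit h n) χ

end Varieties

/-! ### §C. Prop. 3.3 as printed (every `m`): power sums with `k ≥ d` terms have no equation of degree `d` -/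

section PowerSums

variable {k : Type} [Field k]

/-- **`I(Pow_{m,r}^n)_d = 0` for `d ≤ r`, for EVERY number of variables `m`** (`n ≥ 1`, `k`
algebraically closed of characteristic zero): a homogeneous `Ψ ≠ 0` of degree `d ≤ r` on
`Sym^n k^m` does not vanish at some power sum of `r` linear forms (BIP 2019 Prop. 3.2, tree:
`exists_aeval_formCoeff_sum_linearFormPow_ne_zero`), which is a point of `powerSumSet k m r n`. This
is the step "(3.1) is a consequence of [BIP19, Prop. 3.2]" of DIP's proof of Prop. 3.3, without the
tree's earlier restriction `r ≤ m` (`eq_zero_of_mem_orbitVanishingIdeal_partialPowerSum`).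
[cite: DorflerIkenmeyerPanova2020, Prop. 3.3 (arXiv p. 4)] -/
theorem eq_zero_of_mem_vanishingIdeal_powerSumSet [IsAlgClosed k] [CharZero k] {m r n d : ℕ}
    (hn : 0 < n) (hd : d ≤ r) {Ψ : MvPolynomial (DegIdx (Fin m) n) k}
    (hΨI : Ψ ∈ MvPolynomial.vanishingIdeal k (formCoeff n '' powerSumSet k m r n))
    (hΨd : Ψ.IsHomogeneous d) : Ψ = 0 := by
  classical
  by_contra hΨ0
  have hdeg : Ψ.totalDegree ≤ r := (hΨd.totalDegree hΨ0).le.trans hd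
  obtain ⟨φ, hφ⟩ := exists_aeval_formCoeff_sum_linearFormPow_ne_zero hn Ψ hΨ0 hdeg
  refine hφ ?_
  rw [MvPolynomial.mem_vanishingIdeal_iff] at hΨI
  exact hΨI _ ⟨_, ⟨φ, rfl⟩, rfl⟩

/-- **Prop. 3.3 as printed, weight form, every `m`**: for `n ≥ 1`, `d ≤ r` and every weight `χ`
of `GL_m` of degree `d` (`|χ| = -n d`), `mult_χ(ℂ[Pow_{m,r}^n]) = a_χ`.
[cite: DorflerIkenmeyerPanova2020, Prop. 3.3 (arXiv p. 4)] -/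
theorem coordRingMultiplicity_powerSumSet_eq_plethysmCoeff [IsAlgClosed k] [CharZero k]
    {m r n d : ℕ} (hn : 0 < n) (hd : d ≤ r) {χ : Weight (Fin m)}
    (hχ : χ.size = -((n * d : ℕ) : ℤ)) :
    coordRingMultiplicity k (powerSumSet k m r n) n χ = plethysmCoeff k (Fin m) n χ :=
  coordRingMultiplicity_eq_plethysmCoeff_of_degree_eq_zero hn.ne'
    (fun _ hΨI hΨd => eq_zero_of_mem_vanishingIdeal_powerSumSet hn hd hΨI hΨd) hχ

/-- **Prop. 3.3 as printed** ("If `λ` is an `m`-partition of `dn` and `k ≥ d`, then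
`mult_λ(ℂ[Pow_{m,k}^n]_d) = a_λ(d[n])`", arXiv p. 4; `n ≥ 1`), now for EVERY `m` — the tree's named
fact `DIP2020_prop_3_3` (discharged, `DIP2020_prop_3_3_holds`) is the orbit-closure rendering in the
range `d ≤ k ≤ m`; here `Pow_{m,k}^n` is the set `powerSumSet ℂ m k n` and `a_λ(d[n])` is
`plethysmCoeffOfPartition ℂ m n λ`.
[cite: DorflerIkenmeyerPanova2020, Prop. 3.3 (arXiv p. 4; TeX multobs.tex L334 {pro:lowdegreepowersums}; held paper-arxiv-1901.04576 p0006.txt:L26 "Proposition 4")] -/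
theorem coordRingMultiplicity_powerSumSet_dualOfPartition [IsAlgClosed k] [CharZero k]
    {m r n d : ℕ} (hn : 0 < n) (hd : d ≤ r) (lam : Nat.Partition (d * n))
    (hlam : lam.parts.card ≤ m) :
    coordRingMultiplicity k (powerSumSet k m r n) n (Weight.dualOfPartition m lam) =
      plethysmCoeffOfPartition k m n lam := by
  have hsize : (Weight.dualOfPartition m lam).size = -((n * d : ℕ) : ℤ) := by
    rw [Weight.dualOfPartition, Weight.size_dual, Weight.size_ofPartition_holds hlam, Nat.mul_comm]
  exact coordRingMultiplicity_powerSumSet_eq_plethysmCoeff hn hd hsize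

end PowerSums

/-! ### §D. Data as printed: exceptional bodies and the generator sets `X` -/

section Data

/-- The five exceptional bodies `λ̄ ∈ {(3,3), (3,1), (2,1), (1,1), (1)}` of Lemma 3.7 / Prop. 3.10,
as pairs `(λ₂, λ₃)` with a trailing zero (arXiv p. 5–6). [cite: DorflerIkenmeyerPanova2020, Lemma 3.7 (arXiv p. 5)] -/
def dipTails36 : Finset (ℕ × ℕ) :=
  {(3, 3), (3, 1), (2, 1), (1, 1), (1, 0)}

/-- The set `Y` of 18 exceptional bodies of Lemma 3.13 / Prop. 3.14 ("`Y := {(1), (1,1), (1,1,1),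
(2,1), (2,1,1), (2,2,1), (3,1), (3,1,1), (3,2,1), (3,3), (3,3,1), (3,3,2), (3,3,3), (4,1,1), (4,3,3),
(5,1,1), (5,5,5), (6,1,1)}`", arXiv p. 7), as triples `(λ₂, λ₃, λ₄)` padded with zeros.
[cite: DorflerIkenmeyerPanova2020, Lemma 3.13 (arXiv p. 7)] -/
def dipTails47 : Finset (ℕ × ℕ × ℕ) :=
  {(1, 0, 0), (1, 1, 0), (1, 1, 1), (2, 1, 0), (2, 1, 1), (2, 2, 1), (3, 1, 0), (3, 1, 1), (3, 2, 1),
    (3, 3, 0), (3, 3, 1), (3, 3, 2), (3, 3, 3), (4, 1, 1), (4, 3, 3), (5, 1, 1), (5, 5, 5), (6, 1, 1)}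

/-- The 89 rows of DIP's set `X` of Prop. 3.9 (arXiv p. 6; "Here we truncated trailing zeros from the
3-partitions" — padded back here), in printed order from `(6)` to `(45,45)`.
[cite: DorflerIkenmeyerPanova2020, Prop. 3.9 (arXiv p. 6)] -/
def dipGeneratorRows36 : List (ℕ × ℕ × ℕ) := [
  (6, 0, 0), (6, 6, 0), (8, 4, 0), (10, 2, 0), (6, 6, 6), (8, 6, 4), (10, 4, 4),
  (9, 6, 3), (8, 8, 2), (10, 6, 2), (11, 5, 2), (10, 7, 1), (12, 4, 2), (11, 6, 1),
  (10, 8, 0), (14, 2, 2), (13, 4, 1), (13, 5, 0), (15, 3, 0), (8, 8, 8), (10, 8, 6),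
  (11, 7, 6), (10, 9, 5), (11, 8, 5), (10, 10, 4), (12, 7, 5), (11, 9, 4), (13, 6, 5),
  (12, 8, 4), (11, 10, 3), (13, 7, 4), (12, 9, 3), (13, 8, 3), (12, 10, 2), (15, 5, 4),
  (14, 7, 3), (13, 9, 2), (13, 10, 1), (16, 5, 3), (15, 7, 2), (14, 9, 1), (17, 4, 3),
  (15, 8, 1), (15, 9, 0), (19, 3, 2), (18, 5, 1), (17, 7, 0), (10, 10, 10), (11, 10, 9),
  (12, 10, 8), (13, 9, 8), (12, 11, 7), (13, 10, 7), (14, 9, 7), (13, 11, 6), (15, 8, 7),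
  (13, 12, 5), (16, 7, 7), (15, 9, 6), (14, 11, 5), (13, 13, 4), (15, 10, 5), (15, 11, 4),
  (14, 13, 3), (16, 11, 3), (15, 13, 2), (15, 14, 1), (17, 13, 0), (13, 12, 11), (14, 11, 11),
  (13, 13, 10), (15, 11, 10), (14, 13, 9), (16, 11, 9), (15, 13, 8), (15, 14, 7), (18, 9, 9),
  (15, 15, 6), (17, 17, 2), (18, 17, 1), (26, 5, 5), (15, 14, 13), (16, 13, 13), (15, 15, 12),
  (17, 17, 8), (18, 15, 15), (17, 17, 14), (25, 23, 0), (45, 45, 0)]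

/-- DIP's set `X ⊆ ℕ³` of Prop. 3.9 as a set of row vectors of `3`-partitions.
[cite: DorflerIkenmeyerPanova2020, Prop. 3.9 (arXiv p. 6)] -/
def dipGenerators36 : Set (Fin 3 → ℕ) :=
  {μ | (μ 0, μ 1, μ 2) ∈ dipGeneratorRows36}

/-- The 948 rows of DIP's set `X` of Prop. 7.1 for `m = 4`, `n = 7` (§7, arXiv p. 16; trailing zeros
padded back), in printed order from `(7)` to `(49,49)`.
[cite: DorflerIkenmeyerPanova2020, Prop. 7.1 (arXiv p. 16)] -/
def dipGeneratorRows47 : List (ℕ × ℕ × ℕ × ℕ) := [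
  (7, 0, 0, 0), (8, 6, 0, 0), (10, 4, 0, 0), (12, 2, 0, 0), (8, 8, 5, 0), (9, 6, 6, 0),
  (10, 7, 4, 0), (10, 8, 3, 0), (10, 10, 1, 0), (11, 6, 4, 0), (11, 8, 2, 0), (12, 6, 3, 0),
  (12, 7, 2, 0), (12, 8, 1, 0), (12, 9, 0, 0), (13, 4, 4, 0), (13, 6, 2, 0), (13, 7, 1, 0),
  (13, 8, 0, 0), (14, 5, 2, 0), (14, 6, 1, 0), (14, 7, 0, 0), (15, 4, 2, 0), (16, 4, 1, 0),
  (16, 5, 0, 0), (17, 2, 2, 0), (18, 3, 0, 0), (10, 6, 6, 6), (9, 8, 6, 5), (8, 8, 8, 4),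
  (10, 8, 6, 4), (10, 10, 4, 4), (11, 7, 6, 4), (11, 8, 5, 4), (10, 8, 7, 3), (10, 9, 6, 3),
  (12, 6, 6, 4), (12, 8, 4, 4), (11, 8, 6, 3), (11, 9, 5, 3), (10, 8, 8, 2), (11, 10, 4, 3),
  (10, 10, 6, 2), (13, 7, 4, 4), (12, 7, 6, 3), (12, 8, 5, 3), (12, 9, 4, 3), (11, 8, 7, 2),
  (11, 9, 6, 2), (11, 10, 5, 2), (10, 10, 7, 1), (14, 6, 4, 4), (13, 6, 6, 3), (13, 7, 5, 3),
  (13, 8, 4, 3), (13, 9, 3, 3), (12, 8, 6, 2), (12, 9, 5, 2), (11, 8, 8, 1), (12, 10, 4, 2),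
  (11, 9, 7, 1), (12, 11, 3, 2), (11, 10, 6, 1), (12, 12, 2, 2), (11, 11, 5, 1), (10, 10, 8, 0),
  (14, 7, 4, 3), (13, 7, 6, 2), (13, 8, 5, 2), (13, 9, 4, 2), (12, 8, 7, 1), (13, 10, 3, 2),
  (12, 9, 6, 1), (12, 10, 5, 1), (12, 11, 4, 1), (11, 10, 7, 0), (16, 4, 4, 4), (15, 6, 4, 3),
  (14, 6, 6, 2), (14, 7, 5, 2), (14, 8, 4, 2), (13, 7, 7, 1), (14, 9, 3, 2), (13, 8, 6, 1),
  (14, 10, 2, 2), (13, 9, 5, 1), (12, 8, 8, 0), (13, 10, 4, 1), (12, 9, 7, 0), (13, 11, 3, 1),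
  (12, 10, 6, 0), (13, 12, 2, 1), (12, 11, 5, 0), (13, 13, 1, 1), (12, 12, 4, 0), (15, 6, 5, 2),
  (15, 7, 4, 2), (15, 8, 3, 2), (14, 7, 6, 1), (15, 9, 2, 2), (14, 8, 5, 1), (14, 9, 4, 1),
  (13, 8, 7, 0), (14, 10, 3, 1), (13, 9, 6, 0), (14, 11, 2, 1), (13, 10, 5, 0), (13, 11, 4, 0),
  (13, 12, 3, 0), (16, 6, 4, 2), (16, 7, 3, 2), (15, 6, 6, 1), (16, 8, 2, 2), (15, 7, 5, 1),
  (15, 8, 4, 1), (15, 9, 3, 1), (14, 8, 6, 0), (15, 10, 2, 1), (14, 9, 5, 0), (15, 11, 1, 1),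
  (14, 10, 4, 0), (14, 11, 3, 0), (14, 12, 2, 0), (14, 13, 1, 0), (14, 14, 0, 0), (17, 5, 4, 2),
  (17, 6, 3, 2), (17, 7, 2, 2), (16, 6, 5, 1), (16, 7, 4, 1), (16, 8, 3, 1), (15, 7, 6, 0),
  (16, 9, 2, 1), (16, 10, 1, 1), (15, 9, 4, 0), (15, 10, 3, 0), (15, 11, 2, 0), (15, 12, 1, 0),
  (18, 4, 4, 2), (18, 6, 2, 2), (17, 6, 4, 1), (17, 7, 3, 1), (17, 8, 2, 1), (16, 7, 5, 0),
  (17, 9, 1, 1), (16, 8, 4, 0), (16, 9, 3, 0), (16, 10, 2, 0), (16, 11, 1, 0), (19, 5, 2, 2),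
  (18, 5, 4, 1), (18, 6, 3, 1), (18, 7, 2, 1), (17, 6, 5, 0), (17, 9, 2, 0), (17, 11, 0, 0),
  (20, 4, 2, 2), (19, 4, 4, 1), (19, 5, 3, 1), (19, 6, 2, 1), (19, 7, 1, 1), (18, 7, 3, 0),
  (18, 9, 1, 0), (20, 5, 2, 1), (19, 5, 4, 0), (22, 2, 2, 2), (21, 4, 2, 1), (20, 5, 3, 0),
  (21, 4, 3, 0), (22, 5, 1, 0), (23, 3, 2, 0), (11, 8, 8, 8), (10, 10, 8, 7), (11, 9, 8, 7),
  (11, 10, 7, 7), (10, 10, 9, 6), (12, 8, 8, 7), (11, 10, 8, 6), (11, 11, 7, 6), (10, 10, 10, 5),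
  (13, 8, 7, 7), (12, 9, 8, 6), (12, 10, 7, 6), (12, 11, 6, 6), (11, 10, 9, 5), (11, 11, 8, 5),
  (13, 8, 8, 6), (13, 9, 7, 6), (13, 10, 6, 6), (12, 9, 9, 5), (12, 10, 8, 5), (12, 11, 7, 5),
  (11, 10, 10, 4), (12, 12, 6, 5), (11, 11, 9, 4), (14, 8, 7, 6), (14, 9, 6, 6), (13, 9, 8, 5),
  (13, 10, 7, 5), (13, 11, 6, 5), (12, 10, 9, 4), (13, 12, 5, 5), (12, 11, 8, 4), (12, 12, 7, 4),
  (11, 11, 10, 3), (15, 7, 7, 6), (15, 8, 6, 6), (14, 8, 8, 5), (14, 9, 7, 5), (14, 10, 6, 5),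
  (13, 9, 9, 4), (14, 11, 5, 5), (13, 10, 8, 4), (13, 11, 7, 4), (12, 10, 10, 3), (13, 12, 6, 4),
  (12, 11, 9, 3), (13, 13, 5, 4), (12, 12, 8, 3), (16, 7, 6, 6), (15, 8, 7, 5), (15, 9, 6, 5),
  (15, 10, 5, 5), (14, 9, 8, 4), (14, 10, 7, 4), (14, 11, 6, 4), (13, 10, 9, 3), (14, 12, 5, 4),
  (13, 11, 8, 3), (14, 13, 4, 4), (13, 12, 7, 3), (12, 11, 10, 2), (13, 13, 6, 3), (12, 12, 9, 2),
  (16, 7, 7, 5), (16, 9, 5, 5), (15, 9, 7, 4), (15, 10, 6, 4), (14, 9, 9, 3), (15, 11, 5, 4),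
  (14, 10, 8, 3), (15, 12, 4, 4), (14, 11, 7, 3), (13, 10, 10, 2), (14, 12, 6, 3), (13, 11, 9, 2),
  (14, 13, 5, 3), (13, 12, 8, 2), (14, 14, 4, 3), (13, 13, 7, 2), (12, 12, 10, 1), (17, 7, 6, 5),
  (17, 8, 5, 5), (16, 8, 7, 4), (16, 9, 6, 4), (16, 10, 5, 4), (15, 9, 8, 3), (16, 11, 4, 4),
  (15, 10, 7, 3), (15, 11, 6, 3), (14, 10, 9, 2), (15, 12, 5, 3), (14, 11, 8, 2), (15, 13, 4, 3),
  (14, 12, 7, 2), (13, 11, 10, 1), (15, 14, 3, 3), (14, 13, 6, 2), (13, 12, 9, 1), (14, 14, 5, 2),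
  (13, 13, 8, 1), (12, 12, 11, 0), (18, 6, 6, 5), (18, 7, 5, 5), (17, 7, 7, 4), (17, 9, 5, 4),
  (16, 8, 8, 3), (16, 9, 7, 3), (16, 10, 6, 3), (15, 9, 9, 2), (16, 11, 5, 3), (15, 10, 8, 2),
  (16, 12, 4, 3), (15, 11, 7, 2), (14, 10, 10, 1), (16, 13, 3, 3), (15, 12, 6, 2), (14, 11, 9, 1),
  (15, 13, 5, 2), (14, 12, 8, 1), (15, 14, 4, 2), (14, 13, 7, 1), (13, 12, 10, 0), (15, 15, 3, 2),
  (14, 14, 6, 1), (13, 13, 9, 0), (18, 9, 4, 4), (17, 10, 5, 3), (16, 9, 8, 2), (17, 11, 4, 3),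
  (16, 10, 7, 2), (17, 12, 3, 3), (16, 11, 6, 2), (15, 10, 9, 1), (16, 12, 5, 2), (15, 11, 8, 1),
  (16, 13, 4, 2), (15, 12, 7, 1), (14, 11, 10, 0), (16, 14, 3, 2), (15, 13, 6, 1), (14, 12, 9, 0),
  (16, 15, 2, 2), (15, 14, 5, 1), (14, 13, 8, 0), (15, 15, 4, 1), (14, 14, 7, 0), (19, 7, 5, 4),
  (18, 7, 7, 3), (17, 9, 7, 2), (18, 11, 3, 3), (16, 9, 9, 1), (17, 11, 5, 2), (16, 10, 8, 1),
  (17, 12, 4, 2), (16, 11, 7, 1), (15, 10, 10, 0), (17, 13, 3, 2), (16, 12, 6, 1), (15, 11, 9, 0),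
  (17, 14, 2, 2), (16, 13, 5, 1), (15, 12, 8, 0), (16, 14, 4, 1), (15, 13, 7, 0), (16, 15, 3, 1),
  (15, 14, 6, 0), (16, 16, 2, 1), (15, 15, 5, 0), (20, 6, 5, 4), (19, 10, 3, 3), (17, 9, 8, 1),
  (18, 11, 4, 2), (18, 12, 3, 2), (17, 11, 6, 1), (16, 10, 9, 0), (18, 13, 2, 2), (17, 12, 5, 1),
  (16, 11, 8, 0), (17, 13, 4, 1), (16, 12, 7, 0), (17, 14, 3, 1), (16, 13, 6, 0), (17, 15, 2, 1),
  (17, 16, 1, 1), (16, 15, 4, 0), (16, 16, 3, 0), (19, 7, 7, 2), (17, 9, 9, 0), (18, 12, 4, 1),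
  (17, 11, 7, 0), (18, 13, 3, 1), (18, 14, 2, 1), (17, 13, 5, 0), (18, 15, 1, 1), (17, 14, 4, 0),
  (17, 15, 3, 0), (17, 16, 2, 0), (22, 5, 4, 4), (21, 6, 5, 3), (21, 8, 3, 3), (20, 11, 2, 2),
  (18, 9, 8, 0), (19, 12, 3, 1), (18, 11, 6, 0), (19, 13, 2, 1), (19, 14, 1, 1), (18, 15, 2, 0),
  (18, 17, 0, 0), (22, 7, 3, 3), (19, 13, 3, 0), (19, 15, 1, 0), (19, 16, 0, 0), (23, 5, 4, 3),
  (23, 6, 3, 3), (21, 12, 1, 1), (24, 4, 4, 3), (23, 5, 5, 2), (21, 7, 7, 0), (25, 5, 3, 2),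
  (24, 5, 5, 1), (26, 4, 3, 2), (25, 8, 1, 1), (28, 3, 2, 2), (27, 4, 3, 1), (12, 10, 10, 10),
  (11, 11, 11, 9), (12, 11, 10, 9), (12, 12, 9, 9), (13, 10, 10, 9), (13, 11, 9, 9), (12, 11, 11, 8),
  (12, 12, 10, 8), (14, 10, 9, 9), (13, 11, 10, 8), (13, 12, 9, 8), (13, 13, 8, 8), (12, 12, 11, 7),
  (15, 9, 9, 9), (14, 10, 10, 8), (14, 11, 9, 8), (14, 12, 8, 8), (13, 11, 11, 7), (13, 12, 10, 7),
  (13, 13, 9, 7), (12, 12, 12, 6), (15, 10, 9, 8), (15, 11, 8, 8), (14, 11, 10, 7), (14, 12, 9, 7),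
  (14, 13, 8, 7), (13, 12, 11, 6), (14, 14, 7, 7), (13, 13, 10, 6), (16, 9, 9, 8), (16, 10, 8, 8),
  (15, 10, 10, 7), (15, 11, 9, 7), (15, 12, 8, 7), (14, 11, 11, 6), (15, 13, 7, 7), (14, 12, 10, 6),
  (14, 13, 9, 6), (13, 12, 12, 5), (14, 14, 8, 6), (13, 13, 11, 5), (17, 9, 8, 8), (16, 10, 9, 7),
  (16, 11, 8, 7), (16, 12, 7, 7), (15, 11, 10, 6), (15, 12, 9, 6), (15, 13, 8, 6), (14, 12, 11, 5),
  (15, 14, 7, 6), (14, 13, 10, 5), (15, 15, 6, 6), (14, 14, 9, 5), (13, 13, 12, 4), (17, 9, 9, 7),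
  (17, 11, 7, 7), (16, 10, 10, 6), (16, 11, 9, 6), (16, 12, 8, 6), (15, 11, 11, 5), (16, 13, 7, 6),
  (15, 12, 10, 5), (16, 14, 6, 6), (15, 13, 9, 5), (14, 12, 12, 4), (15, 14, 8, 5), (14, 13, 11, 4),
  (15, 15, 7, 5), (14, 14, 10, 4), (13, 13, 13, 3), (17, 11, 8, 6), (17, 12, 7, 6), (16, 11, 10, 5),
  (17, 13, 6, 6), (16, 12, 9, 5), (16, 13, 8, 5), (15, 12, 11, 4), (16, 14, 7, 5), (15, 13, 10, 4),
  (16, 15, 6, 5), (15, 14, 9, 4), (14, 13, 12, 3), (16, 16, 5, 5), (15, 15, 8, 4), (14, 14, 11, 3),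
  (19, 9, 7, 7), (18, 9, 9, 6), (17, 11, 9, 5), (17, 12, 8, 5), (16, 11, 11, 4), (17, 13, 7, 5),
  (16, 12, 10, 4), (16, 13, 9, 4), (15, 12, 12, 3), (17, 15, 5, 5), (15, 13, 11, 3), (16, 15, 7, 4),
  (15, 14, 10, 3), (14, 13, 13, 2), (16, 16, 6, 4), (15, 15, 9, 3), (14, 14, 12, 2), (18, 12, 7, 5),
  (17, 11, 10, 4), (18, 13, 6, 5), (17, 12, 9, 4), (18, 14, 5, 5), (17, 13, 8, 4), (16, 12, 11, 3),
  (17, 14, 7, 4), (16, 13, 10, 3), (17, 15, 6, 4), (16, 14, 9, 3), (15, 13, 12, 2), (17, 16, 5, 4),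
  (16, 15, 8, 3), (15, 14, 11, 2), (17, 17, 4, 4), (16, 16, 7, 3), (15, 15, 10, 2), (14, 14, 13, 1),
  (21, 7, 7, 7), (19, 13, 5, 5), (17, 11, 11, 3), (18, 13, 7, 4), (17, 12, 10, 3), (17, 13, 9, 3),
  (16, 12, 12, 2), (18, 15, 5, 4), (17, 14, 8, 3), (16, 13, 11, 2), (17, 15, 7, 3), (16, 14, 10, 2),
  (15, 13, 13, 1), (17, 16, 6, 3), (16, 15, 9, 2), (15, 14, 12, 1), (17, 17, 5, 3), (16, 16, 8, 2),
  (15, 15, 11, 1), (14, 14, 14, 0), (18, 12, 9, 3), (18, 13, 8, 3), (17, 12, 11, 2), (19, 15, 4, 4),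
  (17, 13, 10, 2), (17, 14, 9, 2), (16, 13, 12, 1), (18, 16, 5, 3), (17, 15, 8, 2), (16, 14, 11, 1),
  (18, 17, 4, 3), (17, 16, 7, 2), (16, 15, 10, 1), (15, 14, 13, 0), (18, 18, 3, 3), (17, 17, 6, 2),
  (16, 16, 9, 1), (15, 15, 12, 0), (18, 11, 11, 2), (19, 13, 7, 3), (18, 12, 10, 2), (18, 13, 9, 2),
  (17, 12, 12, 1), (17, 13, 11, 1), (18, 15, 7, 2), (17, 14, 10, 1), (16, 13, 13, 0), (19, 17, 3, 3),
  (17, 15, 9, 1), (16, 14, 12, 0), (18, 17, 5, 2), (17, 16, 8, 1), (16, 15, 11, 0), (18, 18, 4, 2),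
  (17, 17, 7, 1), (19, 13, 8, 2), (18, 12, 11, 1), (18, 13, 10, 1), (20, 16, 3, 3), (18, 14, 9, 1),
  (17, 13, 12, 0), (18, 15, 8, 1), (19, 17, 4, 2), (17, 15, 10, 0), (19, 18, 3, 2), (18, 17, 6, 1),
  (17, 16, 9, 0), (19, 19, 2, 2), (18, 18, 5, 1), (17, 17, 8, 0), (19, 11, 11, 1), (19, 13, 9, 1),
  (18, 13, 11, 0), (18, 14, 10, 0), (19, 18, 4, 1), (18, 17, 7, 0), (19, 19, 3, 1), (21, 17, 2, 2),
  (19, 15, 8, 0), (20, 18, 3, 1), (19, 17, 6, 0), (20, 19, 2, 1), (19, 18, 5, 0), (19, 19, 4, 0),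
  (20, 11, 11, 0), (20, 19, 3, 0), (26, 6, 5, 5), (22, 18, 1, 1), (21, 19, 2, 0), (21, 20, 1, 0),
  (23, 19, 0, 0), (28, 5, 5, 4), (29, 5, 5, 3), (31, 5, 3, 3), (32, 5, 5, 0), (13, 12, 12, 12),
  (13, 13, 12, 11), (14, 12, 12, 11), (14, 13, 11, 11), (13, 13, 13, 10), (15, 12, 11, 11), (14, 13, 12, 10),
  (14, 14, 11, 10), (16, 11, 11, 11), (15, 12, 12, 10), (15, 13, 11, 10), (15, 14, 10, 10), (14, 13, 13, 9),
  (14, 14, 12, 9), (16, 12, 11, 10), (16, 13, 10, 10), (15, 13, 12, 9), (15, 14, 11, 9), (15, 15, 10, 9),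
  (14, 14, 13, 8), (17, 11, 11, 10), (17, 12, 10, 10), (16, 12, 12, 9), (16, 13, 11, 9), (16, 14, 10, 9),
  (15, 13, 13, 8), (16, 15, 9, 9), (15, 14, 12, 8), (15, 15, 11, 8), (14, 14, 14, 7), (18, 11, 10, 10),
  (17, 12, 11, 9), (17, 13, 10, 9), (17, 14, 9, 9), (16, 13, 12, 8), (16, 14, 11, 8), (16, 15, 10, 8),
  (15, 14, 13, 7), (16, 16, 9, 8), (15, 15, 12, 7), (18, 12, 10, 9), (18, 13, 9, 9), (17, 12, 12, 8),
  (17, 13, 11, 8), (17, 14, 10, 8), (16, 13, 13, 7), (17, 15, 9, 8), (16, 14, 12, 7), (17, 16, 8, 8),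
  (16, 15, 11, 7), (15, 14, 14, 6), (16, 16, 10, 7), (15, 15, 13, 6), (18, 12, 11, 8), (18, 13, 10, 8),
  (18, 14, 9, 8), (17, 13, 12, 7), (18, 15, 8, 8), (17, 14, 11, 7), (17, 15, 10, 7), (16, 14, 13, 6),
  (17, 16, 9, 7), (16, 15, 12, 6), (17, 17, 8, 7), (16, 16, 11, 6), (15, 15, 14, 5), (19, 13, 9, 8),
  (18, 12, 12, 7), (18, 13, 11, 7), (18, 14, 10, 7), (17, 13, 13, 6), (18, 15, 9, 7), (17, 14, 12, 6),
  (17, 15, 11, 6), (16, 14, 14, 5), (18, 17, 7, 7), (17, 16, 10, 6), (16, 15, 13, 5), (17, 17, 9, 6),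
  (16, 16, 12, 5), (15, 15, 15, 4), (19, 13, 10, 7), (19, 14, 9, 7), (18, 13, 12, 6), (18, 15, 10, 6),
  (17, 14, 13, 5), (17, 15, 12, 5), (18, 17, 8, 6), (16, 15, 14, 4), (18, 18, 7, 6), (17, 17, 10, 5),
  (19, 13, 11, 6), (20, 15, 7, 7), (19, 14, 10, 6), (18, 13, 13, 5), (19, 15, 9, 6), (18, 15, 11, 5),
  (17, 15, 13, 4), (19, 18, 6, 6), (18, 17, 9, 5), (17, 16, 12, 4), (16, 15, 15, 3), (18, 18, 8, 5),
  (17, 17, 11, 4), (16, 16, 14, 3), (19, 13, 12, 5), (19, 14, 11, 5), (18, 14, 13, 4), (17, 15, 14, 3),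
  (18, 17, 10, 4), (17, 16, 13, 3), (19, 19, 6, 5), (17, 17, 12, 3), (16, 16, 15, 2), (19, 13, 13, 4),
  (18, 14, 14, 3), (18, 15, 13, 3), (17, 15, 15, 2), (20, 19, 5, 5), (19, 18, 8, 4), (17, 16, 14, 2),
  (19, 19, 7, 4), (18, 18, 10, 3), (17, 17, 13, 2), (16, 16, 16, 1), (18, 15, 14, 2), (20, 19, 6, 4),
  (18, 17, 12, 2), (17, 16, 15, 1), (19, 19, 8, 3), (17, 17, 14, 1), (19, 15, 13, 2), (18, 15, 15, 1),
  (18, 16, 14, 1), (21, 20, 4, 4), (18, 17, 13, 1), (17, 16, 16, 0), (20, 20, 6, 3), (19, 19, 9, 2),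
  (17, 17, 15, 0), (19, 15, 14, 1), (18, 16, 15, 0), (18, 17, 14, 0), (21, 21, 4, 3), (19, 15, 15, 0),
  (19, 17, 13, 0), (22, 21, 3, 3), (21, 21, 5, 2), (19, 19, 11, 0), (20, 15, 14, 0), (23, 22, 2, 2),
  (22, 22, 4, 1), (21, 21, 7, 0), (24, 23, 1, 1), (23, 23, 3, 0), (25, 23, 1, 0), (25, 24, 0, 0),
  (14, 14, 14, 14), (15, 14, 14, 13), (15, 15, 13, 13), (16, 14, 13, 13), (15, 15, 14, 12), (17, 13, 13, 13),
  (16, 14, 14, 12), (16, 15, 13, 12), (16, 16, 12, 12), (15, 15, 15, 11), (17, 14, 13, 12), (17, 15, 12, 12),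
  (16, 15, 14, 11), (16, 16, 13, 11), (18, 13, 13, 12), (18, 14, 12, 12), (17, 14, 14, 11), (17, 15, 13, 11),
  (17, 16, 12, 11), (16, 15, 15, 10), (17, 17, 11, 11), (16, 16, 14, 10), (19, 13, 12, 12), (18, 14, 13, 11),
  (18, 15, 12, 11), (18, 16, 11, 11), (17, 15, 14, 10), (17, 16, 13, 10), (17, 17, 12, 10), (16, 16, 15, 9),
  (19, 13, 13, 11), (19, 15, 11, 11), (18, 15, 13, 10), (17, 15, 15, 9), (18, 17, 11, 10), (18, 18, 10, 10),
  (17, 17, 13, 9), (20, 14, 11, 11), (19, 14, 13, 10), (19, 15, 12, 10), (19, 16, 11, 10), (18, 15, 14, 9),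
  (19, 17, 10, 10), (18, 16, 13, 9), (18, 17, 12, 9), (17, 16, 15, 8), (18, 18, 11, 9), (17, 17, 14, 8),
  (20, 15, 11, 10), (19, 14, 14, 9), (19, 15, 13, 9), (18, 15, 15, 8), (18, 17, 13, 8), (17, 16, 16, 7),
  (19, 19, 9, 9), (17, 17, 15, 7), (21, 15, 10, 10), (19, 18, 11, 8), (19, 19, 10, 8), (17, 17, 16, 6),
  (20, 15, 13, 8), (19, 15, 15, 7), (20, 19, 9, 8), (18, 17, 15, 6), (19, 19, 11, 7), (17, 17, 17, 5),
  (18, 17, 16, 5), (20, 15, 15, 6), (18, 17, 17, 4), (21, 21, 7, 7), (19, 17, 16, 4), (18, 18, 17, 3),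
  (19, 17, 17, 3), (19, 18, 16, 3), (18, 18, 18, 2), (19, 18, 17, 2), (19, 19, 16, 2), (20, 17, 17, 2),
  (19, 18, 18, 1), (19, 19, 17, 1), (20, 18, 17, 1), (20, 19, 16, 1), (19, 19, 18, 0), (21, 17, 17, 1),
  (20, 18, 18, 0), (20, 19, 17, 0), (21, 19, 16, 0), (22, 17, 17, 0), (28, 26, 1, 1), (27, 27, 2, 0),
  (29, 27, 0, 0), (16, 16, 16, 15), (17, 16, 15, 15), (18, 15, 15, 15), (17, 16, 16, 14), (17, 17, 15, 14),
  (18, 16, 15, 14), (18, 17, 14, 14), (17, 17, 16, 13), (19, 15, 15, 14), (19, 16, 14, 14), (18, 16, 16, 13),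
  (18, 17, 15, 13), (18, 18, 14, 13), (17, 17, 17, 12), (20, 15, 14, 14), (19, 16, 15, 13), (19, 17, 14, 13),
  (19, 18, 13, 13), (18, 17, 16, 12), (18, 18, 15, 12), (20, 15, 15, 13), (20, 17, 13, 13), (19, 17, 15, 12),
  (18, 17, 17, 11), (19, 19, 13, 12), (20, 19, 12, 12), (19, 19, 14, 11), (21, 15, 15, 12), (20, 17, 15, 11),
  (19, 17, 17, 10), (19, 19, 19, 6), (20, 19, 19, 5), (21, 19, 19, 4), (20, 20, 20, 3), (21, 20, 19, 3),
  (21, 20, 20, 2), (21, 21, 19, 2), (21, 21, 20, 1), (22, 20, 20, 1), (22, 21, 19, 1), (21, 21, 21, 0),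
  (22, 21, 20, 0), (23, 21, 19, 0), (31, 31, 1, 0), (18, 18, 17, 17), (19, 17, 17, 17), (18, 18, 18, 16),
  (19, 18, 17, 16), (19, 19, 16, 16), (20, 17, 17, 16), (20, 18, 16, 16), (19, 18, 18, 15), (19, 19, 17, 15),
  (21, 17, 16, 16), (20, 18, 17, 15), (20, 19, 16, 15), (20, 20, 15, 15), (19, 19, 18, 14), (21, 19, 15, 15),
  (21, 21, 14, 14), (23, 22, 22, 3), (23, 23, 22, 2), (23, 23, 23, 1), (24, 23, 22, 1), (24, 23, 23, 0),
  (25, 23, 22, 0), (34, 34, 1, 1), (20, 19, 19, 19), (20, 20, 19, 18), (21, 19, 19, 18), (21, 20, 18, 18),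
  (20, 20, 20, 17), (22, 19, 18, 18), (21, 20, 19, 17), (21, 21, 18, 17), (22, 21, 17, 17), (25, 25, 25, 2),
  (26, 25, 25, 1), (27, 25, 25, 0), (21, 21, 21, 21), (22, 21, 21, 20), (22, 22, 20, 20), (23, 21, 20, 20),
  (22, 22, 21, 19), (23, 23, 19, 19), (23, 23, 23, 22), (24, 23, 22, 22), (25, 25, 24, 24), (49, 49, 0, 0)]

/-- DIP's set `X ⊆ ℕ⁴` of Prop. 7.1 as a set of row vectors of `4`-partitions.
[cite: DorflerIkenmeyerPanova2020, Prop. 7.1 (arXiv p. 16)] -/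
def dipGenerators47 : Set (Fin 4 → ℕ) :=
  {μ | (μ 0, μ 1, μ 2, μ 3) ∈ dipGeneratorRows47}

/-- `X` for `(m, n) = (3, 6)` has `89` members, `77` of them of length `3` (the range of Prop. 5.1).
[cite: DorflerIkenmeyerPanova2020, Prop. 3.9 (arXiv p. 6)] -/
theorem length_dipGeneratorRows36 :
    dipGeneratorRows36.length = 89 ∧ (dipGeneratorRows36.filter fun t => 0 < t.2.2).length = 77 := by
  decide

set_option maxRecDepth 100000 in
/-- "The semigroup of 4-partitions `λ` that have `a_λ(d[7]) > 0` has 948 generators, listed in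
Proposition 7.1" (arXiv p. 7). [cite: DorflerIkenmeyerPanova2020, §3 (arXiv p. 7)] -/
theorem length_dipGeneratorRows47 : dipGeneratorRows47.length = 948 := by
  decide

end Data

/-! ### §E. The statements of §2–§3 and §5, §7 as named facts (over `ℂ`) -/

section Facts

/-- `2 ≤ 6`, for `dipPartition 6 = (34, 6, 2)`. [folklore] -/
private theorem two_le_six : 2 ≤ 6 := by norm_num

/-- `2 ≤ 7`, for `dipPartition 7 = (47, 7, 2)`. [folklore] -/
private theorem two_le_seven : 2 ≤ 7 := by norm_num

/-- **Prop. 3.2** (arXiv p. 4, a computer calculation: "8 tableaux that index a basis of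
`HWV_{(34,6,2)}(ℂ[𝔸_3^6]_7)`" evaluated at 8 random points of `Pow_{3,4}^6`, §6 p. 15; plethysm values
by LiE): "`mult_{(34,6,2)}(ℂ[Pow_{3,4}^6]_7) = 8 = a_{(34,6,2)}(7[6])` and
`mult_{(47,7,2)}(ℂ[Pow_{3,4}^7]_8) = 11 = a_{(47,7,2)}(8[7])`." Here `(34,6,2) = dipPartition 6`,
`(47,7,2) = dipPartition 7`, `Pow_{3,4}^n` is `powerSumSet ℂ 3 4 n` (note `k = 4 < d`, so Prop. 3.3
does not apply). DISCHARGEABLE by certificate (the printed tableaux; tree pattern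
`PlethysmTableauEvaluation` / `le_orbitMultiplicity_of_det_eval_ne_zero`); the two plethysm values
are reproduced by the desk check in the typing session (DIP (4.4), independent Vandermonde count).
[cite: DorflerIkenmeyerPanova2020, Prop. 3.2 (arXiv p. 4; TeX multobs.tex L324 {pro:smallcomputercalc}; held paper-arxiv-1901.04576 p0006.txt:L14 "Proposition 3")] -/
def DIP20_prop_3_2 : Prop :=
  coordRingMultiplicity ℂ (powerSumSet ℂ 3 4 6) 6 (Weight.dualOfPartition 3 (dipPartition 6 two_le_six)) = 8 ∧
    plethysmCoeffOfPartition ℂ 3 6 (dipPartition 6 two_le_six) = 8 ∧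
  coordRingMultiplicity ℂ (powerSumSet ℂ 3 4 7) 7 (Weight.dualOfPartition 3 (dipPartition 7 two_le_seven)) = 11 ∧
    plethysmCoeffOfPartition ℂ 3 7 (dipPartition 7 two_le_seven) = 11

/-- **Main Theorem 2.3 (2)(a)** (arXiv p. 4): "Let `k = 4`, `n = 6`, `m = 3`, `d = 7`,
`λ = (n²-2,n,2) = (34,6,2)`. Then `mult_λ(ℂ[Ch_m^n]_d) = 7 < 8 = mult_λ(ℂ[Pow_{m,k}^n]_d)`, i.e., `λ` is a
multiplicity obstruction that shows `Pow_{m,k}^n ⊄ Ch_m^n`", together with the no-occurrence clause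
"(a) cannot be achieved using occurrence obstructions, even for arbitrary `k`: for all `m`-partitions
`μ` that satisfy `a_μ(d[n]) > 0` we have `mult_μ(ℂ[Ch_m^n]_{d'}) > 0`" (= (3.6), p. 5: "`a_μ(d[n]) > 0`
implies `mult_μ(ℂ[Ch_m^n]_d) > 0` for `n = 6`, `m = 3`", the degree being `|μ|/6`). `Ch_3^6` is the set
`chowSet ℂ 3 6` (products of six ternary linear forms — not an orbit closure of a ternary form,
whence the set rendering); part (1) of the theorem is the tree's `DIP2020_thm_2_3_1`
(`ChowVersusPowerSums.lean`, discharged in `ChowVersusPowerSumsProofs.lean`).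
[cite: DorflerIkenmeyerPanova2020, Thm. 2.3 (2)(a) (arXiv p. 4; TeX multobs.tex L280 {thm:main}; held paper-arxiv-1901.04576 p0005.txt:L46–60 "Theorem 1")] -/
def DIP20_thm_2_3_2a : Prop :=
  coordRingMultiplicity ℂ (chowSet ℂ 3 6) 6 (Weight.dualOfPartition 3 (dipPartition 6 two_le_six)) = 7 ∧
  coordRingMultiplicity ℂ (powerSumSet ℂ 3 4 6) 6 (Weight.dualOfPartition 3 (dipPartition 6 two_le_six)) = 8 ∧
  ∀ μ : Fin 3 → ℕ, Antitone μ → 0 < plethysmCoeff ℂ (Fin 3) 6 (rowDual μ) →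
    0 < coordRingMultiplicity ℂ (chowSet ℂ 3 6) 6 (rowDual μ)

/-- **Main Theorem 2.3 (2)(b)** (arXiv p. 4): "Similarly, for `k = 4`, `n = 7`, `m = 4`, `d = 8`,
`λ = (n²-2,n,2) = (47,7,2)` we have `mult_λ(ℂ[Ch_m^n]_d) < 11 = mult_λ(ℂ[Pow_{m,k}^n]_d)`", with the
no-occurrence clause for this setting ("for all `m`-partitions `μ` that satisfy `a_μ(d[n]) > 0` we have
`mult_μ(ℂ[Ch_m^n]_{d'}) > 0`", `m = 4`, `n = 7`). `Ch_4^7 = chowSet ℂ 4 7`; `Pow_{4,4}^7 = powerSumSet ℂ 4 4 7`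
(here `k ≤ m`, so this part is also `orbitMultiplicity` of `x₁⁷+⋯+x₄⁷`, `coordRingMultiplicity_powerSumSet`).
[cite: DorflerIkenmeyerPanova2020, Thm. 2.3 (2)(b) (arXiv p. 4; TeX multobs.tex L280 {thm:main}; held paper-arxiv-1901.04576 p0005.txt:L46–60 "Theorem 1")] -/
def DIP20_thm_2_3_2b : Prop :=
  coordRingMultiplicity ℂ (chowSet ℂ 4 7) 7 (Weight.dualOfPartition 4 (dipPartition 7 two_le_seven)) < 11 ∧
  coordRingMultiplicity ℂ (powerSumSet ℂ 4 4 7) 7 (Weight.dualOfPartition 4 (dipPartition 7 two_le_seven)) = 11 ∧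
  ∀ μ : Fin 4 → ℕ, Antitone μ → 0 < plethysmCoeff ℂ (Fin 4) 7 (rowDual μ) →
    0 < coordRingMultiplicity ℂ (chowSet ℂ 4 7) 7 (rowDual μ)

/-- **Lemma 3.4** (arXiv p. 5; "see also [Lan17, Sec. 9.2.3]"): "Let `λ` be an `m`-partition and
`n ≥ m`. Then `mult_λ(ℂ[Ch_m^n]_d) ≤ a_λ(n[d])`." Proof in print: `Ch_m^n = 𝔸_m^n ∩ \overline{GL_n(x₁⋯x_n)}`
(inheritance), `ℂ[\overline{GL_n x₁⋯x_n}]_d ⊆ ℂ[GL_n x₁⋯x_n]_d = ℂ[GL_n]^H_d`, `H = T ⋊ 𝔖_n` the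
stabilizer, algebraic Peter–Weyl, `dim {λ}^H = a_λ(n[d])`. Here `a_λ(n[d])` (inner degree `d`,
outer `n`) is `plethysmCoeffOfPartition ℂ m d λ` ("assuming `m` is large enough": `ℓ(λ) ≤ m`; the
value does not depend on `m ≥ ℓ(λ)`, tree: `plethysmCoeffOfPartition_eq_of_card_parts_le`).
Guard `0 < d`: the printed Lemma 3.4 concerns `ℂ[Ch_m^n]_d` for `d ≥ 1` (at `d = 0` it reads `1 ≤ 1`);
in the tree, at inner degree `0` the value `plethysmCoeffOfPartition ℂ m 0 ∅` is the `finrank` junk `0`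
(trivial action on `ℂ[Sym^0]`, see `plethysmCoeff`) while `mult_∅ ℂ[Ch_m^n]_0 = 1` (constants), so the
unguarded sentence would be false at `d = 0` (bip referee rows 70/73; first typed without the guard in
p419565, corrected in p430558).
DISCHARGED in the sibling file `DIP20ChowUpperBoundProofs.lean` (`DIP20_lem_3_4_holds`, val-lit-p6): few
letters to `n` variables (`coordRingMultiplicity_chowSet_dualOfPartition`), then the Hermite–Hadamard–Howe
pullback `chowPullback` and the plethysm bridge `plethysmRestitution` (`ChowPullback.lean`,
`ChowPlethysmBridge.lean`) with rank–nullity, in place of the printed Peter–Weyl count.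
[cite: DorflerIkenmeyerPanova2020, Lemma 3.4 (arXiv p. 5; TeX multobs.tex L339 {lem:chowupperbound}; held paper-arxiv-1901.04576 p0006.txt:L32 "Lemma 5")] -/
def DIP20_lem_3_4 : Prop :=
  ∀ (m n d : ℕ), m ≤ n → 0 < d → ∀ lam : Nat.Partition (d * n), lam.parts.card ≤ m →
    coordRingMultiplicity ℂ (chowSet ℂ m n) n (Weight.dualOfPartition m lam) ≤
      plethysmCoeffOfPartition ℂ m d lam

/-- **Theorem 3.5** (arXiv p. 5): "`a_{(n²-2,n,2)}((n+1)[n]) = 1 + a_{(n²-2,n,2)}(n[n+1])`" (`n ≥ 2`;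
`(n²-2,n,2) = dipPartition n`, three rows; inner degree `n` on the left, `n+1` on the right). Printed
proof: §4, Cor. 4.8 (`DIP20_cor_4_8`, case `r = n`). Desk-checked for `n = 2,…,6` in the typing
session. FACT (symmetric-function computation).
[cite: DorflerIkenmeyerPanova2020, Thm. 3.5 (arXiv p. 5; TeX multobs.tex L378 {thm:plethineq}; held paper-arxiv-1901.04576 p0006.txt:L83 "Theorem 6")] -/
def DIP20_thm_3_5 : Prop :=
  ∀ (n : ℕ) (hn : 2 ≤ n),
    plethysmCoeffOfPartition ℂ 3 n (dipPartition n hn) =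
      1 + plethysmCoeffOfPartition ℂ 3 (n + 1) (dipPartition n hn)

/-- **Lemma 3.7** (arXiv p. 5): "Let `λ̄ := (λ₂, λ₃, …)` denote `λ` without its first row. If `λ` is an
`m`-partition of `dn` and `λ̄ ∈ {(3,3), (3,1), (2,1), (1,1), (1)}`, then `a_λ(d[n]) = 0`" ("proved by a
finite calculation for all cases but `(3,3)` as Thm 1.10(a) in [IP17]" = IP17 Thm. 1.7(a), tree
`Complexity.ikenmeyerPanova2017_thm_1_7a`). Row form: such `λ` has at most `3` rows, and
`a_λ(d[n]) = plethysmCoeff ℂ (Fin 3) n (rowDual λ)` (independent of `m ≥ ℓ(λ)`; the degree `d` is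
pinned by the weight, and the coefficient is `0` anyway when `n ∤ |λ|`).
[cite: DorflerIkenmeyerPanova2020, Lemma 3.7 (arXiv p. 5; TeX multobs.tex L397 {lem:vanishingpleth}; held paper-arxiv-1901.04576 p0006.txt:L105 "Lemma 7")] -/
def DIP20_lem_3_7 : Prop :=
  ∀ (n : ℕ) (μ : Fin 3 → ℕ), Antitone μ → (μ 1, μ 2) ∈ dipTails36 →
    plethysmCoeff ℂ (Fin 3) n (rowDual μ) = 0

/-- **(3.8), the semigroup property of positive plethysm coefficients** (arXiv p. 6): "If
`a_μ(d[n]) > 0` and `a_ν(d'[n]) > 0`, then `a_{μ+ν}((d+d')[n]) > 0`" ("A detailed proof … in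
[BI18, Prop. 21.2.6]"; products of highest-weight vectors in the domain `ℂ[𝔸_m^n]`). Row form for
`m`-partitions `μ, ν` (row-wise sum; `n ≥ 1`). DISCHARGED below (`DIP20_eq_3_8_holds`). [cite: DorflerIkenmeyerPanova2020, eq. (3.8) (arXiv p. 6; TeX multobs.tex L409 {eq:plethsemigroup}; held paper-arxiv-1901.04576 p0006.txt:L118)] -/
def DIP20_eq_3_8 : Prop :=
  ∀ (m n : ℕ) (μ ν : Fin m → ℕ), 0 < n → 0 < plethysmCoeff ℂ (Fin m) n (rowDual μ) →
    0 < plethysmCoeff ℂ (Fin m) n (rowDual ν) → 0 < plethysmCoeff ℂ (Fin m) n (rowDual (μ + ν))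

/-- Row-wise sums of partitions have additive dual weights. [cite: DorflerIkenmeyerPanova2020, eq. (3.8) (arXiv p. 6)] -/
theorem rowDual_add {m : ℕ} (μ ν : Fin m → ℕ) : rowDual (μ + ν) = rowDual μ + rowDual ν := by
  funext i
  simp only [rowDual, Weight.dual, Pi.add_apply, Nat.cast_add, neg_add]

/-- **Discharge of (3.8)**: products of highest-weight vectors of `ℂ[𝔸_m^n]` (a domain) are nonzero
highest-weight vectors of the sum weight (the tree's `mul_mem_highestWeightSpace_coordRep`), so
positive plethysm coefficients form a semigroup — the argument of [BI18, Prop. 21.2.6] cited in print.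
[cite: DorflerIkenmeyerPanova2020, eq. (3.8) (arXiv p. 6)] -/
theorem DIP20_eq_3_8_holds : DIP20_eq_3_8 := by
  intro m n μ ν hn hμ hν
  haveI : ∀ χ, FiniteDimensional ℂ ↥(highestWeightSpace (coordRep (Fin m) ℂ n) χ) :=
    fun χ => finiteDimensional_highestWeightSpace_coordRep_holds (Nat.pos_iff_ne_zero.mp hn) χ
  unfold plethysmCoeff hwMultiplicity at hμ hν ⊢
  obtain ⟨F, hF0⟩ := Module.finrank_pos_iff_exists_ne_zero.mp hμ
  obtain ⟨G, hG0⟩ := Module.finrank_pos_iff_exists_ne_zero.mp hν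
  have hFG : F.1 * G.1 ∈ highestWeightSpace (coordRep (Fin m) ℂ n) (rowDual (μ + ν)) := by
    rw [rowDual_add]
    exact mul_mem_highestWeightSpace_coordRep F.2 G.2
  refine Module.finrank_pos_iff_exists_ne_zero.mpr ⟨⟨F.1 * G.1, hFG⟩, fun h => ?_⟩
  have hF0' : F.1 ≠ 0 := fun h0 => hF0 (Subtype.ext h0)
  have hG0' : G.1 ≠ 0 := fun h0 => hG0 (Subtype.ext h0)
  exact mul_ne_zero hF0' hG0' (congrArg Subtype.val h)

/-- **Prop. 3.9** (arXiv p. 6): "The set `X` [`dipGenerators36`, 89 rows] is the set of generators of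
the semigroup of 3-partitions `μ` that have `a_μ(d[6]) > 0`" (`d = |μ|/6`; LiE for
`μ ∈ X ∖ {(45,45)}`, Sturmfels' formula [Stu08, Cor. 4.2.8] for `a_{(45,45)}(15[6]) > 0`, brute force up
to `d ≤ 26` / `d ≤ 14`, and Prop. 3.10). Desk check in the typing session: for `d ≤ 5` the
3-partitions with `a_μ(d[6]) > 0` are exactly the sums of rows of `X` of size `6d`.
[cite: DorflerIkenmeyerPanova2020, Prop. 3.9 (arXiv p. 6; TeX multobs.tex L414 {pro:listofgenerators}; held paper-arxiv-1901.04576 p0006.txt:L123 "Proposition 8")] -/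
def DIP20_prop_3_9 : Prop :=
  ∀ μ : Fin 3 → ℕ, Antitone μ →
    (0 < plethysmCoeff ℂ (Fin 3) 6 (rowDual μ) ↔ μ ∈ AddSubmonoid.closure dipGenerators36)

/-- **Prop. 3.10** (arXiv p. 6): "If `λ` is a 3-partition of `6d`, `d ≥ 15`, and
`λ̄ ∉ {(3,3),(3,1),(2,1),(1,1),(1)}`, then `λ` is a sum of partitions from `X`." (Printed proof:
computer check for `15 ≤ d ≤ 17`, then pigeonhole induction removing `(6)`, `(6,6)` or `(6,6,6)`.)
Purely combinatorial; DISCHARGED in `DIP20PlethysmSemigroupGenerators.lean` (`DIP20_prop_3_10_holds`: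
kernel-checked certificates for `15 ≤ d ≤ 17` + the printed induction).
[cite: DorflerIkenmeyerPanova2020, Prop. 3.10 (arXiv p. 6; TeX multobs.tex L436 {pro:generators}; held paper-arxiv-1901.04576 p0007.txt:L23 "Proposition 9")] -/
def DIP20_prop_3_10 : Prop :=
  ∀ (d : ℕ), 15 ≤ d → ∀ μ : Fin 3 → ℕ, Antitone μ → ∑ i, μ i = 6 * d →
    (μ 1, μ 2) ∉ dipTails36 → μ ∈ AddSubmonoid.closure dipGenerators36

/-- **(3.11), the semigroup property for the Chow variety** (arXiv p. 6): "If `mult_μ(ℂ[Ch_m^n]_d) > 0`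
and `mult_ν(ℂ[Ch_m^n]_{d'}) > 0`, then `mult_{μ+ν}(ℂ[Ch_m^n]_{d+d'}) > 0`" ("a semigroup property
analogous to (3.8) holds (the same proof applies)"). Row form, `Ch_m^n = chowSet ℂ m n`, `n ≥ 1`
(DISCHARGEABLE: `ℂ[Ch_m^n]` is a domain — `Ch_m^n` is irreducible — and products of highest-weight
vectors not vanishing on `Ch_m^n` do not vanish on it).
[cite: DorflerIkenmeyerPanova2020, eq. (3.11) (arXiv p. 6; TeX multobs.tex L453; held paper-arxiv-1901.04576 p0007.txt:L43)] -/
def DIP20_eq_3_11 : Prop :=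
  ∀ (m n : ℕ) (μ ν : Fin m → ℕ), 0 < n → 0 < coordRingMultiplicity ℂ (chowSet ℂ m n) n (rowDual μ) →
    0 < coordRingMultiplicity ℂ (chowSet ℂ m n) n (rowDual ν) →
    0 < coordRingMultiplicity ℂ (chowSet ℂ m n) n (rowDual (μ + ν))

/-- **Prop. 3.12** (arXiv p. 7): "Let `μ` be a 3-partition of length at most 2. If `a_μ(d[n]) > 0`, then
`mult_μ(ℂ[Ch_m^n]_d) > 0`." (Context `m = 3`; printed proof: for 2-partitions
`a_μ(d[n]) = mult_μ(ℂ[Ch_2^n]_d)` since every binary form splits into linear factors — "This is how the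
Hermite reciprocity can be proved" — then inheritance `Ch_2^n → Ch_3^n`, [Ike12, Lemma 4.3.2].)
DISCHARGED below (`DIP20_prop_3_12_holds`, §K–§L: fundamental theorem of algebra for binary forms + the
few-letter inheritance of `FewLetterEquations.lean`). [cite: DorflerIkenmeyerPanova2020, Prop. 3.12 (arXiv p. 7; TeX multobs.tex L460 {pro:fewrows}; held paper-arxiv-1901.04576 p0007.txt:L51 "Proposition 10")] -/
def DIP20_prop_3_12 : Prop :=
  ∀ (n : ℕ) (μ : Fin 3 → ℕ), Antitone μ → μ 2 = 0 → 0 < plethysmCoeff ℂ (Fin 3) n (rowDual μ) →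
    0 < coordRingMultiplicity ℂ (chowSet ℂ 3 n) n (rowDual μ)

/-- **Lemma 3.13** (arXiv p. 7): "If `λ` is an `m`-partition of `dn` and `λ̄ ∈ Y` [`dipTails47`], then
`a_λ(d[n]) = 0`" ("proven exactly like Lemma 3.7"). Row form: such `λ` has at most `4` rows.
[cite: DorflerIkenmeyerPanova2020, Lemma 3.13 (arXiv p. 7; TeX multobs.tex L480 {lem:vanishingpleth74}; held paper-arxiv-1901.04576 p0007.txt:L71 "Lemma 11")] -/
def DIP20_lem_3_13 : Prop :=
  ∀ (n : ℕ) (μ : Fin 4 → ℕ), Antitone μ → (μ 1, μ 2, μ 3) ∈ dipTails47 →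
    plethysmCoeff ℂ (Fin 4) n (rowDual μ) = 0

/-- **Prop. 3.14** (arXiv p. 7): "If `λ` is a 4-partition of `7d`, `d ≥ 14`, and `λ̄ ∉ Y`, then `λ` is a
sum of partitions from `X`" (`X` = `dipGenerators47`, 948 rows; "proved completely analogously to
Proposition 3.10"). DISCHARGED in `DIP20PlethysmSemigroupGenerators47.lean` (`DIP20_prop_3_14_holds`:
kernel-checked certificates for `14 ≤ d ≤ 21` + an induction removing twelve actual rows of `X` —
`(7,7)`, `(7,7,7)`, `(7,7,7,7)` are not in `X`). [cite: DorflerIkenmeyerPanova2020, Prop. 3.14 (arXiv p. 7; TeX multobs.tex L498 {pro:generators74}; held paper-arxiv-1901.04576 p0008.txt:L3 "Proposition 12")] -/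
def DIP20_prop_3_14 : Prop :=
  ∀ (d : ℕ), 14 ≤ d → ∀ μ : Fin 4 → ℕ, Antitone μ → ∑ i, μ i = 7 * d →
    (μ 1, μ 2, μ 3) ∉ dipTails47 → μ ∈ AddSubmonoid.closure dipGenerators47

/-- **Prop. 7.1** (§7 "Generators for `m = 4`, `n = 7`", arXiv p. 16): "The set `X` [948 rows,
`dipGenerators47`] is the set of generators of the semigroup of 4-partitions `μ` that have
`a_μ(d[7]) > 0`" (p. 7: LiE for `μ ∈ X ∖ {(49,49), (24,24,23,23)}`; for those two,
`mult_μ(ℂ[Ch_4^7]_d) > 0` by the computer calculation, which implies `a_μ(d[7]) > 0`).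
[cite: DorflerIkenmeyerPanova2020, Prop. 7.1 (arXiv p. 16; TeX multobs.tex L906 {pro:listofgenerators74}; held paper-arxiv-1901.04576 p0015.txt:L3 "Proposition 19")] -/
def DIP20_prop_7_1 : Prop :=
  ∀ μ : Fin 4 → ℕ, Antitone μ →
    (0 < plethysmCoeff ℂ (Fin 4) 7 (rowDual μ) ↔ μ ∈ AddSubmonoid.closure dipGenerators47)

/-- **Prop. 5.1** (arXiv p. 12; the tableaux are listed in §8, pp. 17–24): "If `X` is defined as in
Proposition 3.9, then for all `μ ∈ X` of length 3 we have `mult_μ(ℂ[Ch_3^6]) > 0`. If `X` is defined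
as in Proposition 7.1, then for all `μ ∈ X` we have `mult_μ(ℂ[Ch_4^7]) > 0`." (Degree `|μ|/n`, pinned by
the weight.) DISCHARGEABLE by certificate replay: one tableau `T` and one point `p ∈ Ch_m^n` per `μ`
with the contraction (5.6) nonzero (tree pattern: `PlethysmTableauEvaluation`, evaluation rank
bounds of `HwvEvaluationRankBound.lean`). [cite: DorflerIkenmeyerPanova2020, Prop. 5.1 (arXiv p. 12; TeX multobs.tex L737 {pro:computercalc}; held paper-arxiv-1901.04576 p0012.txt:L7 "Proposition 18")] -/
def DIP20_prop_5_1 : Prop :=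
  (∀ μ ∈ dipGenerators36, 0 < μ 2 → 0 < coordRingMultiplicity ℂ (chowSet ℂ 3 6) 6 (rowDual μ)) ∧
  (∀ μ ∈ dipGenerators47, 0 < coordRingMultiplicity ℂ (chowSet ℂ 4 7) 7 (rowDual μ))

/-- **Prop. 3.15** (arXiv pp. 7–8): "The following partitions give occurrence obstructions that show
`Pow_{m,d}^n ⊄ Ch_m^n`": `(m,n,λ,d) = (3,2,(2,2,2),3)`, `(3,3,(7,3,2),4)`, `(3,4,(11,9,8),7)`,
`(3,5,(12,9,9),6)`, `(4,6,(14,14,13,13),9)` — i.e. `mult_λ(ℂ[Ch_m^n]_d) = 0 < mult_λ(ℂ[Pow_{m,d}^n]_d)`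
(printed proof: "Lemma 3.4 implies `mult_λ(ℂ[Ch_m^n]_d) ≤ a_λ(n[d]) = 0`. Proposition 3.3 implies
`mult_λ(ℂ[Pow_{m,d}^n]_d) > 0`"; note that in the first row `n = 2 < m = 3`, outside Lemma 3.4's printed
hypothesis `n ≥ m` — there `Ch_3^2` = rank-`≤ 2` ternary quadrics and the type `(2,2,2)` is the
discriminant, which vanishes on them). The printed table of plethysm values is `DIP20_prop_3_15_table`.
[cite: DorflerIkenmeyerPanova2020, Prop. 3.15 (arXiv p. 7; TeX multobs.tex L513 {pro:occobsdoexist}; held paper-arxiv-1901.04576 p0008.txt:L18 "Proposition 13")] -/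
def DIP20_prop_3_15 : Prop :=
  (coordRingMultiplicity ℂ (chowSet ℂ 3 2) 2 (rowDual ![2, 2, 2]) = 0 ∧
    0 < coordRingMultiplicity ℂ (powerSumSet ℂ 3 3 2) 2 (rowDual ![2, 2, 2])) ∧
  (coordRingMultiplicity ℂ (chowSet ℂ 3 3) 3 (rowDual ![7, 3, 2]) = 0 ∧
    0 < coordRingMultiplicity ℂ (powerSumSet ℂ 3 4 3) 3 (rowDual ![7, 3, 2])) ∧
  (coordRingMultiplicity ℂ (chowSet ℂ 3 4) 4 (rowDual ![11, 9, 8]) = 0 ∧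
    0 < coordRingMultiplicity ℂ (powerSumSet ℂ 3 7 4) 4 (rowDual ![11, 9, 8])) ∧
  (coordRingMultiplicity ℂ (chowSet ℂ 3 5) 5 (rowDual ![12, 9, 9]) = 0 ∧
    0 < coordRingMultiplicity ℂ (powerSumSet ℂ 3 6 5) 5 (rowDual ![12, 9, 9])) ∧
  (coordRingMultiplicity ℂ (chowSet ℂ 4 6) 6 (rowDual ![14, 14, 13, 13]) = 0 ∧
    0 < coordRingMultiplicity ℂ (powerSumSet ℂ 4 9 6) 6 (rowDual ![14, 14, 13, 13]))

/-- **The table of Prop. 3.15** (arXiv p. 8), columns `a_λ(d[n])` (inner degree `n`) and `a_λ(n[d])`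
(inner degree `d`): `(2,2,2)`: `1, 0` (`d=3,n=2`); `(7,3,2)`: `1, 0` (`4, 3`); `(11,9,8)`: `1, 0` (`7, 4`);
`(12,9,9)`: `1, 0` (`6, 5`); `(14,14,13,13)`: `a_λ(6[9]) = 0` ("computations were performed with the
LiE software"). PRINT ERRATUM CANDIDATE (typing session, two independent evaluations — DIP's own
formula (4.4) and Vandermonde extraction): the printed `a_{(14,14,13,13)}(9[6]) = 11` evaluates to
`19`; only its positivity is used by the proposition, and only positivity is typed for that entry.
The other nine entries are reproduced.
[cite: DorflerIkenmeyerPanova2020, Prop. 3.15 table (arXiv p. 8; held paper-arxiv-1901.04576 p0008.txt:L18–30)] -/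
def DIP20_prop_3_15_table : Prop :=
  (plethysmCoeff ℂ (Fin 3) 2 (rowDual ![2, 2, 2]) = 1 ∧ plethysmCoeff ℂ (Fin 3) 3 (rowDual ![2, 2, 2]) = 0) ∧
  (plethysmCoeff ℂ (Fin 3) 3 (rowDual ![7, 3, 2]) = 1 ∧ plethysmCoeff ℂ (Fin 3) 4 (rowDual ![7, 3, 2]) = 0) ∧
  (plethysmCoeff ℂ (Fin 3) 4 (rowDual ![11, 9, 8]) = 1 ∧ plethysmCoeff ℂ (Fin 3) 7 (rowDual ![11, 9, 8]) = 0) ∧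
  (plethysmCoeff ℂ (Fin 3) 5 (rowDual ![12, 9, 9]) = 1 ∧ plethysmCoeff ℂ (Fin 3) 6 (rowDual ![12, 9, 9]) = 0) ∧
  (0 < plethysmCoeff ℂ (Fin 4) 6 (rowDual ![14, 14, 13, 13]) ∧
    plethysmCoeff ℂ (Fin 4) 9 (rowDual ![14, 14, 13, 13]) = 0)

end Facts

/-! ### §F. The plethysm combinatorics of §4 (arXiv pp. 8–12) -/

section PlethysmCombinatorics

/-- **`c_ν(d,n)`** (DIP (4.3), arXiv p. 9): "`c_ν(d,n) := (x^ν) @ h_d[h_n] = ⟨h_ν, h_d[h_n]⟩ =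
#{(b) : |b| = d, Σ_i b_i α^i = ν}`", the number of weak compositions `b` of `d`, indexed by the weak
compositions `α^i` of `n` of length `ℓ = ℓ(ν)`, with `Σ_i b_i α^i = ν` — equivalently the number of
multisets of `d` weak `ℓ`-compositions of `n` with vector sum `ν` (the coefficient of the monomial
`x^ν` in the plethysm `h_d[h_n(x_1,…,x_ℓ)]`).
[cite: DorflerIkenmeyerPanova2020, eq. (4.3) (arXiv p. 9; TeX multobs.tex L585 {eq:mon_coef}; held paper-arxiv-1901.04576 p0009.txt:L66)] -/
def dipMonomialCount {ℓ : ℕ} (ν : Fin ℓ → ℕ) (d n : ℕ) : ℕ :=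
  Nat.card {M : Multiset (Fin ℓ → ℕ) //
    Multiset.card M = d ∧ (∀ α ∈ M, ∑ i, α i = n) ∧ M.sum = ν}

/-- **`p_r(a,b)`**, "the number of partitions of `r` which fit inside an `a × b` rectangle" (arXiv
p. 9; at most `a` parts, each at most `b`). [cite: DorflerIkenmeyerPanova2020, §4 (arXiv p. 9)] -/
def boxPartitionCount (r a b : ℕ) : ℕ :=
  Nat.card {μ : Nat.Partition r // μ.parts.card ≤ a ∧ ∀ x ∈ μ.parts, x ≤ b}

/-- **The Gaussian binomial coefficient `binom(a+b, a)_q`**, DEFINED by the printed generating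
function "`binom(a+b, a)_q = (1-q)⋯(1-q^{a+b}) / ((1-q)⋯(1-q^a)(1-q)⋯(1-q^b)) = Σ_{r=0}^{ab} p_r(a,b) q^r`"
(arXiv p. 9, [Sta11]) as the integer polynomial `Σ_{r ≤ ab} p_r(a,b) q^r`; DIP's `binom(N, K)_q` is
`gaussBinomial K (N - K)` for `K ≤ N` (e.g. `binom(n+d-2, n)_q = gaussBinomial n (d-2)`,
`binom(n, 1)_q = gaussBinomial 1 (n-1)`, `binom(n, 2)_q = gaussBinomial 2 (n-2)`). The product formula
is not asserted here. [cite: DorflerIkenmeyerPanova2020, §4 (arXiv p. 9)] -/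
def gaussBinomial (a b : ℕ) : Polynomial ℤ :=
  ∑ r ∈ Finset.range (a * b + 1), Polynomial.C (boxPartitionCount r a b : ℤ) * Polynomial.X ^ r

/-- An integer polynomial as a rational power series (for the coefficient extractions `(q^k) @ f` of
Props. 4.6–4.7, whose `f` are written with denominators `1 - q^j`). [folklore] -/
def toRatPowerSeries (p : Polynomial ℤ) : PowerSeries ℚ :=
  ((p.map (Int.castRingHom ℚ) : Polynomial ℚ) : PowerSeries ℚ)

/-- **(4.4), plethysm coefficients by Jacobi–Trudi** (arXiv p. 9): "`a_λ(d[n]) =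
⟨det[h_{λ_i - i + j}]_{i,j=1}^{ℓ(λ)}, h_d[h_n]⟩ = Σ_{π ∈ S_{ℓ(λ)}} sgn(π) c_{λ + π - (1,2,…)}(d,n)`, where the
permutations `π` are viewed as vectors with entries `1, 2, …, ℓ(λ)`" (terms with a negative entry of
`λ + π - (1,2,…)` are `0`, `h_{-j} = 0`). With `a_λ(d[n]) = plethysmCoeff ℂ (Fin ℓ) n (rowDual λ)` for a
row vector `λ` of size `dn` (`n ≥ 1`) and `0`-indexed `π`. FACT (symmetric-function / Schur–Weyl
character theory).
[cite: DorflerIkenmeyerPanova2020, eq. (4.4) (arXiv p. 9; TeX multobs.tex L589 {eq:pleth_det}; held paper-arxiv-1901.04576 p0010.txt:L2)] -/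
def DIP20_eq_4_4 : Prop :=
  ∀ (ℓ n d : ℕ) (lam : Fin ℓ → ℕ), 0 < n → Antitone lam → ∑ i, lam i = d * n →
    (plethysmCoeff ℂ (Fin ℓ) n (rowDual lam) : ℤ) =
      ∑ π : Equiv.Perm (Fin ℓ), ((Equiv.Perm.sign π : ℤˣ) : ℤ) *
        (if ∀ i : Fin ℓ, (i : ℕ) ≤ lam i + (π i : ℕ)
          then (dipMonomialCount (fun i : Fin ℓ => lam i + (π i : ℕ) - (i : ℕ)) d n : ℤ) else 0)

/-- **Prop. 4.5, first two identities** (arXiv p. 9; `ν = (L, k, j)` a partition of `dn` with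
`ν₃ = j ≤ 2`; implicit in print: `n, d ≥ 2`): "`c_{(L,k,1)} = (q^k) @ binom(n,1)_q binom(n+d-1,n)_q`"
and "`c_{(L,k,0)} = (q^k) @ binom(n+d,n)_q = p_k(n,d)`". PRINT ERRATUM CANDIDATE (typing session;
direct evaluation of (4.3) for `2 ≤ n, d ≤ 6`): the third printed identity "`c_{(L,k,2)} = (q^k) @
(binom(n,1)_q binom(n+d-2,n)_q + binom(n-1,1)_q binom(n+d-1,n)_q + q binom(n,2)_q binom(n+d-2,n)_q)`"
is off — the case `b_i = 2` of the printed proof contributes `Σ_r q^{2r}`, i.e. the first factor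
should read `binom(n,1)_{q²}`; with that reading it evaluates correctly (not typed as a fact, being
unprinted; DISCHARGEABLE as a theorem).
[cite: DorflerIkenmeyerPanova2020, Prop. 4.5 (arXiv p. 9; TeX multobs.tex L599 {prop:c_coeffs}; held paper-arxiv-1901.04576 p0010.txt:L12 "Proposition 14")] -/
def DIP20_prop_4_5 : Prop :=
  ∀ (n d L j : ℕ), 2 ≤ n → 2 ≤ d → j ≤ L →
    (L + j = d * n → dipMonomialCount ![L, j, 0] d n = boxPartitionCount j n d) ∧
    (L + j + 1 = d * n → 1 ≤ j →
      dipMonomialCount ![L, j, 1] d n = (gaussBinomial 1 (n - 1) * gaussBinomial n (d - 1)).coeff j)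

/-- **Prop. 4.7** (arXiv p. 11): "Let `λ = (L,r,2)`. We have that `a_λ(d[n]) - a_λ(n[d]) =
(q^r) @ binom(n+d-2, n-1)_q (q^n - q^d) (1-q^{d-1})(1-q^{n-1}) / ((1-q^d)(1-q^n))`" (coefficient
extraction in `ℚ⟦q⟧`; `λ ⊢ dn`, `L ≥ r ≥ 2`; implicit in print `n, d ≥ 2`). Reproduced by direct
evaluation for `2 ≤ n, d ≤ 6` in the typing session. (The printed Prop. 4.6, from which the paper
derives it, inherits the misprint of Prop. 4.5: its `binom(n+d-2,n)_q`-coefficient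
`q(1-q^n)(1-q²+q-q^n)/(1-q²)` should read `q(1-q^n)(1-q^{n+1})/(1-q²)` — PRINT ERRATUM CANDIDATE, not
typed; Prop. 4.7 is correct as printed.) FACT.
[cite: DorflerIkenmeyerPanova2020, Prop. 4.7 (arXiv p. 11; TeX multobs.tex L666 {prop:difference}; held paper-arxiv-1901.04576 p0010.txt:L90 "Proposition 16")] -/
def DIP20_prop_4_7 : Prop :=
  ∀ (n d L r : ℕ), 2 ≤ n → 2 ≤ d → 2 ≤ r → r ≤ L → L + r + 2 = d * n →
    ((plethysmCoeff ℂ (Fin 3) n (rowDual ![L, r, 2]) : ℚ) -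
        (plethysmCoeff ℂ (Fin 3) d (rowDual ![L, r, 2]) : ℚ)) =
      PowerSeries.coeff r
        (toRatPowerSeries (gaussBinomial (n - 1) (d - 1)) *
          (PowerSeries.X ^ n - PowerSeries.X ^ d) * (1 - PowerSeries.X ^ (d - 1)) *
          (1 - PowerSeries.X ^ (n - 1)) * ((1 - PowerSeries.X ^ d) * (1 - PowerSeries.X ^ n))⁻¹)

/-- DIP's family `λ = (n²+n-2-r, r, 2) ⊢ (n+1)·n` of Cor. 4.8 as a row vector (a partition when
`2 ≤ r` and `2r ≤ n²+n-2`); `r = n` gives `(n²-2, n, 2)` = `dipPartition n`.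
[cite: DorflerIkenmeyerPanova2020, Cor. 4.8 (arXiv p. 12)] -/
def dipFamilyRow (n r : ℕ) : Fin 3 → ℕ :=
  ![n ^ 2 + n - 2 - r, r, 2]

/-- **Cor. 4.8 [Theorem 3.5]** (arXiv p. 12): "Let `d = n+1` and `λ = (n²+n-2-r, r, 2)`. Then
`a_λ((n+1)[n]) - a_λ(n[n+1]) ≥ 0`, with `a_λ((n+1)[n]) - a_λ(n[n+1]) = 0` when `r < n`; `= 1` when `r = n`;
`> 0` when `r > n` and `n ≥ 7`, with the exception in the last case when `n = 8`, and `r = 35` when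
`a_{(35,35,2)}(9[8]) = a_{(35,35,2)}(8[9])`." Typed with the last clause RESTRICTED to where it holds —
PRINT ERRATUM CANDIDATE (typing session): by the printed proof itself the difference for `r = n+k+1`
is `p_{k+1}(n+1,n-2) - p_k(n+1,n-2)`, which is `1 - 1 = 0` at `r = n+1` (`k = 0`) for every `n`, and it
also vanishes at `(n, r) = (9, 44)` (`binom(17,7)_q` has equal coefficients `734` at `q^{34}, q^{35}`;
`a_{(44,44,2)}(10[9]) = a_{(44,44,2)}(9[10]) = 109`), a second exception besides the printed `(8, 35)`;
for `7 ≤ n ≤ 60`, `n+2 ≤ r ≤ (n²+n-2)/2` these are the only zeros (Pak–Panova's strict unimodality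
covers `n ≥ 10`). Here `a_λ((n+1)[n]) = plethysmCoeff ℂ (Fin 3) n (rowDual λ)` (inner degree `n`) and
`a_λ(n[n+1])` has inner degree `n+1`.
[cite: DorflerIkenmeyerPanova2020, Cor. 4.8 (arXiv p. 12; TeX multobs.tex L689 {cor:keyinequality}; held paper-arxiv-1901.04576 p0011.txt:L18 "Corollary 17")] -/
def DIP20_cor_4_8 : Prop :=
  ∀ (n r : ℕ), 2 ≤ r → 2 * r ≤ n ^ 2 + n - 2 →
    plethysmCoeff ℂ (Fin 3) (n + 1) (rowDual (dipFamilyRow n r)) ≤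
        plethysmCoeff ℂ (Fin 3) n (rowDual (dipFamilyRow n r)) ∧
    (r < n → plethysmCoeff ℂ (Fin 3) n (rowDual (dipFamilyRow n r)) =
        plethysmCoeff ℂ (Fin 3) (n + 1) (rowDual (dipFamilyRow n r))) ∧
    (r = n → plethysmCoeff ℂ (Fin 3) n (rowDual (dipFamilyRow n r)) =
        plethysmCoeff ℂ (Fin 3) (n + 1) (rowDual (dipFamilyRow n r)) + 1) ∧
    (7 ≤ n → n + 2 ≤ r → (n, r) ≠ (8, 35) → (n, r) ≠ (9, 44) →
      plethysmCoeff ℂ (Fin 3) (n + 1) (rowDual (dipFamilyRow n r)) <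
        plethysmCoeff ℂ (Fin 3) n (rowDual (dipFamilyRow n r))) ∧
    (n = 8 → r = 35 → plethysmCoeff ℂ (Fin 3) n (rowDual (dipFamilyRow n r)) =
        plethysmCoeff ℂ (Fin 3) (n + 1) (rowDual (dipFamilyRow n r)))

/-- **The two box-partition counts of Cor. 4.8's proof** (arXiv p. 12): "`p_26(9,6) = 227 = p_27(9,6)`,
which gives the only exceptional 0 plethysm" (reproduced in the typing session). DISCHARGED below
(`DIP20_cor_4_8_boxCounts_holds`, §M). [cite: DorflerIkenmeyerPanova2020, Cor. 4.8 (proof, arXiv p. 12)] -/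
def DIP20_cor_4_8_boxCounts : Prop :=
  boxPartitionCount 26 9 6 = 227 ∧ boxPartitionCount 27 9 6 = 227

end PlethysmCombinatorics

/-! ### §G. Bridges to the tree's renderings -/

section Bridges

/-- The sorted parts of DIP's `λ = (n²-2, n, 2)` = `dipPartition n` are `[n²-2, n, 2]` (Thm. 2.3's
partition; the private lemma of `ChowVersusPowerSumsProofs.lean`, restated).
[cite: DorflerIkenmeyerPanova2020, Thm. 2.3 (arXiv p. 4)] -/
theorem sortedParts_dipPartition_eq {n : ℕ} (hn : 2 ≤ n) :
    (dipPartition n hn).sortedParts = [n ^ 2 - 2, n, 2] := by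
  have hn2 : 2 ≤ n ^ 2 - 2 := by
    have : 2 * 2 ≤ n * n := Nat.mul_le_mul hn hn
    rw [pow_two]; omega
  have hparts : (dipPartition n hn).parts = ↑[n ^ 2 - 2, n, 2] := by
    rw [dipPartition, Nat.Partition.ofSums_parts, Multiset.filter_eq_self.mpr]
    · rfl
    · intro a ha
      simp only [Multiset.insert_eq_cons, Multiset.mem_cons, Multiset.mem_singleton] at ha
      omega
  change (dipPartition n hn).parts.sort (· ≥ ·) = _
  rw [hparts, Multiset.coe_sort]
  apply List.mergeSort_eq_self
  have h1 : n ≤ n ^ 2 - 2 := by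
    have : n * 2 ≤ n * n := Nat.mul_le_mul_left n hn
    rw [pow_two]; omega
  refine List.Pairwise.cons ?_ (List.Pairwise.cons ?_ (List.pairwise_singleton _ _))
  · intro x hx
    simp only [List.mem_cons, List.not_mem_nil, or_false] at hx
    rcases hx with rfl | rfl
    · exact h1
    · exact hn2
  · intro x hx
    simp only [List.mem_cons, List.not_mem_nil, or_false] at hx
    subst hx
    exact hn

/-- `rowDual (n²-2, n, 2) = λ^*` for `λ = dipPartition n` and `GL_3` (row form versus the tree's
partition form of Thm. 2.3's `λ`). [cite: DorflerIkenmeyerPanova2020, Thm. 2.3 (arXiv p. 4)] -/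
theorem rowDual_dipFamilyRow_self {n : ℕ} (hn : 2 ≤ n) :
    rowDual ![n ^ 2 - 2, n, 2] = Weight.dualOfPartition 3 (dipPartition n hn) := by
  rw [← rowDual_sortedParts 3 (dipPartition n hn), sortedParts_dipPartition_eq hn]
  congr 1
  funext i
  fin_cases i <;> rfl

/-- `dipFamilyRow n n = (n²-2, n, 2)`: Cor. 4.8's family at `r = n` is Thm. 3.5's partition
("[Theorem 3.5]", arXiv p. 12). [cite: DorflerIkenmeyerPanova2020, Cor. 4.8 (arXiv p. 12)] -/
theorem dipFamilyRow_self (n : ℕ) : dipFamilyRow n n = ![n ^ 2 - 2, n, 2] := by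
  unfold dipFamilyRow
  have h : n ^ 2 + n - 2 - n = n ^ 2 - 2 := by
    generalize n ^ 2 = q
    omega
  rw [h]

/-- **Cor. 4.8 (`r = n`) gives Theorem 3.5** ("We are now ready to prove Theorem 3.5 as a Corollary
of the above computations", arXiv p. 12), in the tree's partition vocabulary.
[cite: DorflerIkenmeyerPanova2020, Cor. 4.8 (arXiv p. 12)] -/
theorem DIP20_thm_3_5_of_cor_4_8 (h : DIP20_cor_4_8) : DIP20_thm_3_5 := by
  intro n hn
  have hr : 2 * n ≤ n ^ 2 + n - 2 := by
    have h4 : 2 * n ≤ n ^ 2 := by rw [pow_two]; exact Nat.mul_le_mul_right n hn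
    generalize n ^ 2 = q at h4 ⊢
    omega
  have h3 := (h n n hn hr).2.2.1 rfl
  rw [dipFamilyRow_self, rowDual_dipFamilyRow_self hn] at h3
  unfold plethysmCoeffOfPartition
  rw [h3, Nat.add_comm]

/-- **Main Theorem 2.3 (1) in the set vocabulary** (range `m ≥ n+1` of the tree's discharged fact
`DIP2020_thm_2_3_1_holds`): `mult_λ(ℂ[Ch_m^n]_{n+1}) < mult_λ(ℂ[Pow_{m,n+1}^n]_{n+1})` for `λ = (n²-2,n,2)`,
`n ≥ 2`, with `Ch_m^n = chowSet ℂ m n` and `Pow_{m,n+1}^n` the closure of `powerSumSet ℂ m (n+1) n`.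
(The printed range `3 ≤ m ≤ n` is `dip20_thm_2_3_1_sets_all`, §I.)
[cite: DorflerIkenmeyerPanova2020, Thm. 2.3 (1) (arXiv p. 4)] -/
theorem dip20_thm_2_3_1_sets {n m : ℕ} (hn : 2 ≤ n) (hm : n + 1 ≤ m) :
    coordRingMultiplicity ℂ (chowSet ℂ m n) n (Weight.dualOfPartition m (dipPartition n hn)) <
      coordRingMultiplicity ℂ (powerSumSet ℂ m (n + 1) n) n
        (Weight.dualOfPartition m (dipPartition n hn)) := by
  rw [coordRingMultiplicity_chowSet ((Nat.le_succ n).trans hm) (by omega),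
    coordRingMultiplicity_powerSumSet hm (by omega)]
  exact DIP2020_thm_2_3_1_holds n m hn hm

/-- **(2b)'s power-sum side is an orbit-closure multiplicity** (`k = m = 4`): under Thm. 2.3 (2)(b),
`mult_{(47,7,2)}(ℂ[Δ_7[x₁⁷+x₂⁷+x₃⁷+x₄⁷]]) = 11` in the tree's `orbitMultiplicity` vocabulary.
[cite: DorflerIkenmeyerPanova2020, Thm. 2.3 (2)(b) (arXiv p. 4)] -/
theorem DIP20_thm_2_3_2b.orbitMultiplicity_eq (h : DIP20_thm_2_3_2b) :
    orbitMultiplicity ℂ (partialPowerSum ℂ 4 4 7 le_rfl) 7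
      (Weight.dualOfPartition 4 (dipPartition 7 two_le_seven)) = 11 := by
  rw [← coordRingMultiplicity_powerSumSet le_rfl (by norm_num)]
  exact h.2.1

end Bridges

/-! ### §H. Discharge of (3.11): `I(Ch_m^n)` is prime (generic product of linear forms) -/

section ChowSemigroup

variable {k : Type} [Field k]

/-- The **generic product of `n` linear forms in `m` variables** `∏_i (∑_j Y_{ij} x_j)` with
indeterminate coefficients `Y_{ij}` (`MvPolynomial (Fin n × Fin m) k`): the comorphism of the
parametrisation `(ℓ_1,…,ℓ_n) ↦ ℓ_1⋯ℓ_n` of `Ch_m^n` (DIP §2: "the set of polynomials that can be written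
as a product of homogeneous linear forms"). [cite: DorflerIkenmeyerPanova2020, §2 (arXiv p. 3; TeX multobs.tex L174; held paper-arxiv-1901.04576 p0004.txt:L13)] -/
def genericChowProduct (m n : ℕ) : MvPolynomial (Fin m) (MvPolynomial (Fin n × Fin m) k) :=
  ∏ i : Fin n, ∑ j : Fin m, C (X (i, j)) * X j

/-- Specialising the indeterminate coefficients `Y_{ij} ↦ a_{ij}` in the generic product gives the
product of the linear forms `ℓ_i = ∑_j a_{ij} x_j`. [cite: DorflerIkenmeyerPanova2020, §2 (arXiv p. 3)] -/
theorem map_eval_genericChowProduct (m n : ℕ) (a : Fin n → Fin m → k) :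
    map (eval fun ij : Fin n × Fin m => a ij.1 ij.2) (genericChowProduct (k := k) m n) =
      ∏ i : Fin n, linearForm (a i) := by
  simp only [genericChowProduct, map_prod, map_sum, map_mul, map_C, map_X, eval_X, linearForm]

/-- Hence the coefficients of the generic product evaluate to the coefficients of `∏_i ℓ_i`.
[cite: DorflerIkenmeyerPanova2020, §2 (arXiv p. 3)] -/
theorem eval_coeff_genericChowProduct (m n : ℕ) (a : Fin n → Fin m → k) (e : Fin m →₀ ℕ) :
    eval (fun ij : Fin n × Fin m => a ij.1 ij.2) (coeff e (genericChowProduct (k := k) m n)) =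
      coeff e (∏ i : Fin n, linearForm (a i)) := by
  rw [← map_eval_genericChowProduct m n a, coeff_map]

/-- **The comorphism of the parametrisation of `Ch_m^n`**: the `k`-algebra map
`k[Sym^n k^m] → k[Y_{ij}]`, `X_e ↦ coeff_e (∏_i ∑_j Y_{ij} x_j)`; evaluating the image of `F` at `a`
gives `F` at the coefficient vector of `∏_i ℓ_{a_i}`. [cite: DorflerIkenmeyerPanova2020, §2 (arXiv p. 3)] -/
theorem aeval_genericChowMap (m n : ℕ) (F : MvPolynomial (DegIdx (Fin m) n) k)
    (a : Fin n → Fin m → k) :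
    aeval (fun ij : Fin n × Fin m => a ij.1 ij.2)
      (aeval (fun e : DegIdx (Fin m) n => coeff e.1 (genericChowProduct (k := k) m n)) F) =
      aeval (formCoeff n (∏ i : Fin n, linearForm (a i))) F := by
  have hFG : (fun e : DegIdx (Fin m) n => aeval (fun ij : Fin n × Fin m => a ij.1 ij.2)
      (coeff e.1 (genericChowProduct (k := k) m n))) = formCoeff n (∏ i : Fin n, linearForm (a i)) := by
    funext e
    exact eval_coeff_genericChowProduct m n a e.1
  rw [← AlgHom.comp_apply, comp_aeval, hFG]

/-- **`I(Ch_m^n)` is the kernel of the comorphism** (infinite field): `F` vanishes on all products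
of `n` linear forms iff the polynomial `a ↦ F(∏_i ℓ_{a_i})` in the `nm` coefficients vanishes
identically. [cite: DorflerIkenmeyerPanova2020, §2 (arXiv p. 3)] -/
theorem vanishingIdeal_chowSet_eq_ker [Infinite k] (m n : ℕ) :
    MvPolynomial.vanishingIdeal k (formCoeff n '' chowSet k m n) = RingHom.ker
      (aeval (fun e : DegIdx (Fin m) n => coeff e.1 (genericChowProduct (k := k) m n)) :
        MvPolynomial (DegIdx (Fin m) n) k →ₐ[k] MvPolynomial (Fin n × Fin m) k) := by
  ext F
  rw [MvPolynomial.mem_vanishingIdeal_iff, RingHom.mem_ker]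
  constructor
  · intro hF
    apply MvPolynomial.funext
    intro a
    rw [map_zero, ← aeval_eq_eval, aeval_genericChowMap m n F (fun i j => a (i, j))]
    exact hF _ ⟨_, ⟨fun i j => a (i, j), rfl⟩, rfl⟩
  · intro hF
    rintro _ ⟨_, ⟨a, rfl⟩, rfl⟩
    have h := aeval_genericChowMap m n F a
    rw [hF, map_zero] at h
    exact h.symm

/-- **`I(Ch_m^n)` is prime** (`Ch_m^n` is irreducible, being the image of `V^n`): the kernel of a ring
map into the domain `k[Y_{ij}]`. [cite: DorflerIkenmeyerPanova2020, §2 (arXiv p. 3)] -/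
theorem isPrime_vanishingIdeal_chowSet [Infinite k] (m n : ℕ) :
    (MvPolynomial.vanishingIdeal k (formCoeff n '' chowSet k m n)).IsPrime := by
  rw [vanishingIdeal_chowSet_eq_ker]
  exact RingHom.ker_isPrime _

variable {σ : Type} [Fintype σ] [LinearOrder σ]

/-- **Positivity of `mult_χ k[Z̄]` = a highest-weight vector of weight `χ` not vanishing on `Z`**
(`n ≠ 0`, characteristic zero): DIP §5, "the statement `dim HWV_λ(ℂ[Ch_m^n]_d) > 0` is equivalent to
the existence of … `p ∈ Ch_m^n` such that (5.6) is nonzero" (arXiv p. 13).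
[cite: DorflerIkenmeyerPanova2020, §5 (arXiv p. 13; held paper-arxiv-1901.04576 p0012.txt:L53)] -/
theorem coordRingMultiplicity_pos_iff [CharZero k] {Z : Set (MvPolynomial σ k)} {n : ℕ} (hn : n ≠ 0)
    (χ : Weight σ) :
    0 < coordRingMultiplicity k Z n χ ↔
      ∃ F ∈ highestWeightSpace (coordRep σ k n) χ,
        F ∉ MvPolynomial.vanishingIdeal k (formCoeff n '' Z) := by
  haveI : Infinite k := CharZero.infinite k
  haveI : FiniteDimensional k ↥(highestWeightSpace (coordRep σ k n) χ) :=
    finiteDimensional_highestWeightSpace_coordRep_holds hn χ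
  set H := highestWeightSpace (coordRep σ k n) χ with hH
  set J := H ⊓ (MvPolynomial.vanishingIdeal k (formCoeff n '' Z)).restrictScalars k with hJ
  have hJH : J ≤ H := inf_le_left
  have hle : Module.finrank k ↥J ≤ Module.finrank k ↥H :=
    LinearMap.finrank_le_finrank_of_injective (Submodule.inclusion_injective hJH)
  have hdef : coordRingMultiplicity k Z n χ = Module.finrank k ↥H - Module.finrank k ↥J := rfl
  rw [hdef, Nat.sub_pos_iff_lt]
  constructor
  · intro hlt
    have hne : J ≠ H := fun hJeq => by rw [hJeq] at hlt; exact lt_irrefl _ hlt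
    obtain ⟨F, hFH, hFJ⟩ := SetLike.exists_of_lt (lt_of_le_of_ne hJH hne)
    exact ⟨F, hFH, fun hFI => hFJ (Submodule.mem_inf.mpr ⟨hFH, hFI⟩)⟩
  · rintro ⟨F, hFH, hFI⟩
    by_contra hge
    have hEq : J = H := Submodule.eq_of_le_of_finrank_eq hJH (le_antisymm hle (not_lt.mp hge))
    have hFJ : F ∈ J := by rw [hEq]; exact hFH
    exact hFI (Submodule.mem_inf.mp hFJ).2

/-- **Discharge of (3.11), the semigroup property for `ℂ[Ch_m^n]`**: if highest-weight vectors of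
weights `μ^*`, `ν^*` do not vanish on `Ch_m^n`, neither does their product (of weight `(μ+ν)^*`),
because `I(Ch_m^n)` is prime — "the same proof [as (3.8)] applies" (arXiv p. 6).
[cite: DorflerIkenmeyerPanova2020, eq. (3.11) (arXiv p. 6; TeX multobs.tex L453; held paper-arxiv-1901.04576 p0007.txt:L43)] -/
theorem DIP20_eq_3_11_holds : DIP20_eq_3_11 := by
  intro m n μ ν hn hμ hν
  have hn' : n ≠ 0 := Nat.pos_iff_ne_zero.mp hn
  obtain ⟨F, hF, hFI⟩ := (coordRingMultiplicity_pos_iff hn' _).mp hμ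
  obtain ⟨G, hG, hGI⟩ := (coordRingMultiplicity_pos_iff hn' _).mp hν
  refine (coordRingMultiplicity_pos_iff hn' _).mpr ⟨F * G, ?_, ?_⟩
  · rw [rowDual_add]
    exact mul_mem_highestWeightSpace_coordRep hF hG
  · haveI : Infinite ℂ := CharZero.infinite ℂ
    intro hFG
    rcases (isPrime_vanishingIdeal_chowSet (k := ℂ) m n).mem_or_mem hFG with h | h
    · exact hFI h
    · exact hGI h

end ChowSemigroup

/-! ### §I. Few letters: `mult_λ(ℂ[Ch_m^n]_d)` is a multiplicity of `Δ_n[x₁⋯x_n] ⊆ 𝔸_M^n`, `m ≤ M` -/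

section FewLetters

variable {k : Type} [Field k]

open _root_.Literature.Barriers.ValiantsHypothesis (degIdxMap degIdxMap_injective killCompl_X_app
  killCompl_X_of_not_mem sum_eq_sum_app)

/-- `x₁ ⋯ x_n ≠ 0`. [cite: DorflerIkenmeyerPanova2020, §2 (arXiv p. 3)] -/
theorem truncatedChowMonomial_ne_zero (n M : ℕ) (h : n ≤ M) : truncatedChowMonomial k n M h ≠ 0 := by
  unfold truncatedChowMonomial
  exact Finset.prod_ne_zero_iff.mpr fun i _ => X_ne_zero _

/-- Renaming a linear form along an injection `ι` of the variables gives the linear form with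
coefficients extended by zero. [cite: DorflerIkenmeyerPanova2020, §2 (arXiv p. 3)] -/
theorem rename_linearForm {m M : ℕ} {ι : Fin m → Fin M} (hι : Function.Injective ι)
    (a : Fin m → k) : rename ι (linearForm a) = linearForm (Function.extend ι a 0) := by
  simp only [linearForm, map_sum, map_mul, rename_C, rename_X]
  rw [sum_eq_sum_app hι (fun y => C (Function.extend ι a 0 y) * X y) ?_]
  · refine Finset.sum_congr rfl fun j _ => ?_
    rw [hι.extend_apply]
  · intro y hy
    rw [Function.extend_apply' _ _ _ ?_, Pi.zero_apply, C_0, zero_mul]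
    exact fun ⟨j, hj⟩ => hy ⟨j, hj⟩

/-- `ι(Ch_m^n) ⊆ Ch_M^n`: "Choose bases and embed `𝔸_m^n ⊆ 𝔸_n^n`" (proof of Lemma 3.4, arXiv p. 5).
[cite: DorflerIkenmeyerPanova2020, Lemma 3.4 (proof, arXiv p. 5)] -/
theorem rename_mem_chowSet {m M n : ℕ} {ι : Fin m → Fin M} (hι : Function.Injective ι)
    {p : MvPolynomial (Fin m) k} (hp : p ∈ chowSet k m n) : rename ι p ∈ chowSet k M n := by
  obtain ⟨a, rfl⟩ := hp
  exact ⟨fun i => Function.extend ι (a i) 0, by simp only [map_prod, rename_linearForm hι]⟩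

/-- Killing the variables off `range ι` in a translate `A · x₁⋯x_n` gives a product of `n` linear
forms in the letters of `ι` (the `m`-letter part of an orbit point is a point of `Ch_m^n`).
[cite: DorflerIkenmeyerPanova2020, Lemma 3.4 (proof, arXiv p. 5)] -/
theorem killCompl_linSubst_truncatedChowMonomial_mem {m M n : ℕ} {ι : Fin m → Fin M}
    (hι : Function.Injective ι) (hn : n ≤ M) (A : Matrix (Fin M) (Fin M) k) :
    killCompl hι (linSubst (Fin M) k A (truncatedChowMonomial k n M hn)) ∈ chowSet k m n := by
  refine ⟨fun i j => A (ι j) (Fin.castLE hn i), ?_⟩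
  simp only [truncatedChowMonomial, map_prod, linSubst_X, smul_eq_C_mul, map_sum, map_mul,
    MvPolynomial.algHom_C, MvPolynomial.algebraMap_eq]
  refine Finset.prod_congr rfl fun i _ => ?_
  rw [sum_eq_sum_app hι (fun y => C (A y (Fin.castLE hn i)) * killCompl hι (X y)) fun y hy => by
    rw [killCompl_X_of_not_mem hι hy, mul_zero]]
  simp only [killCompl_X_app, linearForm]

/-- **`Ch_m^n = 𝔸_m^n ∩ \overline{GL_M(x₁ ⋯ x_n)}` at the level of equations** (`n ≤ M`, infinite field;
proof of Lemma 3.4, arXiv p. 5, there with `M = n`): the vanishing ideal of `Ch_m^n` equals the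
vanishing ideal of the `m`-letter part `{p ∈ 𝔸_m^n : ι p ∈ Δ_n[x₁⋯x_n]}` of the orbit closure in
`𝔸_M^n`, for any injection `ι` of the variables. (`⊆`: `(ι F)` vanishes on `GL_M · x₁⋯x_n` since the
`m`-letter part of an orbit point lies in `Ch_m^n`, then `rename_mem_orbitVanishingIdeal_iff_forall_orbitClosure`;
`⊇`: `ι(Ch_m^n) ⊆ Ch_M^n ⊆ End · x₁⋯x_n ⊆ Δ_n[x₁⋯x_n]`.)
[cite: DorflerIkenmeyerPanova2020, Lemma 3.4 (proof, arXiv p. 5; held paper-arxiv-1901.04576 p0006.txt:L35–45)] -/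
theorem vanishingIdeal_chowSet_eq_letterPart [Infinite k] {m M n : ℕ} {ι : Fin m → Fin M}
    (hι : Function.Injective ι) (hn : n ≤ M) :
    MvPolynomial.vanishingIdeal k (formCoeff n '' chowSet k m n) =
      MvPolynomial.vanishingIdeal k (formCoeff n ''
        {p : MvPolynomial (Fin m) k | rename ι p ∈ orbitClosure (truncatedChowMonomial k n M hn)}) := by
  apply le_antisymm
  · intro F hF
    rw [MvPolynomial.mem_vanishingIdeal_iff] at hF
    have hmem : rename (degIdxMap hι) F ∈ orbitVanishingIdeal (truncatedChowMonomial k n M hn) n := by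
      rw [mem_orbitVanishingIdeal_iff]
      intro g
      rw [aeval_formCoeff_rename_degIdxMap, linSubstRep_apply]
      exact hF _ ⟨_, killCompl_linSubst_truncatedChowMonomial_mem hι hn _, rfl⟩
    rw [MvPolynomial.mem_vanishingIdeal_iff]
    rintro _ ⟨p, hp, rfl⟩
    exact (rename_mem_orbitVanishingIdeal_iff_forall_orbitClosure hι
      (truncatedChowMonomial_isHomogeneous k n M hn) (truncatedChowMonomial_ne_zero n M hn) F).mp
      hmem p hp
  · refine MvPolynomial.vanishingIdeal_anti_mono (Set.image_mono ?_)
    intro p hp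
    exact endOrbit_subset_orbitClosure_holds _ (chowSet_subset_endOrbit hn (rename_mem_chowSet hι hp))

/-- **The multiplicity of a few-row type in `ℂ[Ch_m^n]` is a multiplicity of `Δ_n[x₁⋯x_n] ⊆ 𝔸_M^n`**
(`m ≤ M`, `1 ≤ n ≤ M`, characteristic zero; weight form, the `m`-row weight `χ` extended by zero to
`GL_M` along the top embedding): "the multiplicity of the irreducible `GL_m`-representation `{λ}_m` in
`ℂ[Ch_m^n]_d` equals the multiplicity of the irreducible `GL_n`-representation `{λ}_n` in
`ℂ[\overline{GL_n(x₁⋯x_n)}]`" (proof of Lemma 3.4, arXiv p. 5, "via argument analogous to that for the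
plethysm coefficient ([Ike12, Lem. 4.3.2])"), by the tree's few-letter theorem
`orbitMultiplicity_extend_add_finrank_eq_plethysmCoeff`.
[cite: DorflerIkenmeyerPanova2020, Lemma 3.4 (proof, arXiv p. 5; held paper-arxiv-1901.04576 p0006.txt:L38–45)] -/
theorem coordRingMultiplicity_chowSet_eq_orbitMultiplicity_extend [CharZero k] {m M n : ℕ}
    (hmM : m ≤ M) (hn : n ≤ M) (hn0 : n ≠ 0) (χ : Weight (Fin m)) :
    coordRingMultiplicity k (chowSet k m n) n χ =
      orbitMultiplicity k (truncatedChowMonomial k n M hn) n (Function.extend (topEmb hmM) χ 0) := by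
  haveI : Infinite k := CharZero.infinite k
  have h := orbitMultiplicity_extend_add_finrank_eq_plethysmCoeff (topEmb_strictMono hmM)
    (isUpperSet_range_topEmb hmM) (truncatedChowMonomial_isHomogeneous k n M hn)
    (truncatedChowMonomial_ne_zero n M hn) hn0 χ
  unfold coordRingMultiplicity
  rw [vanishingIdeal_chowSet_eq_letterPart (topEmb_strictMono hmM).injective hn, ← h]
  exact Nat.add_sub_cancel _ _

/-- **Partition form** ("`mult_λ(ℂ[Ch_m^n]_d) = mult_λ(ℂ[\overline{GL_n(x₁⋯x_n)}]_d)`", proof of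
Lemma 3.4, arXiv p. 5, there with `M = n ≥ m`): for `λ` with at most `m ≤ M` parts and `1 ≤ n ≤ M`,
`coordRingMultiplicity k (chowSet k m n) n λ^* = orbitMultiplicity k (x₁⋯x_n ∈ 𝔸_M^n) n λ^*` — in
particular the multiplicity does not depend on `m ≥ ℓ(λ)` (inheritance).
[cite: DorflerIkenmeyerPanova2020, Lemma 3.4 (proof, arXiv p. 5; held paper-arxiv-1901.04576 p0006.txt:L38–45)] -/
theorem coordRingMultiplicity_chowSet_dualOfPartition [CharZero k] {m M n s : ℕ} (hmM : m ≤ M)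
    (hn : n ≤ M) (hn0 : n ≠ 0) (lam : Nat.Partition s) (hlam : lam.parts.card ≤ m) :
    coordRingMultiplicity k (chowSet k m n) n (Weight.dualOfPartition m lam) =
      orbitMultiplicity k (truncatedChowMonomial k n M hn) n (Weight.dualOfPartition M lam) := by
  rw [dualOfPartition_eq_extend_topEmb hmM lam hlam]
  exact coordRingMultiplicity_chowSet_eq_orbitMultiplicity_extend hmM hn hn0 _

/-- **Main Theorem 2.3 (1) AS PRINTED, every `m ≥ 3`** (arXiv p. 4): "Let `m ≥ 3`, `n ≥ 2`,
`k = d = n+1`, `λ = (n²-2,n,2)`. We have `mult_λ(ℂ[Ch_m^n]_d) < mult_λ(ℂ[Pow_{m,k}^n]_d)`", with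
`Ch_m^n = chowSet ℂ m n`, `Pow_{m,n+1}^n` the closure of `powerSumSet ℂ m (n+1) n`, `λ^*` the dual weight
of `dipPartition n` for `GL_m`. PROVED: for `m ≥ n+1` this is the tree's `DIP2020_thm_2_3_1_holds`
(`dip20_thm_2_3_1_sets`); for `3 ≤ m ≤ n` both sides are transported to `M = n+1` letters — the Chow
side by the few-letter identity above, the power-sum side by Prop. 3.3 (every `m`,
`coordRingMultiplicity_powerSumSet_dualOfPartition`) and the independence of plethysm coefficients
of the number of variables. [cite: DorflerIkenmeyerPanova2020, Thm. 2.3 (1) (arXiv p. 4; TeX multobs.tex L280 {thm:main}; held paper-arxiv-1901.04576 p0005.txt:L46 "Theorem 1")] -/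
theorem dip20_thm_2_3_1_sets_all {n m : ℕ} (hn : 2 ≤ n) (hm : 3 ≤ m) :
    coordRingMultiplicity ℂ (chowSet ℂ m n) n (Weight.dualOfPartition m (dipPartition n hn)) <
      coordRingMultiplicity ℂ (powerSumSet ℂ m (n + 1) n) n
        (Weight.dualOfPartition m (dipPartition n hn)) := by
  by_cases hmn : n + 1 ≤ m
  · exact dip20_thm_2_3_1_sets hn hmn
  · have hmM : m ≤ n + 1 := by omega
    have hlam : (dipPartition n hn).parts.card ≤ m := (card_parts_dipPartition_le n hn).trans hm
    haveI : Infinite ℂ := CharZero.infinite ℂ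
    rw [coordRingMultiplicity_chowSet_dualOfPartition hmM (Nat.le_succ n) (by omega) _ hlam,
      coordRingMultiplicity_powerSumSet_dualOfPartition (by omega : 0 < n) le_rfl (dipPartition n hn)
        hlam,
      ← plethysmCoeffOfPartition_eq_of_card_parts_le hmM n (dipPartition n hn) hlam,
      ← orbitMultiplicity_partialPowerSum_dualOfPartition_eq le_rfl (by omega) le_rfl
        (dipPartition n hn) (hlam.trans hmM)]
    exact DIP2020_thm_2_3_1_holds n (n + 1) hn le_rfl

/-- Hence for every `m ≥ 3`, `n ≥ 2`: **`Pow_{m,n+1}^n ⊄ Ch_m^n` is witnessed by a multiplicity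
obstruction in the set vocabulary** (the obstruction principle `coordRingMultiplicity_mono`
contraposed): the power sums of `n+1` linear forms are not all limits of products — as sets of forms,
`powerSumSet ℂ m (n+1) n ⊄ Z` for every `Z` with the equations of `Ch_m^n`, in particular
`¬ powerSumSet ⊆ chowSet`. [cite: DorflerIkenmeyerPanova2020, Thm. 2.3 (1) (arXiv p. 4)] -/
theorem powerSumSet_not_subset_chowSet {n m : ℕ} (hn : 2 ≤ n) (hm : 3 ≤ m) :
    ¬ powerSumSet ℂ m (n + 1) n ⊆ chowSet ℂ m n := fun h =>
  absurd (coordRingMultiplicity_mono h (by omega : n ≠ 0) (Weight.dualOfPartition m (dipPartition n hn)))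
    (not_le.mpr (dip20_thm_2_3_1_sets_all hn hm))

end FewLetters

/-! ### §J. Prop. 3.15, power-sum side: positivity from Prop. 3.3 and the printed plethysm values -/

section OccurrenceObstructionsPow

/-- The size of the dual weight of a row vector is minus its number of boxes. [cite: DorflerIkenmeyerPanova2020, §2 (arXiv p. 3)] -/
theorem size_rowDual {m : ℕ} (μ : Fin m → ℕ) : (rowDual μ).size = -((∑ i, μ i : ℕ) : ℤ) := by
  unfold rowDual Weight.size Weight.dual
  rw [Finset.sum_neg_distrib, Nat.cast_sum]
  congr 1
  exact Equiv.sum_comp Fin.revPerm (fun i => (μ i : ℤ))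

/-- **Prop. 3.15, the power-sum column** ("Proposition 3.3 implies `mult_λ(ℂ[Pow_{m,d}^n]_d) > 0`",
arXiv p. 8): for the five rows, `mult_λ(ℂ[Pow_{m,d}^n]_d) = a_λ(d[n]) > 0` by Prop. 3.3 (every `m`,
`coordRingMultiplicity_powerSumSet_eq_plethysmCoeff`, `k = d`) and the printed (positive) values of
`a_λ(d[n])` (`DIP20_prop_3_15_table`). [cite: DorflerIkenmeyerPanova2020, Prop. 3.15 (proof, arXiv p. 8; TeX multobs.tex L527–531)] -/
theorem DIP20_prop_3_15_powerSum_pos_of_table (htab : DIP20_prop_3_15_table) :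
    0 < coordRingMultiplicity ℂ (powerSumSet ℂ 3 3 2) 2 (rowDual ![2, 2, 2]) ∧
    0 < coordRingMultiplicity ℂ (powerSumSet ℂ 3 4 3) 3 (rowDual ![7, 3, 2]) ∧
    0 < coordRingMultiplicity ℂ (powerSumSet ℂ 3 7 4) 4 (rowDual ![11, 9, 8]) ∧
    0 < coordRingMultiplicity ℂ (powerSumSet ℂ 3 6 5) 5 (rowDual ![12, 9, 9]) ∧
    0 < coordRingMultiplicity ℂ (powerSumSet ℂ 4 9 6) 6 (rowDual ![14, 14, 13, 13]) := by
  obtain ⟨⟨h1, -⟩, ⟨h2, -⟩, ⟨h3, -⟩, ⟨h4, -⟩, ⟨h5, -⟩⟩ := htab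
  refine ⟨?_, ?_, ?_, ?_, ?_⟩
  · rw [coordRingMultiplicity_powerSumSet_eq_plethysmCoeff (d := 3) (by norm_num) le_rfl
      (by rw [size_rowDual]; simp [Fin.sum_univ_succ]), h1]
    norm_num
  · rw [coordRingMultiplicity_powerSumSet_eq_plethysmCoeff (d := 4) (by norm_num) le_rfl
      (by rw [size_rowDual]; simp [Fin.sum_univ_succ]), h2]
    norm_num
  · rw [coordRingMultiplicity_powerSumSet_eq_plethysmCoeff (d := 7) (by norm_num) le_rfl
      (by rw [size_rowDual]; simp [Fin.sum_univ_succ]), h3]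
    norm_num
  · rw [coordRingMultiplicity_powerSumSet_eq_plethysmCoeff (d := 6) (by norm_num) le_rfl
      (by rw [size_rowDual]; simp [Fin.sum_univ_succ]), h4]
    norm_num
  · rw [coordRingMultiplicity_powerSumSet_eq_plethysmCoeff (d := 9) (by norm_num) le_rfl
      (by rw [size_rowDual]; simp [Fin.sum_univ_succ])]
    exact h5

end OccurrenceObstructionsPow

/-! ### §K. Binary forms split (the Hermite-reciprocity mechanism of Prop. 3.12): `Ch_2^n = 𝔸_2^n` -/

section BinaryForms

variable {k : Type} [Field k]

/-- The substitution `x₀ ↦ c·x₁, x₁ ↦ x₁` (restriction to the line through `(c : 1)`).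
[cite: DorflerIkenmeyerPanova2020, Prop. 3.12 (proof, arXiv p. 7)] -/
private def lineSubst (c : k) : MvPolynomial (Fin 2) k →ₐ[k] MvPolynomial (Fin 2) k :=
  aeval ![C c * X 1, X 1]

/-- `lineSubst c` sends `x₀` to `c·x₁`. [folklore] -/
private theorem lineSubst_X_zero (c : k) : lineSubst c (X 0) = C c * X 1 := by
  simp [lineSubst]

/-- `lineSubst c` fixes `x₁`. [folklore] -/
private theorem lineSubst_X_one (c : k) : lineSubst c (X 1) = X 1 := by
  simp [lineSubst]

/-- `G − G(c x₁, x₁) ∈ ⟨x₀ − c x₁⟩`. [folklore] -/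
private theorem sub_lineSubst_mem_span (c : k) (G : MvPolynomial (Fin 2) k) :
    G - lineSubst c G ∈ Ideal.span {(X 0 - C c * X 1 : MvPolynomial (Fin 2) k)} := by
  rw [← Ideal.Quotient.eq, ← Ideal.Quotient.mkₐ_eq_mk k, ← AlgHom.comp_apply]
  congr 1
  refine MvPolynomial.algHom_ext fun i => ?_
  simp only [AlgHom.comp_apply, Ideal.Quotient.mkₐ_eq_mk]
  rw [Ideal.Quotient.eq]
  match i with
  | 0 =>
    rw [lineSubst_X_zero]
    exact Ideal.subset_span rfl
  | 1 =>
    rw [lineSubst_X_one, sub_self]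
    exact zero_mem _

/-- On a form `G` of degree `e`: `G(c x₁, x₁) = G(c,1) · x₁^e`. [folklore] -/
private theorem lineSubst_of_isHomogeneous (c : k) {G : MvPolynomial (Fin 2) k} {e : ℕ}
    (hG : G.IsHomogeneous e) : lineSubst c G = C (eval ![c, 1] G) * X 1 ^ e := by
  classical
  conv_lhs => rw [G.as_sum]
  conv_rhs => rw [G.as_sum]
  simp only [map_sum, Finset.sum_mul]
  refine Finset.sum_congr rfl fun m hm => ?_
  have hdeg : m 0 + m 1 = e := by
    have h := hG (mem_support_iff.mp hm)
    rw [Finsupp.weight_apply, Finsupp.sum_fintype _ _ (by simp)] at h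
    simpa [Fin.sum_univ_two] using h
  rw [lineSubst, aeval_monomial, eval_monomial, Finsupp.prod_fintype _ _ (by simp),
    Finsupp.prod_fintype _ _ (by simp)]
  simp only [Fin.prod_univ_two, Matrix.cons_val_zero, Matrix.cons_val_one, one_pow,
    mul_one, algebraMap_eq, mul_pow, ← C_pow, C_mul]
  rw [← hdeg, pow_add]
  ring

/-- **A binary form vanishing at `(c : 1)` is divisible by `x₀ − c x₁`**, with a homogeneous
cofactor of degree one less ("every homogeneous polynomial in 2 variables decomposes as a product of
homogeneous linear polynomials by the fundamental theorem of algebra", proof of Prop. 3.12, arXiv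
p. 7; the linear-factor step). [cite: DorflerIkenmeyerPanova2020, Prop. 3.12 (proof, arXiv p. 7)] -/
theorem exists_linearForm_mul_of_eval_eq_zero {N : ℕ} {p : MvPolynomial (Fin 2) k}
    (hp : p.IsHomogeneous (N + 1)) {c : k} (hc : eval ![c, 1] p = 0) :
    ∃ P : MvPolynomial (Fin 2) k, P.IsHomogeneous N ∧ p = linearForm ![1, -c] * P := by
  have hmem : p ∈ Ideal.span {(X 0 - C c * X 1 : MvPolynomial (Fin 2) k)} := by
    have h := sub_lineSubst_mem_span c p
    rwa [lineSubst_of_isHomogeneous c hp, hc, C_0, zero_mul, sub_zero] at h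
  obtain ⟨q, hq⟩ := Ideal.mem_span_singleton'.mp hmem
  have hlin : (X 0 - C c * X 1 : MvPolynomial (Fin 2) k).IsHomogeneous 1 :=
    (isHomogeneous_X k 0).sub ((isHomogeneous_C _ c).mul (isHomogeneous_X k 1))
  refine ⟨homogeneousComponent N q, homogeneousComponent_isHomogeneous _ _, ?_⟩
  have h1 := Literature.RingTheory.MvPolynomial.homogeneousComponent_mul_add_of_isHomogeneous
    hlin q N
  rw [mul_comm (X 0 - C c * X 1) q, hq, homogeneousComponent_of_mem hp, if_pos rfl] at h1
  rw [h1]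
  congr 1
  simp [linearForm, Fin.sum_univ_two, sub_eq_add_neg]

/-- The univariate restriction `t ↦ p(t, 1)` of a binary form, as a polynomial. [folklore] -/
private def dehomX (p : MvPolynomial (Fin 2) k) : Polynomial k :=
  aeval ![Polynomial.X, 1] p

/-- Evaluating the univariate restriction: `(dehomX p)(c) = p(c, 1)`. [folklore] -/
private theorem eval_dehomX (p : MvPolynomial (Fin 2) k) (c : k) :
    (dehomX p).eval c = eval ![c, 1] p := by
  have h : (Polynomial.aeval c).comp (aeval ![Polynomial.X, (1 : Polynomial k)]) =
      aeval ![c, (1 : k)] := by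
    refine MvPolynomial.algHom_ext fun i => ?_
    fin_cases i <;> simp
  have h' := congrArg (fun φ => φ p) h
  simp only [AlgHom.comp_apply, Polynomial.coe_aeval_eq_eval] at h'
  rw [dehomX, h']
  rfl

/-- **Every binary form of positive degree has a linear factor** (algebraically closed field): the
linear-factor step of "every homogeneous polynomial in 2 variables decomposes as a product of
homogeneous linear polynomials by the fundamental theorem of algebra" (proof of Prop. 3.12, arXiv
p. 7). If `p(c,1) = 0` for some `c` the factor is `x₀ - c x₁`; if `p(1,0) = 0` it is `x₁`; otherwise
`t ↦ p(t,1)` is a polynomial without roots, hence a nonzero constant `a`, and homogeneity gives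
`p(1,s) = a s^{N+1}` for all `s ≠ 0`, so the polynomial `s ↦ p(1,s)` would vanish at `0` — absurd.
[cite: DorflerIkenmeyerPanova2020, Prop. 3.12 (proof, arXiv p. 7)] -/
theorem exists_linearForm_mul_of_isHomogeneous [IsAlgClosed k] {N : ℕ} {p : MvPolynomial (Fin 2) k}
    (hp : p.IsHomogeneous (N + 1)) :
    ∃ (b : Fin 2 → k) (P : MvPolynomial (Fin 2) k), P.IsHomogeneous N ∧ p = linearForm b * P := by
  classical
  by_cases hroot : ∃ c : k, eval ![c, 1] p = 0
  · obtain ⟨c, hc⟩ := hroot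
    obtain ⟨P, hP, h⟩ := exists_linearForm_mul_of_eval_eq_zero hp hc
    exact ⟨_, P, hP, h⟩
  push Not at hroot
  -- the swapped form `p̂(x₀, x₁) = p(x₁, x₀)`
  set ps := rename (Equiv.swap (0 : Fin 2) 1) p with hps
  have hpsh : ps.IsHomogeneous (N + 1) := hp.rename_isHomogeneous
  have hswap : ∀ u v : k, eval ![u, v] ps = eval ![v, u] p := by
    intro u v
    have hfun : (![u, v] ∘ ⇑(Equiv.swap (0 : Fin 2) 1)) = ![v, u] := by
      funext i
      fin_cases i <;> rfl
    rw [hps, eval_rename, hfun]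
  by_cases h10 : eval ![1, 0] p = 0
  · -- `x₁` divides `p`: apply the root lemma to the swapped form at `c = 0`
    have h0 : eval ![(0 : k), 1] ps = 0 := by rw [hswap]; exact h10
    obtain ⟨P, hP, h⟩ := exists_linearForm_mul_of_eval_eq_zero hpsh h0
    refine ⟨Function.extend (Equiv.swap (0 : Fin 2) 1) ![1, -0] 0, rename (Equiv.swap (0 : Fin 2) 1) P,
      hP.rename_isHomogeneous, ?_⟩
    have hinv : rename (Equiv.swap (0 : Fin 2) 1) ps = p := by
      have hss : (⇑(Equiv.swap (0 : Fin 2) 1) ∘ ⇑(Equiv.swap (0 : Fin 2) 1)) = id := by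
        funext i
        fin_cases i <;> rfl
      rw [hps, rename_rename, hss, rename_id, AlgHom.id_apply]
    rw [← hinv, h, map_mul, rename_linearForm (Equiv.injective _)]
  · -- no root on either chart: contradiction
    exfalso
    have hQ : ∀ c, (dehomX p).eval c ≠ 0 := fun c => by rw [eval_dehomX]; exact hroot c
    have hQdeg : (dehomX p).degree = 0 := by
      by_contra hd
      obtain ⟨c, hc⟩ := IsAlgClosed.exists_root (dehomX p) hd
      exact hQ c hc
    set a := (dehomX p).coeff 0 with ha
    have hQa : dehomX p = Polynomial.C a := Polynomial.eq_C_of_degree_eq_zero hQdeg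
    have hconst : ∀ c : k, eval ![c, 1] p = a := fun c => by
      rw [← eval_dehomX, hQa, Polynomial.eval_C]
    -- `p(1, s) = s^{N+1} · a` for `s ≠ 0`
    have hscale : ∀ s : k, s ≠ 0 → eval ![1, s] p = s ^ (N + 1) * a := by
      intro s hs
      have h := eval_smul_of_isHomogeneous hp s ![s⁻¹, 1]
      have hx : (s • ![s⁻¹, (1 : k)]) = ![1, s] := by
        funext i
        fin_cases i <;> simp [hs]
      rw [hx, hconst] at h
      exact h
    -- the polynomial `s ↦ p(1, s)` agrees with `a X^{N+1}` off `0`, hence everywhere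
    have hpoly : dehomX ps = Polynomial.C a * Polynomial.X ^ (N + 1) := by
      apply Polynomial.eq_of_infinite_eval_eq
      apply Set.Infinite.mono (s := {x : k | x ≠ 0})
      · intro s hs
        simp only [Set.mem_setOf_eq] at hs ⊢
        rw [eval_dehomX, hswap, hscale s hs, Polynomial.eval_mul, Polynomial.eval_C,
          Polynomial.eval_pow, Polynomial.eval_X, mul_comm]
      · exact (Set.finite_singleton (0 : k)).infinite_compl |>.mono fun x hx => by simpa using hx
    have h0 : eval ![1, 0] p = 0 := by
      rw [← hswap, ← eval_dehomX, hpoly]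
      simp
    exact h10 h0

/-- Linear forms are homogeneous of degree `1`. [folklore] -/
private theorem linearForm_isHomogeneous' {m : ℕ} (a : Fin m → k) : (linearForm a).IsHomogeneous 1 := by
  unfold linearForm
  refine IsHomogeneous.sum _ _ _ fun i _ => ?_
  simpa using (isHomogeneous_C (Fin m) (a i)).mul (isHomogeneous_X k i)

/-- Scaling a linear form scales its coefficients. [folklore] -/
private theorem C_mul_linearForm {m : ℕ} (c : k) (a : Fin m → k) :
    C c * linearForm a = linearForm (c • a) := by
  simp only [linearForm, Finset.mul_sum, Pi.smul_apply, smul_eq_mul, C_mul, mul_assoc]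

/-- **Binary forms split** (algebraically closed field): every form of degree `n+1` in two variables
is a product of `n+1` linear forms, i.e. lies in `Ch_2^{n+1}` — "every homogeneous polynomial in 2
variables decomposes as a product of homogeneous linear polynomials by the fundamental theorem of
algebra" (proof of Prop. 3.12, arXiv p. 7). Induction on the degree with
`exists_linearForm_mul_of_isHomogeneous`. [cite: DorflerIkenmeyerPanova2020, Prop. 3.12 (proof, arXiv p. 7; held paper-arxiv-1901.04576 p0007.txt:L55–58)] -/
theorem mem_chowSet_two_of_isHomogeneous [IsAlgClosed k] (n : ℕ) :
    ∀ {p : MvPolynomial (Fin 2) k}, p.IsHomogeneous (n + 1) → p ∈ chowSet k 2 (n + 1) := by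
  induction n with
  | zero =>
    intro p hp
    obtain ⟨b, P, hP, rfl⟩ := exists_linearForm_mul_of_isHomogeneous hp
    have hPc : P = C (coeff 0 P) := by
      apply totalDegree_eq_zero_iff_eq_C.mp
      exact Nat.le_zero.mp (hP.totalDegree_le)
    refine ⟨fun _ => coeff 0 P • b, ?_⟩
    rw [Fin.prod_univ_one, ← C_mul_linearForm, mul_comm, ← hPc]
  | succ n ih =>
    intro p hp
    obtain ⟨b, P, hP, rfl⟩ := exists_linearForm_mul_of_isHomogeneous hp
    obtain ⟨a, ha⟩ := ih hP
    refine ⟨Fin.cons b a, ?_⟩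
    rw [Fin.prod_univ_succ, Fin.cons_zero, ha]
    simp only [Fin.cons_succ]

/-- **`Ch_2^n = 𝔸_2^n` for `n ≥ 1`** over an algebraically closed field: the products of `n` linear
forms in two variables are exactly the binary forms of degree `n` (fundamental theorem of algebra;
proof of Prop. 3.12, arXiv p. 7). [cite: DorflerIkenmeyerPanova2020, Prop. 3.12 (proof, arXiv p. 7)] -/
theorem chowSet_two_eq [IsAlgClosed k] {n : ℕ} (hn : n ≠ 0) :
    chowSet k 2 n = {p : MvPolynomial (Fin 2) k | p.IsHomogeneous n} := by
  obtain ⟨n, rfl⟩ := Nat.exists_eq_succ_of_ne_zero hn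
  ext p
  constructor
  · rintro ⟨a, rfl⟩
    have h := IsHomogeneous.prod (Finset.univ : Finset (Fin n.succ)) (fun i => linearForm (a i))
      (fun _ => 1) fun i _ => linearForm_isHomogeneous' (a i)
    simpa using h
  · exact fun hp => mem_chowSet_two_of_isHomogeneous n hp

/-- Hence **`Ch_2^n` (`n ≥ 1`) has no equations**: `I(Ch_2^n) = 0` in `k[Sym^n k^2]` (every
coefficient vector is that of a binary form, which splits). [cite: DorflerIkenmeyerPanova2020, Prop. 3.12 (proof, arXiv p. 7)] -/
theorem vanishingIdeal_chowSet_two [IsAlgClosed k] {n : ℕ} (hn : n ≠ 0) :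
    MvPolynomial.vanishingIdeal k (formCoeff n '' chowSet k 2 n) = ⊥ := by
  rw [eq_bot_iff]
  intro F hF
  rw [MvPolynomial.mem_vanishingIdeal_iff] at hF
  rw [Ideal.mem_bot]
  apply MvPolynomial.funext
  intro c
  rw [map_zero]
  obtain ⟨p, hp, hpc⟩ := exists_isHomogeneous_formCoeff_eq c
  rw [← hpc]
  exact hF _ ⟨p, by rw [chowSet_two_eq hn]; exact hp, rfl⟩

/-- **"`a_μ(d[n]) = mult_μ(ℂ[Ch_2^n]_d)` for 2-partitions `μ`"** (proof of Prop. 3.12, arXiv p. 7 — "This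
is how the Hermite reciprocity can be proved"): the multiplicities of `ℂ[Ch_2^n]` are the plethysm
coefficients of `GL_2`, in every degree (`n ≥ 1`, characteristic zero, algebraically closed).
[cite: DorflerIkenmeyerPanova2020, Prop. 3.12 (proof, arXiv p. 7; held paper-arxiv-1901.04576 p0007.txt:L55–58)] -/
theorem coordRingMultiplicity_chowSet_two [IsAlgClosed k] {n : ℕ} (hn : n ≠ 0)
    (χ : Weight (Fin 2)) : coordRingMultiplicity k (chowSet k 2 n) n χ = plethysmCoeff k (Fin 2) n χ := by
  unfold coordRingMultiplicity
  rw [vanishingIdeal_chowSet_two hn, Submodule.restrictScalars_bot, inf_bot_eq, finrank_bot,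
    Nat.sub_zero]

end BinaryForms

/-! ### §L. Discharge of Prop. 3.12: inheritance `Ch_2^n → Ch_3^n` for 2-row types -/

section FewRows

variable {k : Type} [Field k]

/-- Extension by zero along top embeddings composes: `Fin K ↪ Fin L ↪ Fin N`. [folklore] -/
private theorem extend_topEmb_extend_topEmb {K L N : ℕ} (hKL : K ≤ L) (hLN : L ≤ N) (χ : Weight (Fin K)) :
    Function.extend (topEmb hLN) (Function.extend (topEmb hKL) χ 0) 0 =
      Function.extend (topEmb (hKL.trans hLN)) χ 0 := by
  funext x
  by_cases hx : x ∈ Set.range (topEmb (hKL.trans hLN))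
  · obtain ⟨i, rfl⟩ := hx
    have hcomp : topEmb (hKL.trans hLN) i = topEmb hLN (topEmb hKL i) := by
      apply Fin.ext
      simp only [topEmb_val]
      omega
    rw [(topEmb_strictMono (hKL.trans hLN)).injective.extend_apply, hcomp,
      (topEmb_strictMono hLN).injective.extend_apply, (topEmb_strictMono hKL).injective.extend_apply]
  · rw [Function.extend_apply' _ _ _ hx]
    by_cases hx' : x ∈ Set.range (topEmb hLN)
    · obtain ⟨j, rfl⟩ := hx'
      rw [(topEmb_strictMono hLN).injective.extend_apply, Function.extend_apply' _ _ _ ?_]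
      · rfl
      · rintro ⟨i, rfl⟩
        apply hx
        refine ⟨i, Fin.ext ?_⟩
        simp only [topEmb_val]
        omega
    · rw [Function.extend_apply' _ _ _ hx']

/-- The first two rows of a `3`-row vector. [folklore] -/
private def firstTwoRows (μ : Fin 3 → ℕ) : Fin 2 → ℕ := fun i => μ (Fin.castSucc i)

/-- A `3`-row weight with empty third row is the `2`-row weight extended by zero (dual convention).
[folklore] -/
private theorem rowDual_eq_extend_of_third_eq_zero (μ : Fin 3 → ℕ) (h : μ 2 = 0) :
    rowDual μ = Function.extend (topEmb (show 2 ≤ 3 by norm_num)) (rowDual (firstTwoRows μ)) 0 := by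
  have h1 : (1 : Fin 3) = topEmb (show 2 ≤ 3 by norm_num) 0 := Fin.ext (by simp [topEmb_val])
  have h2 : (2 : Fin 3) = topEmb (show 2 ≤ 3 by norm_num) 1 := Fin.ext (by simp [topEmb_val])
  funext j
  fin_cases j
  · have h0 : ((0 : Fin 3)) ∉ Set.range (topEmb (show 2 ≤ 3 by norm_num)) := by
      rintro ⟨i, hi⟩
      have := congrArg Fin.val hi
      simp [topEmb_val] at this
    simp only [Fin.zero_eta]
    rw [Function.extend_apply' _ _ _ h0]
    simp [rowDual, Weight.dual, Fin.rev, h]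
  · simp only [Fin.mk_one]
    rw [h1, (topEmb_strictMono _).injective.extend_apply]
    simp [rowDual, Weight.dual, firstTwoRows, Fin.rev]
  · show rowDual μ 2 = Function.extend (topEmb (show 2 ≤ 3 by norm_num)) (rowDual (firstTwoRows μ)) 0 2
    rw [h2, (topEmb_strictMono _).injective.extend_apply]
    simp [rowDual, Weight.dual, firstTwoRows, Fin.rev]

/-- **Inner degree `0` carries no positive plethysm coefficient** (the junk case `n = 0` of the
row-form statements): if `HWV_χ(k[Sym^0 k^3])` had positive finite dimension it would contain a
nonzero vector, forcing `χ = 0`, and then all powers of the unique coordinate — an infinite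
independent family. [folklore] -/
private theorem not_plethysmCoeff_zero_pos (μ : Fin 3 → ℕ) : ¬ 0 < plethysmCoeff ℂ (Fin 3) 0 (rowDual μ) := by
  intro hμ
  unfold plethysmCoeff hwMultiplicity at hμ
  haveI : Module.Finite ℂ ↥(highestWeightSpace (coordRep (Fin 3) ℂ 0) (rowDual μ)) :=
    Module.finite_of_finrank_pos hμ
  obtain ⟨F, hF0⟩ := Module.finrank_pos_iff_exists_ne_zero.mp hμ
  -- the torus acts trivially in inner degree `0`, so a nonzero weight vector has weight `0`
  have hχ : rowDual μ = 0 := by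
    obtain ⟨s, hs⟩ := support_nonempty.mpr fun h => hF0 (Subtype.ext h)
    rw [← monWeight_eq_of_mem_weightSpace (highestWeightSpace_le_weightSpace _ _ F.2) hs]
    funext i
    refine monWeight_apply_eq_zero s fun d _ => ?_
    have hd : d.1.degree = 0 := mem_degMonomials_iff.mp d.2
    rw [Finsupp.degree_eq_zero_iff] at hd
    rw [hd, Finsupp.zero_apply]
  let d : DegIdx (Fin 3) 0 := ⟨0, by rw [mem_degMonomials_iff]; rfl⟩
  have hX : ∀ j : ℕ, (X d : MvPolynomial (DegIdx (Fin 3) 0) ℂ) ^ j ∈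
      highestWeightSpace (coordRep (Fin 3) ℂ 0) (rowDual μ) := by
    intro j
    have h1 := Complexity.X_mem_highestWeightSpace_coordRep (k := ℂ) 0 (2 : Fin 3)
      (fun i => Fin.le_last i) d (by simp [d])
    have h2 := pow_mem_highestWeightSpace_coordRep h1 j
    have hw : j • (Pi.single (2 : Fin 3) (-((0 : ℕ) : ℤ)) : Weight (Fin 3)) = rowDual μ := by
      rw [hχ]; simp
    rwa [hw] at h2
  have hli : LinearIndependent ℂ
      (fun j : ℕ => (⟨X d ^ j, hX j⟩ : ↥(highestWeightSpace (coordRep (Fin 3) ℂ 0) (rowDual μ)))) := by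
    apply LinearIndependent.of_comp (highestWeightSpace (coordRep (Fin 3) ℂ 0) (rowDual μ)).subtype
    have hfun : (⇑(highestWeightSpace (coordRep (Fin 3) ℂ 0) (rowDual μ)).subtype ∘
        fun j : ℕ => (⟨X d ^ j, hX j⟩ : ↥(highestWeightSpace (coordRep (Fin 3) ℂ 0) (rowDual μ)))) =
        fun j : ℕ => MvPolynomial.basisMonomials (DegIdx (Fin 3) 0) ℂ (Finsupp.single d j) := by
      funext j
      simp [MvPolynomial.coe_basisMonomials, X_pow_eq_monomial]
    rw [hfun]
    exact (MvPolynomial.basisMonomials _ ℂ).linearIndependent.comp _ (Finsupp.single_injective d)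
  exact Module.Finite.not_linearIndependent_of_infinite _ hli

/-- **Discharge of Prop. 3.12** ("Let `μ` be a 3-partition of length at most 2. If `a_μ(d[n]) > 0`,
then `mult_μ(ℂ[Ch_m^n]_d) > 0`", arXiv p. 7), along the printed proof: binary forms split, so
`Ch_2^n = 𝔸_2^n` and `mult_μ(ℂ[Ch_2^n]_d) = a_μ(d[n])` (`coordRingMultiplicity_chowSet_two`); then the
inheritance `Ch_2^n → Ch_3^n` for 2-row types ("[Ike12, Lemma 4.3.2 or Sec. 5.3]"), here through the
few-letter identity of §I in `n + 3` letters and the independence of plethysm coefficients of the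
number of variables. [cite: DorflerIkenmeyerPanova2020, Prop. 3.12 (arXiv p. 7; TeX multobs.tex L460 {pro:fewrows}; held paper-arxiv-1901.04576 p0007.txt:L51 "Proposition 10")] -/
theorem DIP20_prop_3_12_holds : DIP20_prop_3_12 := by
  intro n μ _ hμ2 hμ
  rcases Nat.eq_zero_or_pos n with rfl | hn
  · exact absurd hμ (not_plethysmCoeff_zero_pos μ)
  haveI : Infinite ℂ := CharZero.infinite ℂ
  have hn0 : n ≠ 0 := Nat.pos_iff_ne_zero.mp hn
  have h23 : 2 ≤ 3 := by norm_num
  have h3M : 3 ≤ n + 3 := by omega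
  have h2M : 2 ≤ n + 3 := by omega
  have hnM : n ≤ n + 3 := by omega
  have hw := rowDual_eq_extend_of_third_eq_zero μ hμ2
  -- the plethysm coefficient is that of the 2-row weight
  have hpc : plethysmCoeff ℂ (Fin 3) n (rowDual μ) = plethysmCoeff ℂ (Fin 2) n (rowDual (firstTwoRows μ)) := by
    rw [hw]
    exact plethysmCoeff_extend (topEmb_strictMono h23) (isUpperSet_range_topEmb h23) _
  rw [coordRingMultiplicity_chowSet_eq_orbitMultiplicity_extend h3M hnM hn0, hw,
    extend_topEmb_extend_topEmb h23 h3M,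
    ← coordRingMultiplicity_chowSet_eq_orbitMultiplicity_extend h2M hnM hn0,
    coordRingMultiplicity_chowSet_two hn0, ← hpc]
  exact hμ

end FewRows

/-! ### §M. Discharge of `p_26(9,6) = 227 = p_27(9,6)` (Cor. 4.8, proof): counting partitions in a box -/

section BoxCounts

/-- Enumeration (with fuel) of the part multisets of the partitions of `r` with at most `a` parts, each
at most `b`, by largest part `j + 1 ≤ min(b, r)`. [folklore] -/
def boxPartsAux : ℕ → ℕ → ℕ → ℕ → Finset (Multiset ℕ)
  | _, 0, _, _ => {0}
  | 0, _ + 1, _, _ => ∅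
  | _ + 1, _ + 1, 0, _ => ∅
  | f + 1, r + 1, a + 1, b =>
    (Finset.range (min b (r + 1))).biUnion fun j => (boxPartsAux f (r - j) a (j + 1)).image (Multiset.cons (j + 1))

/-- The same recursion on the counts: `p_0(a,b) = 1`, `p_{r+1}(0,b) = 0`,
`p_{r+1}(a+1,b) = Σ_{1 ≤ k ≤ min(b,r+1)} p_{r+1-k}(a,k)` (split by the largest part `k`). [folklore] -/
def boxCountAux : ℕ → ℕ → ℕ → ℕ → ℕ
  | _, 0, _, _ => 1
  | 0, _ + 1, _, _ => 0
  | _ + 1, _ + 1, 0, _ => 0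
  | f + 1, r + 1, a + 1, b => ∑ j ∈ Finset.range (min b (r + 1)), boxCountAux f (r - j) a (j + 1)

/-- The part multisets of the partitions of `r` in an `a × b` box. [folklore] -/
def boxParts (r a b : ℕ) : Finset (Multiset ℕ) :=
  boxPartsAux r r a b

/-- `p_r(a,b)` computed by the largest-part recursion. [folklore] -/
def boxCount (r a b : ℕ) : ℕ :=
  boxCountAux r r a b

/-- In degree `0` the enumeration is `{0}`. [folklore] -/
private theorem boxPartsAux_zero (f a b : ℕ) : boxPartsAux f 0 a b = {0} := by
  cases f <;> rfl

/-- The multiset `0` is the only one of sum `0` with positive parts. [folklore] -/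
private theorem mem_boxPartsAux_zero_iff (f a b : ℕ) (m : Multiset ℕ) :
    m ∈ boxPartsAux f 0 a b ↔ m.sum = 0 ∧ Multiset.card m ≤ a ∧ ∀ x ∈ m, 0 < x ∧ x ≤ b := by
  rw [boxPartsAux_zero, Finset.mem_singleton]
  constructor
  · rintro rfl
    exact ⟨Multiset.sum_zero, by simp, fun x hx => absurd hx (Multiset.notMem_zero x)⟩
  · rintro ⟨hs, -, hp⟩
    refine Multiset.eq_zero_of_forall_notMem fun x hx => ?_
    have h0 := Multiset.sum_eq_zero_iff.mp hs x hx
    have := (hp x hx).1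
    omega

/-- **Specification of the enumeration**: with enough fuel, `boxPartsAux f r a b` lists exactly the
multisets of positive integers `≤ b` with sum `r` and at most `a` elements. [folklore] -/
private theorem mem_boxPartsAux : ∀ (f r a b : ℕ) (m : Multiset ℕ), r ≤ f →
    (m ∈ boxPartsAux f r a b ↔ m.sum = r ∧ Multiset.card m ≤ a ∧ ∀ x ∈ m, 0 < x ∧ x ≤ b) := by
  intro f
  induction f with
  | zero =>
    intro r a b m hr
    obtain rfl : r = 0 := Nat.le_zero.mp hr
    exact mem_boxPartsAux_zero_iff 0 a b m
  | succ f ih =>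
    intro r a b m hr
    cases r with
    | zero => exact mem_boxPartsAux_zero_iff _ a b m
    | succ r =>
      cases a with
      | zero =>
        simp only [boxPartsAux, Finset.notMem_empty, false_iff]
        rintro ⟨hs, hc, -⟩
        rw [Nat.le_zero, Multiset.card_eq_zero] at hc
        rw [hc, Multiset.sum_zero] at hs
        omega
      | succ a =>
        simp only [boxPartsAux, Finset.mem_biUnion, Finset.mem_range, Finset.mem_image, lt_min_iff]
        constructor
        · rintro ⟨j, ⟨hjb, hjr⟩, m', hm', rfl⟩
          obtain ⟨hs, hc, hp⟩ := (ih (r - j) a (j + 1) m' (by omega)).1 hm'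
          refine ⟨by rw [Multiset.sum_cons, hs]; omega, by rw [Multiset.card_cons]; omega, ?_⟩
          intro x hx
          rw [Multiset.mem_cons] at hx
          rcases hx with rfl | hx
          · omega
          · have := hp x hx
            omega
        · rintro ⟨hs, hc, hp⟩
          have hne : m.toFinset.Nonempty := by
            rw [Multiset.toFinset_nonempty]
            rintro rfl
            rw [Multiset.sum_zero] at hs
            omega
          obtain ⟨x, hxm, hmax⟩ := Finset.exists_max_image m.toFinset id hne
          rw [Multiset.mem_toFinset] at hxm
          have hx := hp x hxm
          have hxle : x ≤ r + 1 := hs ▸ Multiset.le_sum_of_mem hxm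
          refine ⟨x - 1, ⟨by omega, by omega⟩, m.erase x, ?_, ?_⟩
          · refine (ih (r - (x - 1)) a (x - 1 + 1) (m.erase x) (by omega)).2 ⟨?_, ?_, ?_⟩
            · have h2 : x + (m.erase x).sum = r + 1 := by
                rw [← Multiset.sum_cons, Multiset.cons_erase hxm, hs]
              omega
            · have h2 := Multiset.card_erase_add_one hxm
              omega
            · intro y hy
              have hym : y ∈ m := Multiset.mem_of_mem_erase hy
              have hyx : y ≤ x := by
                have := hmax y (by rw [Multiset.mem_toFinset]; exact hym)
                simpa using this
              exact ⟨(hp y hym).1, by omega⟩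
          · rw [show x - 1 + 1 = x by omega, Multiset.cons_erase hxm]

/-- The enumeration has `boxCountAux` elements (distinct largest parts give disjoint pieces; `cons` is
injective). [folklore] -/
private theorem card_boxPartsAux : ∀ (f r a b : ℕ), r ≤ f →
    (boxPartsAux f r a b).card = boxCountAux f r a b := by
  intro f
  induction f with
  | zero =>
    intro r a b hr
    obtain rfl : r = 0 := Nat.le_zero.mp hr
    rfl
  | succ f ih =>
    intro r a b hr
    cases r with
    | zero => rfl
    | succ r =>
      cases a with
      | zero => rfl
      | succ a =>
        simp only [boxPartsAux, boxCountAux]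
        rw [Finset.card_biUnion]
        · refine Finset.sum_congr rfl fun j hj => ?_
          have hj' := (lt_min_iff.mp (Finset.mem_range.mp hj)).2
          rw [Finset.card_image_of_injective _ fun s t h => (Multiset.cons_inj_right _).1 h,
            ih (r - j) a (j + 1) (by omega)]
        · intro j hj j' hj' hne
          have hjr := (lt_min_iff.mp (Finset.mem_coe.mp hj |> Finset.mem_range.mp)).2
          have hjr' := (lt_min_iff.mp (Finset.mem_coe.mp hj' |> Finset.mem_range.mp)).2
          rw [Function.onFun, Finset.disjoint_left]
          intro m hm hm'
          rw [Finset.mem_image] at hm hm'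
          obtain ⟨u, hu, rfl⟩ := hm
          obtain ⟨v, hv, huv⟩ := hm'
          have hu' := ((mem_boxPartsAux f (r - j) a (j + 1) u (by omega)).1 hu).2.2
          have hv' := ((mem_boxPartsAux f (r - j') a (j' + 1) v (by omega)).1 hv).2.2
          have h1 : j' + 1 ∈ (j + 1) ::ₘ u := by rw [← huv]; exact Multiset.mem_cons_self _ _
          have h2 : j + 1 ∈ (j' + 1) ::ₘ v := by rw [huv]; exact Multiset.mem_cons_self _ _
          rw [Multiset.mem_cons] at h1 h2
          have a1 : j' + 1 ≤ j + 1 := by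
            rcases h1 with h1 | h1
            · omega
            · exact (hu' _ h1).2
          have a2 : j + 1 ≤ j' + 1 := by
            rcases h2 with h2 | h2
            · omega
            · exact (hv' _ h2).2
          exact hne (by omega)

/-- **`boxParts r a b` lists the partitions of `r` in an `a × b` box.** [cite: DorflerIkenmeyerPanova2020, §4 ("p_r(a,b) … the number of partitions of r which fit inside an a × b rectangle", arXiv p. 9)] -/
theorem mem_boxParts {r a b : ℕ} {m : Multiset ℕ} :
    m ∈ boxParts r a b ↔ m.sum = r ∧ Multiset.card m ≤ a ∧ ∀ x ∈ m, 0 < x ∧ x ≤ b :=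
  mem_boxPartsAux r r a b m le_rfl

/-- **`p_r(a,b)` is computable by the largest-part recursion**: `boxPartitionCount r a b = boxCount r a b`.
[cite: DorflerIkenmeyerPanova2020, §4 (p_r(a,b), arXiv p. 9)] -/
theorem boxPartitionCount_eq_boxCount (r a b : ℕ) : boxPartitionCount r a b = boxCount r a b := by
  rw [boxCount, ← card_boxPartsAux r r a b le_rfl, ← Nat.card_eq_finsetCard]
  refine Nat.card_congr
    { toFun := fun μ => ⟨μ.1.parts, mem_boxParts.2
        ⟨μ.1.parts_sum, μ.2.1, fun x hx => ⟨μ.1.parts_pos hx, μ.2.2 x hx⟩⟩⟩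
      invFun := fun m => ⟨⟨m.1, fun hx => ((mem_boxParts.1 m.2).2.2 _ hx).1, (mem_boxParts.1 m.2).1⟩,
        (mem_boxParts.1 m.2).2.1, fun x hx => ((mem_boxParts.1 m.2).2.2 x hx).2⟩
      left_inv := fun μ => rfl
      right_inv := fun m => rfl }

/-- **Discharge of the box counts of Cor. 4.8's proof**: `p_26(9,6) = 227 = p_27(9,6)` (arXiv p. 12),
by the kernel through `boxPartitionCount_eq_boxCount`. [cite: DorflerIkenmeyerPanova2020, Cor. 4.8 (proof: "p_26(9,6) = 227 = p_27(9,6)", arXiv p. 12; TeX multobs.tex L689 {cor:keyinequality})] -/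
theorem DIP20_cor_4_8_boxCounts_holds : DIP20_cor_4_8_boxCounts := by
  refine ⟨?_, ?_⟩ <;> rw [boxPartitionCount_eq_boxCount] <;> decide

end BoxCounts

/-! ### §N. The no-occurrence clauses of Thm. 2.3 (2) from the generator classifications (Props. 3.9, 7.1) and Prop. 5.1 -/

section NoOccurrence

/-- A `3`-row vector with `μ₃ ≤ μ₂ ≤ μ₁` is antitone. [folklore] -/
private theorem antitone_fin3 {μ : Fin 3 → ℕ} (h10 : μ 1 ≤ μ 0) (h21 : μ 2 ≤ μ 1) : Antitone μ := by
  intro i j hij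
  fin_cases i <;> fin_cases j <;> simp at hij ⊢ <;> omega

/-- The rows of `X` (Prop. 3.9) are partitions. [cite: DorflerIkenmeyerPanova2020, Prop. 3.9 (the set X, arXiv p. 6)] -/
theorem dipGeneratorRows36_sorted : ∀ t ∈ dipGeneratorRows36, t.2.2 ≤ t.2.1 ∧ t.2.1 ≤ t.1 := by
  decide

/-- Elements of `X` (Prop. 3.9) are antitone row vectors. [cite: DorflerIkenmeyerPanova2020, Prop. 3.9 (the set X, arXiv p. 6)] -/
theorem antitone_of_mem_dipGenerators36 {μ : Fin 3 → ℕ} (h : μ ∈ dipGenerators36) : Antitone μ := by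
  obtain ⟨h1, h2⟩ := dipGeneratorRows36_sorted _ h
  exact antitone_fin3 h2 h1

/-- **The trivial type occurs in `ℂ[Ch_m^n]`**: `mult_0(ℂ[Ch_m^n]_0) > 0` (the constants; `n ≥ 1`).
[cite: DorflerIkenmeyerPanova2020, §3 (the semigroup of occurring types, arXiv p. 6)] -/
theorem coordRingMultiplicity_chowSet_rowDual_zero_pos {m n : ℕ} (hn : n ≠ 0) :
    0 < coordRingMultiplicity ℂ (chowSet ℂ m n) n (rowDual (0 : Fin m → ℕ)) := by
  have h0 : rowDual (0 : Fin m → ℕ) = 0 := by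
    funext i
    simp [rowDual, Weight.dual]
  rw [h0, coordRingMultiplicity_pos_iff hn]
  refine ⟨1, ?_, ?_⟩
  · rw [mem_highestWeightSpace_iff]
    intro g _
    rw [coordRep_apply, map_one]
    simp [weightChar]
  · intro h1
    rw [MvPolynomial.mem_vanishingIdeal_iff] at h1
    have h := h1 (formCoeff n (∏ i : Fin n, linearForm (fun _ : Fin m => (0 : ℂ))))
      ⟨_, ⟨fun _ _ => 0, rfl⟩, rfl⟩
    rw [map_one] at h
    exact one_ne_zero h

/-- **(3.6) — the no-occurrence clause of Thm. 2.3 (2)(a) — from Prop. 3.9 and Prop. 5.1**, along the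
printed proof (arXiv pp. 6–7): "To prove (3.6) it is sufficient (and necessary) to show that
`mult_μ(ℂ[Ch_m^n]_d) > 0` for all `μ ∈ X`, because a semigroup property analogous to (3.8) holds"
[(3.11), `DIP20_eq_3_11_holds`]; "If the length of `μ` is at most 2, we use" Prop. 3.12
[`DIP20_prop_3_12_holds`, with `a_μ(d[6]) > 0` for `μ ∈ X` from Prop. 3.9]; "for all 3-partitions
`μ ∈ X` of length 3 we have `mult_μ(ℂ[Ch_3^6]) > 0`, see Proposition 5.1". The two remaining named
facts enter as hypotheses. [cite: DorflerIkenmeyerPanova2020, Thm. 2.3 (2)(a) / eq. (3.6) (proof, arXiv pp. 6–7; TeX multobs.tex L386 {eq:posplethimpliesposchow})] -/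
theorem dip20_eq_3_6_of_prop_3_9_of_prop_5_1 (h39 : DIP20_prop_3_9) (h51 : DIP20_prop_5_1) :
    ∀ μ : Fin 3 → ℕ, Antitone μ → 0 < plethysmCoeff ℂ (Fin 3) 6 (rowDual μ) →
      0 < coordRingMultiplicity ℂ (chowSet ℂ 3 6) 6 (rowDual μ) := by
  intro μ hμ hpos
  have hmem := (h39 μ hμ).1 hpos
  refine AddSubmonoid.closure_induction
    (motive := fun x _ => 0 < coordRingMultiplicity ℂ (chowSet ℂ 3 6) 6 (rowDual x))
    (fun x hx => ?_) (coordRingMultiplicity_chowSet_rowDual_zero_pos (by norm_num))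
    (fun x y _ _ hx hy => DIP20_eq_3_11_holds 3 6 x y (by norm_num) hx hy) hmem
  have hax := antitone_of_mem_dipGenerators36 hx
  by_cases hx2 : x 2 = 0
  · exact DIP20_prop_3_12_holds 6 x hax hx2 ((h39 x hax).2 (AddSubmonoid.subset_closure hx))
  · exact h51.1 x hx (Nat.pos_of_ne_zero hx2)

/-- **The no-occurrence clause of Thm. 2.3 (2)(b) (`m = 4`, `n = 7`) from Prop. 7.1 and Prop. 5.1**:
"The proof of Theorem 2.3 (2b) is completely analogous … Let `m = 4`, `n = 7`" (arXiv p. 7) — semigroup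
property (3.11) [`DIP20_eq_3_11_holds`] and "If `X` is defined as in Proposition 7.1, then for all `μ ∈ X`
we have `mult_μ(ℂ[Ch_4^7]) > 0`" (Prop. 5.1). [cite: DorflerIkenmeyerPanova2020, Thm. 2.3 (2)(b) (proof, arXiv p. 7)] -/
theorem dip20_noOccurrence47_of_prop_7_1_of_prop_5_1 (h71 : DIP20_prop_7_1) (h51 : DIP20_prop_5_1) :
    ∀ μ : Fin 4 → ℕ, Antitone μ → 0 < plethysmCoeff ℂ (Fin 4) 7 (rowDual μ) →
      0 < coordRingMultiplicity ℂ (chowSet ℂ 4 7) 7 (rowDual μ) := by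
  intro μ hμ hpos
  have hmem := (h71 μ hμ).1 hpos
  exact AddSubmonoid.closure_induction
    (motive := fun x _ => 0 < coordRingMultiplicity ℂ (chowSet ℂ 4 7) 7 (rowDual x))
    (fun x hx => h51.2 x hx) (coordRingMultiplicity_chowSet_rowDual_zero_pos (by norm_num))
    (fun x y _ _ hx hy => DIP20_eq_3_11_holds 4 7 x y (by norm_num) hx hy) hmem

/-- **The Chow side of Thm. 2.3 (2)(b) from Prop. 3.2**: `mult_{(47,7,2)}(ℂ[Ch_4^7]_8) < 11`. Route (set
vocabulary): `mult_λ(ℂ[Ch_4^7]_8) < mult_λ(ℂ[Pow_{4,8}^7]_8)` (`dip20_thm_2_3_1_sets_all`, Thm. 2.3 (1) for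
every `m ≥ 3`) `≤ a_λ(8[7])` (computed for `GL_4`; `= a_λ(8[7])` for `GL_3` by independence of the number
of rows `≥ ℓ(λ) = 3`) `= 11` (Prop. 3.2). [cite: DorflerIkenmeyerPanova2020, Thm. 2.3 (2)(b) (arXiv p. 4) with Prop. 3.2] -/
theorem dip20_thm_2_3_2b_chow_lt_of_prop_3_2 (h32 : DIP20_prop_3_2) :
    coordRingMultiplicity ℂ (chowSet ℂ 4 7) 7 (Weight.dualOfPartition 4 (dipPartition 7 two_le_seven)) < 11 := by
  haveI : Infinite ℂ := CharZero.infinite ℂ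
  have hlt := dip20_thm_2_3_1_sets_all (m := 4) two_le_seven (by norm_num)
  have hle := coordRingMultiplicity_le_plethysmCoeff (powerSumSet ℂ 4 (7 + 1) 7) 7
    (Weight.dualOfPartition 4 (dipPartition 7 two_le_seven))
  have h4 := plethysmCoeffOfPartition_eq_of_card_parts_le (k := ℂ) (show 3 ≤ 4 by norm_num) 7
    (dipPartition 7 two_le_seven) (card_parts_dipPartition_le 7 two_le_seven)
  have h11 := h32.2.2.2
  unfold plethysmCoeffOfPartition at h4 h11
  rw [h11] at h4
  omega

/-- **Thm. 2.3 (2)(a) assembled from the computer facts**: the value `mult_{(34,6,2)}(ℂ[Ch_3^6]_7) = 7`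
(the §6 calculation, arXiv p. 15, not separately typed) as a hypothesis, Prop. 3.2 (`mult(Pow_{3,4}^6) = 8`),
and the no-occurrence clause from Props. 3.9 and 5.1. [cite: DorflerIkenmeyerPanova2020, Thm. 2.3 (2)(a) (arXiv p. 4; proof §3, §5–§6)] -/
theorem DIP20_thm_2_3_2a_of_facts
    (h7 : coordRingMultiplicity ℂ (chowSet ℂ 3 6) 6 (Weight.dualOfPartition 3 (dipPartition 6 two_le_six)) = 7)
    (h32 : DIP20_prop_3_2) (h39 : DIP20_prop_3_9) (h51 : DIP20_prop_5_1) : DIP20_thm_2_3_2a :=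
  ⟨h7, h32.1, dip20_eq_3_6_of_prop_3_9_of_prop_5_1 h39 h51⟩

/-- **Thm. 2.3 (2)(b) assembled from the computer facts**: the Chow side `< 11` from Prop. 3.2
(`dip20_thm_2_3_2b_chow_lt_of_prop_3_2`), the power-sum side `mult_{(47,7,2)}(ℂ[Pow_{4,4}^7]_8) = 11`
(computer calculation; printed for `m = 3` as Prop. 3.2 — the `m = 4` value needs an inheritance for
power sums not in the tree) as a hypothesis, and the no-occurrence clause from Props. 7.1 and 5.1.
[cite: DorflerIkenmeyerPanova2020, Thm. 2.3 (2)(b) (arXiv p. 4; proof §3, §5–§7)] -/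
theorem DIP20_thm_2_3_2b_of_facts (h32 : DIP20_prop_3_2)
    (hpow : coordRingMultiplicity ℂ (powerSumSet ℂ 4 4 7) 7
      (Weight.dualOfPartition 4 (dipPartition 7 two_le_seven)) = 11)
    (h71 : DIP20_prop_7_1) (h51 : DIP20_prop_5_1) : DIP20_thm_2_3_2b :=
  ⟨dip20_thm_2_3_2b_chow_lt_of_prop_3_2 h32, hpow, dip20_noOccurrence47_of_prop_7_1_of_prop_5_1 h71 h51⟩

end NoOccurrence

/-! ### §O. Few letters for power sums: `mult_λ(ℂ[Pow_{m,r}^n]_d)` does not depend on `m ≥ ℓ(λ)` -/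

section FewLettersPow

variable {k : Type} [Field k]

open _root_.Literature.Barriers.ValiantsHypothesis (degIdxMap degIdxMap_injective killCompl_X_app
  killCompl_X_of_not_mem sum_eq_sum_app)

/-- `x₁^n + ⋯ + x_r^n ≠ 0` for `r ≥ 1`, `n ≥ 1` (look at the coefficient of `x₁^n`).
[cite: DorflerIkenmeyerPanova2020, §2 (arXiv p. 3)] -/
theorem partialPowerSum_ne_zero {r M n : ℕ} (h : r ≤ M) (hr : 0 < r) (hn : n ≠ 0) :
    partialPowerSum k r M n h ≠ 0 := by
  intro h0
  have hc := congrArg (coeff (Finsupp.single (Fin.castLE h ⟨0, hr⟩) n)) h0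
  rw [partialPowerSum, coeff_sum, coeff_zero] at hc
  simp_rw [X_pow_eq_monomial, coeff_monomial] at hc
  rw [Finset.sum_eq_single ⟨0, hr⟩ (fun b _ hb => if_neg fun heq => hb ?_) (by simp), if_pos rfl] at hc
  · exact one_ne_zero hc
  · exact Fin.castLE_injective h (Finsupp.single_left_injective hn heq)

/-- `ι(Pow_{m,r}^n) ⊆ Pow_{M,r}^n` for an injection `ι` of the variables.
[cite: DorflerIkenmeyerPanova2020, §2 (arXiv p. 3)] -/
theorem rename_mem_powerSumSet {m M r n : ℕ} {ι : Fin m → Fin M} (hι : Function.Injective ι)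
    {p : MvPolynomial (Fin m) k} (hp : p ∈ powerSumSet k m r n) : rename ι p ∈ powerSumSet k M r n := by
  obtain ⟨a, rfl⟩ := hp
  exact ⟨fun i => Function.extend ι (a i) 0, by simp only [map_sum, map_pow, rename_linearForm hι]⟩

/-- Killing the variables off `range ι` in a translate `A · (x₁^n+⋯+x_r^n)` gives a sum of `r` `n`-th
powers of linear forms in the letters of `ι`. [cite: DorflerIkenmeyerPanova2020, §2 (arXiv p. 3)] -/
theorem killCompl_linSubst_partialPowerSum_mem {m M r n : ℕ} {ι : Fin m → Fin M}
    (hι : Function.Injective ι) (h : r ≤ M) (A : Matrix (Fin M) (Fin M) k) :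
    killCompl hι (linSubst (Fin M) k A (partialPowerSum k r M n h)) ∈ powerSumSet k m r n := by
  refine ⟨fun i j => A (ι j) (Fin.castLE h i), ?_⟩
  simp only [partialPowerSum, map_sum, map_pow, linSubst_X, smul_eq_C_mul, map_mul,
    MvPolynomial.algHom_C, MvPolynomial.algebraMap_eq]
  refine Finset.sum_congr rfl fun i _ => ?_
  rw [sum_eq_sum_app hι (fun y => C (A y (Fin.castLE h i)) * killCompl hι (X y)) fun y hy => by
    rw [killCompl_X_of_not_mem hι hy, mul_zero]]
  simp only [killCompl_X_app, linearForm]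

/-- **`Pow_{m,r}^n` and the `m`-letter part of `\overline{GL_M(x₁^n+⋯+x_r^n)}` have the same equations**
(`1 ≤ r ≤ M`, `n ≥ 1`, infinite field; the power-sum analogue of `vanishingIdeal_chowSet_eq_letterPart`,
valid also for `r > m`, where `Pow_{m,r}^n` is not an orbit closure of an `m`-ary form).
[cite: DorflerIkenmeyerPanova2020, §2 (Pow_{m,k}^n, arXiv p. 3) with Lemma 3.4 (proof pattern, arXiv p. 5)] -/
theorem vanishingIdeal_powerSumSet_eq_letterPart [Infinite k] {m M r n : ℕ} {ι : Fin m → Fin M}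
    (hι : Function.Injective ι) (h : r ≤ M) (hr : 0 < r) (hn : n ≠ 0) :
    MvPolynomial.vanishingIdeal k (formCoeff n '' powerSumSet k m r n) =
      MvPolynomial.vanishingIdeal k (formCoeff n ''
        {p : MvPolynomial (Fin m) k | rename ι p ∈ orbitClosure (partialPowerSum k r M n h)}) := by
  apply le_antisymm
  · intro F hF
    rw [MvPolynomial.mem_vanishingIdeal_iff] at hF
    have hmem : rename (degIdxMap hι) F ∈ orbitVanishingIdeal (partialPowerSum k r M n h) n := by
      rw [mem_orbitVanishingIdeal_iff]
      intro g
      rw [aeval_formCoeff_rename_degIdxMap, linSubstRep_apply]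
      exact hF _ ⟨_, killCompl_linSubst_partialPowerSum_mem hι h _, rfl⟩
    rw [MvPolynomial.mem_vanishingIdeal_iff]
    rintro _ ⟨p, hp, rfl⟩
    exact (rename_mem_orbitVanishingIdeal_iff_forall_orbitClosure hι
      (partialPowerSum_isHomogeneous k r M n h) (partialPowerSum_ne_zero h hr hn) F).mp hmem p hp
  · refine MvPolynomial.vanishingIdeal_anti_mono (Set.image_mono ?_)
    intro p hp
    exact endOrbit_subset_orbitClosure_holds _
      (powerSumSet_subset_endOrbit h n (rename_mem_powerSumSet hι hp))

/-- **Few letters for power sums, weight form**: for `m ≤ M`, `1 ≤ r ≤ M`, `n ≥ 1` (characteristic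
zero), `mult_χ ℂ[Pow_{m,r}^n] = mult_{χ ext} ℂ[\overline{GL_M(x₁^n+⋯+x_r^n)}]` with `χ` extended by zero
along the top embedding. [cite: DorflerIkenmeyerPanova2020, §2 (arXiv p. 3) with Lemma 3.4 (inheritance, arXiv p. 5)] -/
theorem coordRingMultiplicity_powerSumSet_eq_orbitMultiplicity_extend [CharZero k] {m M r n : ℕ}
    (hmM : m ≤ M) (h : r ≤ M) (hr : 0 < r) (hn0 : n ≠ 0) (χ : Weight (Fin m)) :
    coordRingMultiplicity k (powerSumSet k m r n) n χ =
      orbitMultiplicity k (partialPowerSum k r M n h) n (Function.extend (topEmb hmM) χ 0) := by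
  haveI : Infinite k := CharZero.infinite k
  have hh := orbitMultiplicity_extend_add_finrank_eq_plethysmCoeff (topEmb_strictMono hmM)
    (isUpperSet_range_topEmb hmM) (partialPowerSum_isHomogeneous k r M n h)
    (partialPowerSum_ne_zero h hr hn0) hn0 χ
  unfold coordRingMultiplicity
  rw [vanishingIdeal_powerSumSet_eq_letterPart (topEmb_strictMono hmM).injective h hr hn0, ← hh]
  exact Nat.add_sub_cancel _ _

/-- **Inheritance for power sums, partition form**: for `λ` with at most `m ≤ m'` parts, `r ≥ 1`,
`n ≥ 1`, `mult_λ(ℂ[Pow_{m,r}^n]_d) = mult_λ(ℂ[Pow_{m',r}^n]_d)` (both are the multiplicity of `λ^*` in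
the orbit closure of `x₁^n+⋯+x_r^n` in `max(m', r)` letters).
[cite: DorflerIkenmeyerPanova2020, §2 (arXiv p. 3) with Lemma 3.4 (inheritance, arXiv p. 5)] -/
theorem coordRingMultiplicity_powerSumSet_dualOfPartition_eq_of_le {m m' r n s : ℕ} (hmm' : m ≤ m')
    (hr : 0 < r) (hn0 : n ≠ 0) (lam : Nat.Partition s) (hlam : lam.parts.card ≤ m) :
    coordRingMultiplicity ℂ (powerSumSet ℂ m r n) n (Weight.dualOfPartition m lam) =
      coordRingMultiplicity ℂ (powerSumSet ℂ m' r n) n (Weight.dualOfPartition m' lam) := by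
  have hM : m ≤ max m' r := hmm'.trans (le_max_left _ _)
  have hM' : m' ≤ max m' r := le_max_left _ _
  have hrM : r ≤ max m' r := le_max_right _ _
  rw [coordRingMultiplicity_powerSumSet_eq_orbitMultiplicity_extend hM hrM hr hn0,
    coordRingMultiplicity_powerSumSet_eq_orbitMultiplicity_extend hM' hrM hr hn0,
    ← dualOfPartition_eq_extend_topEmb hM lam hlam,
    ← dualOfPartition_eq_extend_topEmb hM' lam (hlam.trans hmm')]

/-- **The power-sum side of Thm. 2.3 (2)(b) from Prop. 3.2**: `mult_{(47,7,2)}(ℂ[Pow_{4,4}^7]_8) = 11`,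
printed in Prop. 3.2 for three variables (`Pow_{3,4}^7`) and transported to `m = 4` by the inheritance
for power sums. [cite: DorflerIkenmeyerPanova2020, Thm. 2.3 (2)(b) (arXiv p. 4) with Prop. 3.2] -/
theorem dip20_thm_2_3_2b_pow_eq_of_prop_3_2 (h32 : DIP20_prop_3_2) :
    coordRingMultiplicity ℂ (powerSumSet ℂ 4 4 7) 7
      (Weight.dualOfPartition 4 (dipPartition 7 two_le_seven)) = 11 := by
  rw [← coordRingMultiplicity_powerSumSet_dualOfPartition_eq_of_le (show 3 ≤ 4 by norm_num)
    (by norm_num) (by norm_num) (dipPartition 7 two_le_seven) (card_parts_dipPartition_le 7 two_le_seven)]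
  exact h32.2.2.1

/-- **Thm. 2.3 (2)(b) from the three computer facts** Prop. 3.2, Prop. 7.1, Prop. 5.1 (no further
hypothesis): Chow side `< 11` and power-sum side `= 11` from Prop. 3.2 (the latter through the
power-sum inheritance `3 → 4` variables), the no-occurrence clause from Props. 7.1 and 5.1.
[cite: DorflerIkenmeyerPanova2020, Thm. 2.3 (2)(b) (arXiv p. 4; proof §3, §5–§7)] -/
theorem DIP20_thm_2_3_2b_of_facts' (h32 : DIP20_prop_3_2) (h71 : DIP20_prop_7_1)
    (h51 : DIP20_prop_5_1) : DIP20_thm_2_3_2b :=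
  DIP20_thm_2_3_2b_of_facts h32 (dip20_thm_2_3_2b_pow_eq_of_prop_3_2 h32) h71 h51

end FewLettersPow

/-! ### §P. The `←` halves of Props. 3.9 / 7.1 reduce to the positivity of the generators (certificate interface) -/

section GeneratorPositivity

/-- **The trivial type occurs in `ℂ[𝔸_m^n]`**: `a_0(0[n]) > 0`, i.e. the constants are highest-weight
vectors of weight `0 = 0^*` in `ℂ[Sym^n ℂ^m]` (`n ≥ 1`). [cite: DorflerIkenmeyerPanova2020, §3 (the semigroup of positive plethysm coefficients, (3.8), arXiv p. 6)] -/
theorem plethysmCoeff_rowDual_zero_pos {m n : ℕ} (hn : n ≠ 0) :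
    0 < plethysmCoeff ℂ (Fin m) n (rowDual (0 : Fin m → ℕ)) := by
  have h0 : rowDual (0 : Fin m → ℕ) = 0 := by
    funext i
    simp [rowDual, Weight.dual]
  haveI : FiniteDimensional ℂ ↥(highestWeightSpace (coordRep (Fin m) ℂ n) (rowDual (0 : Fin m → ℕ))) :=
    finiteDimensional_highestWeightSpace_coordRep_holds hn _
  unfold plethysmCoeff hwMultiplicity
  refine Module.finrank_pos_iff_exists_ne_zero.mpr ⟨⟨1, ?_⟩, fun h => one_ne_zero (congrArg Subtype.val h)⟩
  rw [h0, mem_highestWeightSpace_iff]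
  intro g _
  rw [coordRep_apply, map_one]
  simp [weightChar]

/-- **Positivity propagates along the semigroup generated by `X`** ((3.8) by closure induction): if
`a_μ(d[n]) > 0` for every `μ ∈ X`, then `a_μ(d[n]) > 0` for every `μ` in the additive monoid generated by
`X` (`n ≥ 1`; the degree `d = |μ|/n` is pinned by the weight). This is the mechanism of the `←` halves of
Props. 3.9 and 7.1 ("they form a finitely generated semigroup and hence we only need to find the
semigroup's generators", arXiv p. 6). [cite: DorflerIkenmeyerPanova2020, eq. (3.8) and Prop. 3.9 (arXiv p. 6; TeX multobs.tex L409–L418)] -/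
theorem plethysmCoeff_pos_of_mem_closure {m n : ℕ} (hn : n ≠ 0) {X : Set (Fin m → ℕ)}
    (hX : ∀ μ ∈ X, 0 < plethysmCoeff ℂ (Fin m) n (rowDual μ)) {μ : Fin m → ℕ}
    (hμ : μ ∈ AddSubmonoid.closure X) : 0 < plethysmCoeff ℂ (Fin m) n (rowDual μ) :=
  AddSubmonoid.closure_induction (motive := fun x _ => 0 < plethysmCoeff ℂ (Fin m) n (rowDual x))
    (fun x hx => hX x hx) (plethysmCoeff_rowDual_zero_pos hn)
    (fun x y _ _ hx hy => DIP20_eq_3_8_holds m n x y (Nat.pos_of_ne_zero hn) hx hy) hμ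

/-- **Prop. 3.9, `←` half, from the positivity of the 89 generators** (certificate interface: one
nonzero highest-weight vector of `ℂ[Sym^6 ℂ^3]` per row of `X`; in print "calculated with the LiE
software", `a_{(45,45)}(15[6]) > 0` by Sturmfels' formula). [cite: DorflerIkenmeyerPanova2020, Prop. 3.9 (proof, arXiv p. 6; TeX multobs.tex L414 {pro:listofgenerators})] -/
theorem DIP20_prop_3_9_mpr_of_generators_pos
    (hX : ∀ μ ∈ dipGenerators36, 0 < plethysmCoeff ℂ (Fin 3) 6 (rowDual μ)) :
    ∀ μ : Fin 3 → ℕ, μ ∈ AddSubmonoid.closure dipGenerators36 → 0 < plethysmCoeff ℂ (Fin 3) 6 (rowDual μ) :=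
  fun _ hμ => plethysmCoeff_pos_of_mem_closure (by norm_num) hX hμ

/-- **Prop. 7.1, `←` half, from the positivity of the 948 generators** (certificate interface; in print
LiE for `μ ∈ X ∖ {(49,49), (24,24,23,23)}` and the Chow computation for those two, arXiv p. 7).
[cite: DorflerIkenmeyerPanova2020, Prop. 7.1 (arXiv p. 16; TeX multobs.tex L906 {pro:listofgenerators74})] -/
theorem DIP20_prop_7_1_mpr_of_generators_pos
    (hX : ∀ μ ∈ dipGenerators47, 0 < plethysmCoeff ℂ (Fin 4) 7 (rowDual μ)) :
    ∀ μ : Fin 4 → ℕ, μ ∈ AddSubmonoid.closure dipGenerators47 → 0 < plethysmCoeff ℂ (Fin 4) 7 (rowDual μ) :=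
  fun _ hμ => plethysmCoeff_pos_of_mem_closure (by norm_num) hX hμ

/-- Conversely the generators themselves must have positive coefficients under Prop. 3.9 (so the
certificate list is exactly what the `←` half needs). [cite: DorflerIkenmeyerPanova2020, Prop. 3.9 (arXiv p. 6)] -/
theorem DIP20_prop_3_9.generators_pos (h : DIP20_prop_3_9) :
    ∀ μ ∈ dipGenerators36, 0 < plethysmCoeff ℂ (Fin 3) 6 (rowDual μ) :=
  fun μ hμ => (h μ (antitone_of_mem_dipGenerators36 hμ)).2 (AddSubmonoid.subset_closure hμ)

end GeneratorPositivity

/-! ### §Q. Thm. 3.5 and the elementary clauses of Cor. 4.8 from Prop. 4.7 (coefficient extraction) -/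

section Theorem35FromProp47

open PowerSeries
open _root_.Literature.NumberTheory.DiophantineGeometry

/-- `p_0(a,b) = 1` (the empty partition). [cite: DorflerIkenmeyerPanova2020, §4 (arXiv p. 9)] -/
theorem boxPartitionCount_zero (a b : ℕ) : boxPartitionCount 0 a b = 1 := by
  unfold boxPartitionCount
  haveI : Unique {μ : Nat.Partition 0 // μ.parts.card ≤ a ∧ ∀ x ∈ μ.parts, x ≤ b} :=
    { default := ⟨default, by simp, by simp⟩
      uniq := fun μ => Subtype.ext (Subsingleton.elim _ _) }
  exact Nat.card_unique

/-- The constant term of `binom(a+b,a)_q` (read in `ℚ⟦q⟧`) is `p_0(a,b) = 1`. [cite: DorflerIkenmeyerPanova2020, §4 (arXiv p. 9)] -/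
theorem constantCoeff_toRatPowerSeries_gaussBinomial (a b : ℕ) :
    PowerSeries.constantCoeff (toRatPowerSeries (gaussBinomial a b)) = 1 := by
  rw [toRatPowerSeries, Polynomial.constantCoeff_coe, Polynomial.coeff_map, gaussBinomial,
    Polynomial.finsetSum_coeff]
  simp_rw [Polynomial.coeff_C_mul, Polynomial.coeff_X_pow]
  simp [boxPartitionCount_zero]

/-- **Prop. 4.7's series at `d = n+1`** is `q^n` times a power series with constant term `1`:
`binom(2n-1,n-1)_q (q^n - q^{n+1})(1-q^n)(1-q^{n-1}) / ((1-q^{n+1})(1-q^n))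
 = q^n · (1-q)(1-q^{n-1}) binom(2n-1,n-1)_q / (1-q^{n+1})` (the manipulation of the proof of
Cor. 4.8, arXiv p. 12, before Stanley's formula). [cite: DorflerIkenmeyerPanova2020, Cor. 4.8 (proof, arXiv p. 12)] -/
theorem dip_prop47_series_succ (n : ℕ) (hn : 1 ≤ n) :
    toRatPowerSeries (gaussBinomial (n - 1) (n + 1 - 1)) * (PowerSeries.X ^ n - PowerSeries.X ^ (n + 1)) *
        (1 - PowerSeries.X ^ (n + 1 - 1)) * (1 - PowerSeries.X ^ (n - 1)) * ((1 - PowerSeries.X ^ (n + 1)) * (1 - PowerSeries.X ^ n))⁻¹ =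
      PowerSeries.X ^ n * ((1 - PowerSeries.X) * (1 - PowerSeries.X ^ (n - 1)) * toRatPowerSeries (gaussBinomial (n - 1) n) *
        (1 - PowerSeries.X ^ (n + 1))⁻¹) := by
  rw [Nat.add_sub_cancel]
  set F := toRatPowerSeries (gaussBinomial (n - 1) n)
  have hB : PowerSeries.constantCoeff ((1 : PowerSeries ℚ) - PowerSeries.X ^ n) ≠ 0 := by
    rw [map_sub, map_pow, PowerSeries.constantCoeff_X, zero_pow (by omega), map_one, sub_zero]
    exact one_ne_zero
  rw [PowerSeries.mul_inv_rev]
  calc F * (PowerSeries.X ^ n - PowerSeries.X ^ (n + 1)) * (1 - PowerSeries.X ^ n) * (1 - PowerSeries.X ^ (n - 1)) *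
        ((1 - PowerSeries.X ^ n)⁻¹ * (1 - PowerSeries.X ^ (n + 1))⁻¹)
      = PowerSeries.X ^ n * ((1 - PowerSeries.X) * (1 - PowerSeries.X ^ (n - 1)) * F * (1 - PowerSeries.X ^ (n + 1))⁻¹) *
          ((1 - PowerSeries.X ^ n) * (1 - PowerSeries.X ^ n)⁻¹) := by ring
    _ = _ := by rw [PowerSeries.mul_inv_cancel _ hB, mul_one]

/-- The constant term of `(1-q)(1-q^{n-1}) binom(2n-1,n-1)_q / (1-q^{n+1})` is `1` (`n ≥ 2`).
[cite: DorflerIkenmeyerPanova2020, Cor. 4.8 (proof, arXiv p. 12)] -/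
theorem constantCoeff_dip_cor48_factor (n : ℕ) (hn : 2 ≤ n) :
    PowerSeries.constantCoeff ((1 - PowerSeries.X) * (1 - PowerSeries.X ^ (n - 1)) * toRatPowerSeries (gaussBinomial (n - 1) n) *
        ((1 : PowerSeries ℚ) - PowerSeries.X ^ (n + 1))⁻¹) = 1 := by
  rw [map_mul, map_mul, map_mul, PowerSeries.constantCoeff_inv,
    constantCoeff_toRatPowerSeries_gaussBinomial]
  simp [zero_pow (show n - 1 ≠ 0 by omega)]

/-- **Cor. 4.8, clauses `r < n` and `r = n`, from Prop. 4.7** (`d = n+1`, `λ = (n²+n-2-r, r, 2)`,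
`2 ≤ r`, `2r ≤ n²+n-2`): `a_λ((n+1)[n]) - a_λ(n[n+1])` is `0` for `r < n` and `1` for `r = n` — the
series of Prop. 4.7 is `q^n` times a series with constant term `1`. (The remaining clauses of
Cor. 4.8 need the unimodality of Gaussian coefficients [PP13] and are not derived here.)
[cite: DorflerIkenmeyerPanova2020, Cor. 4.8 (arXiv p. 12; TeX multobs.tex L689 {cor:keyinequality})] -/
theorem dip_cor48_diff_of_prop_4_7 (h : DIP20_prop_4_7) {n r : ℕ} (hn : 2 ≤ n) (hr : 2 ≤ r)
    (hrn : r ≤ n) (h2r : 2 * r ≤ n ^ 2 + n - 2) :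
    ((plethysmCoeff ℂ (Fin 3) n (rowDual (dipFamilyRow n r)) : ℚ) -
        (plethysmCoeff ℂ (Fin 3) (n + 1) (rowDual (dipFamilyRow n r)) : ℚ)) =
      (if r = n then 1 else 0 : ℚ) := by
  have hL : n ^ 2 + n - 2 - r + r + 2 = (n + 1) * n := by
    have h4 : 4 ≤ n ^ 2 := by nlinarith
    have hmul : (n + 1) * n = n ^ 2 + n := by ring
    rw [hmul]
    generalize n ^ 2 = q at *
    omega
  have h47 := h n (n + 1) (n ^ 2 + n - 2 - r) r hn (by omega) hr (by omega) hL
  unfold dipFamilyRow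
  rw [h47, dip_prop47_series_succ n (by omega), PowerSeries.coeff_X_pow_mul']
  split_ifs with h1 h2 h2
  · subst h2
    rw [Nat.sub_self, PowerSeries.coeff_zero_eq_constantCoeff_apply, constantCoeff_dip_cor48_factor _ hn]
  · omega
  · omega
  · rfl

/-- **Theorem 3.5 from Prop. 4.7** ("`a_{(n²-2,n,2)}((n+1)[n]) = 1 + a_{(n²-2,n,2)}(n[n+1])`", the
case `r = n`): a direct coefficient extraction, bypassing the unimodality clauses of Cor. 4.8.
[cite: DorflerIkenmeyerPanova2020, Thm. 3.5 (arXiv p. 5) and Cor. 4.8 (proof, arXiv p. 12)] -/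
theorem DIP20_thm_3_5_of_prop_4_7 (h : DIP20_prop_4_7) : DIP20_thm_3_5 := by
  intro n hn
  have hr : 2 * n ≤ n ^ 2 + n - 2 := by
    have h4 : 2 * n ≤ n ^ 2 := by rw [pow_two]; exact Nat.mul_le_mul_right n hn
    generalize n ^ 2 = q at h4 ⊢
    omega
  have hd := dip_cor48_diff_of_prop_4_7 h hn hn le_rfl hr
  rw [if_pos rfl, dipFamilyRow_self, rowDual_dipFamilyRow_self hn] at hd
  unfold plethysmCoeffOfPartition
  have : (plethysmCoeff ℂ (Fin 3) n (Weight.dualOfPartition 3 (dipPartition n hn)) : ℚ) =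
      1 + (plethysmCoeff ℂ (Fin 3) (n + 1) (Weight.dualOfPartition 3 (dipPartition n hn)) : ℚ) := by
    linarith
  exact_mod_cast this

end Theorem35FromProp47

end Literature.Computability.AlgebraicComplexity
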